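import Literature.MathematicalPhysics.QuantumFieldTheory.Balaban1983to89.B4Cor23Zero
import Literature.MathematicalPhysics.QuantumFieldTheory.Balaban1983to89.B4TwoRegion120

/-!
# B4 Corollary 2.3, the `δG_k(Ω, Ω₀, 0)` clause at zero field — kernel certificate

T. Bałaban, *Regularity and decay of lattice Green's functions*, Commun. Math. Phys. **89** (1983) 571–597 (= B4),
p. 573 (1.11) and p. 581 (end of Corollary 2.3).  PRINTED (transcript `HOME/b2b-balaban-b04/transcript-B4.md`):

* p. 573: «If Ω ⊂ Ω₀, then for δG_k(Ω,Ω₀,A) defined by the equality (1.11) δG_k(Ω,Ω₀,A) = G_k(Ω,A) − G_k(Ω₀,A), we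
  have the inequalities …»
* p. 580–581, Corollary 2.3: «(2.30) |⟨f, G_k(Ω,A)f'⟩|, |⟨f, D^η_{A,μ}G_k(Ω,A)f'⟩|, |⟨f, G_k(Ω,A)D^{η*}_{A,ν}f'⟩|,
  |⟨f, D^η_{A,μ}G_k(Ω,A)D^{η*}_{A,ν}f'⟩| ≤ c₀e^{−δ₀dist(supp f, supp f')}‖f‖₂‖f'‖₂.» and then
  «The same inequalities hold for δG_k(Ω,Ω₀,A) with the additional factor e^{−δ₀(dist(supp f,Ω^c) + dist(supp f',Ω^c))}.»

WHAT IS PROVED HERE (zero external field `A = 0`, every mesh `η = 1/n`, every pair of finite unions of `n`-blocks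
`R ⊆ R₀` — the fine points of `Ω ⊆ Ω₀` —, every mass `m² ≥ 0`, every `a > 0`), on the concrete carriers of
`B4Cor23Zero` (counting `ℓ²`, `H_R = B4Lower18.fineOpR n a m² R`, `G = H_R⁻¹`, `G₀ = H_{R₀}⁻¹`, `D_μ = fdiff`,
`D_ν^⊤ = fdiffT`): with `δG g := G g − (G₀ (ext g))|_R` (`ext` = extension by zero to `R₀`; §1) the FOUR PAIRINGS
`|⟨f, δG f'⟩|, |⟨f, D_μ δG f'⟩|, |⟨f, δG D_ν^⊤ f'⟩|, |⟨f, D_μ δG D_ν^⊤ f'⟩|` are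
`≤ c₁(d,a) · e^{−(δ₀/2)(dist_η(supp f, supp f') + dist_η(supp f, R₀∖R) + dist_η(supp f', R₀∖R))} ‖f‖₂ ‖f'‖₂`
with `δ₀ = B4Cor23Zero.delta0 d a` and an explicit `c₁(d,a)` (`dcor23_zeroField`).  Since `Ω₀∖Ω ⊆ Ω^c`, the distance to
`R₀∖R` dominates the printed `dist(·, Ω^c)`, so this is the printed sentence at `A = 0` (with rate `δ₀/2`; the
print only asserts the existence of some `δ₀ > 0`).

Mechanism (for the referee; the paper re-runs its random-walk expansion — here a direct energy argument).  Let `χ` be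
the `η`-Lipschitz cutoff `χ = min(1, max(0, dist_η(·, R₀∖R) − η))` on `R` (`= 0` on the sites of `R` with a neighbour
in `R₀∖R`, `= 1` at `η`-distance `≥ 1 + η`), `u = G g'`, and `W = ext(χu) − G₀ ext g'` on `R₀`.  Because `R` is a
union of blocks, `H_{R₀}` and `H_R` have the same off-diagonal entries between sites of `R`, the same diagonal off the
boundary layer, and no entry from `R₀∖R` into `R` minus the boundary layer; hence `H_{R₀} ext(v) = ext(H_R v)` for `v`
vanishing on the layer (§2), and `H_{R₀} W = ext([H_R, χ]u − (1−χ)g')` while `δG g' = (1−χ)u + W|_R` (§3).  The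
commutator and `(1−χ)` live in the collar `{dist_η(·,R₀∖R) ≤ 3}`; a Combes–Thomas energy estimate for `W` with a
`δ`-Lipschitz weight `φ ≤ ψ − δ·dist_η(supp f', R₀∖R)` on the collar (`ψ = δ dist_η(·, supp f')` the source weight of
`B4Cor23Zero`), using only first differences of `χ` (the commutator pairing is antisymmetrised), the weighted bounds on
`u, D_μu` of `B4Cor23Zero` (`energyA/B`), the Dirichlet-form bound `Σ(D_μw)² ≤ ⟨w,Hw⟩` and the elementary
`pq ≤ (ε/2)p² + q²/(2ε)` with the two countings "`≤ 2(d+1)` neighbours", "`n^{d+1}` points per block" (§4–§5), gives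
`⟨w, H_{R₀} w⟩ ≤ 8e^{4δ} e^{−2δ dist_η(supp f',R₀∖R)} (α(d,a)β(d,a) + γ(d,a)) ‖f'‖²` (`energyW_le`, `master_setSq_le`);
an inf-convolution weight `φ = δ·min_{c ∈ collar}(dist_η(c, supp f') + dist_η(·, c)) − δ·dist_η(supp f',R₀∖R)` then
extracts the values and `η`-differences of `W` and of `(1−χ)u` on `supp f` (§6–§8), and §9 assembles
`dcor23_zeroField` with `δ = δ₀(d,a)` (admissible by `B4Cor23Zero.delta0_admissible`) and
`c₁(d,a) = √(2e^{10}K(d,a))`, `K` the explicit rational function of `d, a, min(2,a)` of §7 (`KC`).  Degenerate cases: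
`R₀ = R` gives `δG = 0` (`dG_self`), `f' = 0` gives zero pairings.

MAIN DECLARATIONS: `dG` (§3), `bdist`, `cutF`, `collar`, `phiW` (§8), `energyW_le` (§5), `master_setSq_le` (§7),
`core_setSq`, `dcor23_zeroField`, `dcor23_zeroField_fineDom`, the closing numeric `example` (§9).

## DICTIONARY (as in `B4Cor23Zero`, plus)

* `Ω ⊆ Ω₀` ↔ `R ⊆ R₀`, both `IsBlockUnion n`; `G_k(Ω₀,0)` acts on functions on `Ω₀`, and `⟨f, δG_k(Ω,Ω₀,0) f'⟩` for
  `f, f'` on `Ω` means `⟨f, G_k(Ω,0)f'⟩ − ⟨ext f, G_k(Ω₀,0) ext f'⟩` (extension by zero), i.e. our `f ⬝ᵥ dG f'` with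
  `dG g = G g − (G₀ ext g)|_R` (`dot_extTo`); the derivative `D^η_{0,μ}` in the `δG` pairings is the one of `Ω` (bonds of
  `Ω`; on functions supported in `Ω` at distance `≥ η` from `Ω₀∖Ω` it agrees with that of `Ω₀`).
* `dist(supp f, Ω^c)` ↔ dominated by `bdist f = dist_η(supp f, R₀∖R)` (sup-norm, `η`-units; `0` if a set is empty).

## HONEST SCOPE

* `A = 0` ONLY, as in `B4Cor23Zero`; real scalar `f, f'`; finite unions of blocks; sup-norm distances; rate `δ₀/2` and a
  polynomial-in-`(d, a, 1/min(2,a))` constant times `e^{5}`, no sharpness attempted.  The typed leaf `B4.Cor23Printed`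
  (abstract `EtaSetting` family) is not instantiated in this file.
* The printed clause is for general `Ω ⊂ Ω₀` built from unit cubes; here `Ω ⊆ Ω₀` are arbitrary finite unions of
  `n`-blocks (`IsBlockUnion`), in particular the fine regions `fineDom n Ω ⊆ fineDom n Ω₀` of finite label sets
  `Ω ⊆ Ω₀ ⊂ ℤ^{d+1}` (`dcor23_zeroField_fineDom`); infinite `Ω₀` (e.g. the whole lattice or the torus of the later
  sections) is NOT covered.

Value = kernel certificate of a published inequality in a special case (the `δG` clause of B4 Cor. 2.3 at `A = 0`);
NOT summit progress.
-/

namespace Literature.MathematicalPhysics.QuantumFieldTheory.Balaban1983to89.B4Cor23ZeroDelta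

open Finset Matrix
open Literature.MathematicalPhysics.QuantumFieldTheory.Balaban1983to89.B4ContourShift (supNorm supNorm_nonneg)
open Literature.MathematicalPhysics.QuantumFieldTheory.Balaban1983to89.B4Reflection242
open Literature.MathematicalPhysics.QuantumFieldTheory.Balaban1983to89.B4BoxCov237
open Literature.MathematicalPhysics.QuantumFieldTheory.Balaban1983to89.B4Lower18
open Literature.MathematicalPhysics.QuantumFieldTheory.Balaban1983to89.B4Cor23Zero
open Beta.CombesThomasForm (lap lapDefect_le blockDefect_le)
open Beta.CombesThomasFormOp (distTo distTo_le le_distTo distTo_le_zero_of_mem abs_distTo_sub_le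
  conjError_lap_add_blocks_ge weightedSq_le_of_support setSq_le_of_weightedSq)

noncomputable section

variable {d : ℕ}

/-! ## §1  Two nested regions: inclusion, extension by zero, restriction

The inclusion `incl h : ↥R → ↥R₀` of nested finite sets of sites and its injectivity are REUSED from the landed
module `B4TwoRegion120` (§2 there; same one-line definition) and re-exported under this namespace. -/

export Literature.MathematicalPhysics.QuantumFieldTheory.Balaban1983to89.B4TwoRegion120 (incl incl_val incl_injective)

section Nested

variable {n : ℕ} {R R₀ : Finset (Fin (d + 1) → ℤ)}

/-- extension by zero from `R` to `R₀`. [folklore] -/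
def extTo (R₀ : Finset (Fin (d + 1) → ℤ)) (u : ↥R → ℝ) (y : ↥R₀) : ℝ := extR u y.1

/-- restriction from `R₀` to `R`. [folklore] -/
def resTo (h : R ⊆ R₀) (U : ↥R₀ → ℝ) (x : ↥R) : ℝ := U (incl h x)

/-- the extension agrees with the function on `R`. [folklore] -/
theorem extTo_incl (h : R ⊆ R₀) (u : ↥R → ℝ) (x : ↥R) : extTo R₀ u (incl h x) = u x := by
  simp [extTo, incl, extR_of_mem u x.2]

/-- the extension vanishes off `R`. [folklore] -/
theorem extTo_of_not_mem (u : ↥R → ℝ) (y : ↥R₀) (hy : y.1 ∉ R) : extTo R₀ u y = 0 := by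
  simp [extTo, extR_of_not_mem u hy]

/-- restriction after extension is the identity. [folklore] -/
theorem resTo_extTo (h : R ⊆ R₀) (u : ↥R → ℝ) : resTo h (extTo R₀ u) = u := by
  funext x; exact extTo_incl h u x

/-- extension is compatible with subtraction. [folklore] -/
theorem extTo_sub (u v : ↥R → ℝ) : extTo R₀ (u - v) = extTo R₀ u - extTo R₀ v := by
  funext y
  by_cases hy : y.1 ∈ R
  · simp [extTo, extR_of_mem _ hy]
  · simp [extTo, extR_of_not_mem _ hy]

/-- restriction is compatible with subtraction. [folklore] -/
theorem resTo_sub (h : R ⊆ R₀) (U V : ↥R₀ → ℝ) : resTo h (U - V) = resTo h U - resTo h V := by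
  funext x; simp [resTo]

/-- **Reindexing**: a sum over `R₀` against an extension by zero is a sum over `R`. [folklore] -/
theorem sum_extTo_mul (h : R ⊆ R₀) (u : ↥R → ℝ) (F : ↥R₀ → ℝ) :
    ∑ y, extTo R₀ u y * F y = ∑ x, u x * F (incl h x) := by
  classical
  set G : (Fin (d + 1) → ℤ) → ℝ := fun z => if hz : z ∈ R₀ then F ⟨z, hz⟩ else 0 with hG
  have hF : ∀ y : ↥R₀, F y = G y.1 := fun y => by simp [hG, y.2]
  calc ∑ y, extTo R₀ u y * F y = ∑ y : ↥R₀, (fun z => extR u z * G z) y.1 :=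
        Finset.sum_congr rfl fun y _ => by simp only [extTo, hF]
    _ = ∑ z ∈ R₀, extR u z * G z := Finset.sum_coe_sort R₀ (fun z => extR u z * G z)
    _ = ∑ z ∈ R, extR u z * G z := by
        symm
        refine Finset.sum_subset h ?_
        intro z _ hzR
        rw [extR_of_not_mem u hzR, zero_mul]
    _ = ∑ x : ↥R, (fun z => extR u z * G z) x.1 := (Finset.sum_coe_sort R _).symm
    _ = ∑ x, u x * F (incl h x) := Finset.sum_congr rfl fun x _ => by
        simp only [extR_of_mem u x.2, hG, dif_pos (h x.2), incl]

/-- `⟨ext u, U⟩_{R₀} = ⟨u, U|_R⟩_R`. [folklore] -/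
theorem dot_extTo (h : R ⊆ R₀) (u : ↥R → ℝ) (U : ↥R₀ → ℝ) : extTo R₀ u ⬝ᵥ U = u ⬝ᵥ resTo h U := by
  simp only [dotProduct, resTo]
  exact sum_extTo_mul h u U

/-- a matrix of `R₀` applied to an extension by zero. [folklore] -/
theorem mulVec_extTo_apply (h : R ⊆ R₀) (M : Matrix ↥R₀ ↥R₀ ℝ) (u : ↥R → ℝ) (y : ↥R₀) :
    M.mulVec (extTo R₀ u) y = ∑ x, M y (incl h x) * u x := by
  simp only [mulVec, dotProduct]
  calc ∑ y', M y y' * extTo R₀ u y' = ∑ y', extTo R₀ u y' * M y y' := Finset.sum_congr rfl fun _ _ => mul_comm _ _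
    _ = ∑ x, u x * M y (incl h x) := sum_extTo_mul h u (fun y' => M y y')
    _ = ∑ x, M y (incl h x) * u x := Finset.sum_congr rfl fun _ _ => mul_comm _ _

/-- sums of non-negative terms over `R` (through `incl`) are bounded by sums over `R₀`. [folklore] -/
theorem sum_incl_le (h : R ⊆ R₀) (F : ↥R₀ → ℝ) (hF : ∀ y, 0 ≤ F y) (S : Finset ↥R) :
    ∑ x ∈ S, F (incl h x) ≤ ∑ y, F y := by
  classical
  calc ∑ x ∈ S, F (incl h x) = ∑ y ∈ S.map ⟨incl h, incl_injective h⟩, F y := by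
        rw [Finset.sum_map]; rfl
    _ ≤ ∑ y, F y := Finset.sum_le_sum_of_subset_of_nonneg (Finset.subset_univ _) fun y _ _ => hF y

/-- the `η`-distance is the same computed in `R` or in `R₀`. [folklore] -/
theorem edistR_incl (h : R ⊆ R₀) (x y : ↥R) : edistR n R₀ (incl h x) (incl h y) = edistR n R x y := rfl

end Nested

/-! ## §2  The two operators agree away from the boundary layer -/

section Kernel

variable {n : ℕ} {R R₀ : Finset (Fin (d + 1) → ℤ)} {a m2 : ℝ}

/-- the BOUNDARY LAYER of `R` inside `R₀`: sites of `R` with a nearest neighbour in `R₀∖R`. [folklore] -/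
def bdR (R R₀ : Finset (Fin (d + 1) → ℤ)) : Finset ↥R :=
  Finset.univ.filter fun y => ∃ z ∈ nbrs y.1, z ∈ R₀ ∧ z ∉ R

/-- membership in the boundary layer. [folklore] -/
theorem mem_bdR {y : ↥R} : y ∈ bdR R R₀ ↔ ∃ z ∈ nbrs y.1, z ∈ R₀ ∧ z ∉ R := by
  simp [bdR]

/-- the entries of `fineOpR`. [folklore] -/
theorem fineOpR_apply (n : ℕ) (a m2 : ℝ) (R : Finset (Fin (d + 1) → ℤ)) (x y : ↥R) :
    fineOpR n a m2 R x y
      = (n : ℝ) ^ 2 * neumannLapR R x.1 y.1 + (diagK m2 x.1 y.1 + avgK (a * ((n : ℝ) ^ (d + 1))⁻¹) n x.1 y.1) := rfl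

/-- off-diagonal entries between sites of `R` agree. [folklore] -/
theorem fineOpR_incl_offdiag (h : R ⊆ R₀) {x y : ↥R} (hxy : x.1 ≠ y.1) :
    fineOpR n a m2 R₀ (incl h x) (incl h y) = fineOpR n a m2 R x y := by
  rw [fineOpR_apply, fineOpR_apply]
  simp only [incl]
  unfold neumannLapR
  rw [if_neg (Ne.symm hxy), if_neg (Ne.symm hxy)]

/-- diagonal entries agree off the boundary layer. [folklore] -/
theorem fineOpR_incl_diag (h : R ⊆ R₀) {y : ↥R} (hy : y ∉ bdR R R₀) :
    fineOpR n a m2 R₀ (incl h y) (incl h y) = fineOpR n a m2 R y y := by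
  classical
  rw [fineOpR_apply, fineOpR_apply]
  simp only [incl]
  have hfilter : ((nbrs y.1).filter fun z => z ∈ R₀) = ((nbrs y.1).filter fun z => z ∈ R) := by
    refine Finset.filter_congr ?_
    intro z hz
    constructor
    · intro hz0
      by_contra hzR
      exact hy (mem_bdR.2 ⟨z, hz, hz0, hzR⟩)
    · intro hzR; exact h hzR
  unfold neumannLapR
  rw [if_pos rfl, if_pos rfl, hfilter]

/-- no entry from `R₀∖R` into `R` minus its boundary layer (`R` is a union of blocks, so the block-averaging part does
not couple `R` to `R₀∖R` either). [folklore] -/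
theorem fineOpR_out_in (hR : IsBlockUnion n R) (h : R ⊆ R₀) {y : ↥R} (hy : y ∉ bdR R R₀) {z : ↥R₀}
    (hz : z.1 ∉ R) : fineOpR n a m2 R₀ z (incl h y) = 0 := by
  rw [fineOpR_apply]
  simp only [incl]
  have hne : y.1 ≠ z.1 := fun e => hz (e ▸ y.2)
  have hnb : y.1 ∉ nbrs z.1 := by
    intro hyz
    exact hy (mem_bdR.2 ⟨z.1, nbrs_comm.1 hyz, z.2, hz⟩)
  have hblk : blk n y.1 ≠ blk n z.1 := by
    intro e
    exact hz (hR y.2 e.symm)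
  unfold neumannLapR diagK avgK
  rw [if_neg hne, if_neg hnb, if_neg hne, if_neg hblk]
  ring

/-- **`H_{R₀} ext(v) = ext(H_R v)` for `v` vanishing on the boundary layer.** [folklore] -/
theorem mulVec_extTo (hR : IsBlockUnion n R) (h : R ⊆ R₀) (v : ↥R → ℝ) (hv : ∀ y ∈ bdR R R₀, v y = 0) :
    (fineOpR n a m2 R₀).mulVec (extTo R₀ v) = extTo R₀ ((fineOpR n a m2 R).mulVec v) := by
  classical
  funext z
  rw [mulVec_extTo_apply h]
  by_cases hz : z.1 ∈ R
  · set z' : ↥R := ⟨z.1, hz⟩ with hz'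
    have hzz : z = incl h z' := Subtype.ext rfl
    rw [hzz, extTo_incl h]
    simp only [mulVec, dotProduct]
    refine Finset.sum_congr rfl fun x _ => ?_
    by_cases hvx : v x = 0
    · rw [hvx, mul_zero, mul_zero]
    · have hxb : x ∉ bdR R R₀ := fun hb => hvx (hv x hb)
      by_cases hxe : z'.1 = x.1
      · have : z' = x := Subtype.ext hxe
        rw [this, fineOpR_incl_diag h hxb]
      · rw [fineOpR_incl_offdiag h hxe]
  · rw [extTo_of_not_mem _ z hz]
    refine Finset.sum_eq_zero fun x _ => ?_
    by_cases hvx : v x = 0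
    · rw [hvx, mul_zero]
    · have hxb : x ∉ bdR R R₀ := fun hb => hvx (hv x hb)
      rw [fineOpR_out_in hR h hxb hz, zero_mul]

/-- **size of the off-diagonal entries**: for `x ≠ y`, `|H x y| ≤ n²·[y ~ x] + (a/n^{d+1})·[same block]` (`a ≥ 0`).
[folklore] -/
theorem abs_fineOpR_offdiag_le (ha : 0 ≤ a) {x y : ↥R} (hxy : x ≠ y) :
    |fineOpR n a m2 R x y|
      ≤ (n : ℝ) ^ 2 * (if y.1 ∈ nbrs x.1 then 1 else 0)
        + a * ((n : ℝ) ^ (d + 1))⁻¹ * (if blk n y.1 = blk n x.1 then 1 else 0) := by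
  have hne : y.1 ≠ x.1 := fun e => hxy (Subtype.ext e.symm)
  rw [fineOpR_apply]
  unfold neumannLapR diagK avgK
  rw [if_neg hne, if_neg hne]
  have ha' : 0 ≤ a * ((n : ℝ) ^ (d + 1))⁻¹ := by positivity
  by_cases h1 : y.1 ∈ nbrs x.1 <;> by_cases h2 : blk n y.1 = blk n x.1 <;> simp only [h1, h2, if_true, if_false]
  · rw [abs_le]; constructor <;> nlinarith
  · rw [abs_le]; constructor <;> nlinarith
  · rw [zero_add, mul_zero, zero_add, abs_of_nonneg ha']; linarith
  · simp

/-- an entry `H x y ≠ 0` with `x ≠ y` forces `y ~ x` or "same block"; in either case `dist_η(x,y) ≤ 1`. [folklore] -/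
theorem edistR_le_one_of_ne_zero (hn : 1 ≤ n) {x y : ↥R} (hxy : x ≠ y) (hH : fineOpR n a m2 R x y ≠ 0) :
    edistR n R x y ≤ 1 := by
  have hn0 : (0 : ℝ) < n := by exact_mod_cast hn
  have hn1 : (1 : ℝ) ≤ n := by exact_mod_cast hn
  have hne : y.1 ≠ x.1 := fun e => hxy (Subtype.ext e.symm)
  have key : y.1 ∈ nbrs x.1 ∨ blk n y.1 = blk n x.1 := by
    by_contra hc
    rw [not_or] at hc
    apply hH
    rw [fineOpR_apply]
    unfold neumannLapR diagK avgK
    rw [if_neg hne, if_neg hc.1, if_neg hne, if_neg hc.2]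
    ring
  show (1 / (n : ℝ)) * supNorm (x.1 - y.1) ≤ 1
  rcases key with h1 | h2
  · calc (1 / (n : ℝ)) * supNorm (x.1 - y.1) ≤ (1 / (n : ℝ)) * 1 :=
          mul_le_mul_of_nonneg_left (supNorm_sub_le_one_of_mem_nbrs h1) (by positivity)
      _ ≤ 1 := by rw [mul_one, div_le_one hn0]; exact hn1
  · calc (1 / (n : ℝ)) * supNorm (x.1 - y.1) ≤ (1 / (n : ℝ)) * ((n : ℝ) - 1) :=
          mul_le_mul_of_nonneg_left (supNorm_sub_le_of_blk_eq hn h2.symm) (by positivity)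
      _ ≤ 1 := by rw [div_mul_eq_mul_div, one_mul, div_le_one hn0]; linarith

/-- neighbours are at `η`-distance `≤ 1/n`. [folklore] -/
theorem edistR_le_of_mem_nbrs (hn : 1 ≤ n) {x y : ↥R} (h : y.1 ∈ nbrs x.1) : edistR n R x y ≤ 1 / (n : ℝ) := by
  show (1 / (n : ℝ)) * supNorm (x.1 - y.1) ≤ 1 / (n : ℝ)
  have hn0 : (0 : ℝ) < n := by exact_mod_cast hn
  calc (1 / (n : ℝ)) * supNorm (x.1 - y.1) ≤ (1 / (n : ℝ)) * 1 :=
        mul_le_mul_of_nonneg_left (supNorm_sub_le_one_of_mem_nbrs h) (by positivity)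
    _ = 1 / (n : ℝ) := mul_one _

end Kernel

/-! ## §3  The cutoff decomposition of `δG` -/

section Decomp

variable {n : ℕ} {R R₀ : Finset (Fin (d + 1) → ℤ)} {a m2 : ℝ}

/-- `δG g = G g − (G₀ ext g)|_R` — the printed `δG_k(Ω,Ω₀,0) = G_k(Ω,0) − G_k(Ω₀,0)` applied to a function on `Ω`
(extended by zero to `Ω₀`) and read on `Ω`. [cite: Balaban1983RegularityDecay, p. 573 (1.11), case A = 0, dictionary] -/
def dG (n : ℕ) (a m2 : ℝ) (h : R ⊆ R₀) (g : ↥R → ℝ) : ↥R → ℝ :=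
  (fineOpR n a m2 R)⁻¹.mulVec g - resTo h ((fineOpR n a m2 R₀)⁻¹.mulVec (extTo R₀ g))

/-- the commutator `[H, χ]u = H(χu) − χ·Hu`. [folklore] -/
def comm (n : ℕ) (a m2 : ℝ) (R : Finset (Fin (d + 1) → ℤ)) (χ u : ↥R → ℝ) : ↥R → ℝ :=
  (fineOpR n a m2 R).mulVec (χ * u) - χ * (fineOpR n a m2 R).mulVec u

/-- the corrector `W = ext(χu) − G₀ ext g'` on `R₀`. [folklore] -/
def corrW (n : ℕ) (a m2 : ℝ) (R₀ : Finset (Fin (d + 1) → ℤ)) (χ u g' : ↥R → ℝ) : ↥R₀ → ℝ :=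
  extTo R₀ (χ * u) - (fineOpR n a m2 R₀)⁻¹.mulVec (extTo R₀ g')

/-- the commutator entrywise: `([H,χ]u)(x) = Σ_y H x y (χ y − χ x) u y`. [folklore] -/
theorem comm_apply (χ u : ↥R → ℝ) (x : ↥R) :
    comm n a m2 R χ u x = ∑ y, fineOpR n a m2 R x y * (χ y - χ x) * u y := by
  simp only [comm, Pi.sub_apply, Pi.mul_apply, mulVec, dotProduct, Finset.mul_sum, ← Finset.sum_sub_distrib]
  exact Finset.sum_congr rfl fun y _ => by ring

/-- **(W1)** `H_{R₀} W = ext([H,χ]u − (1−χ)g')` when `H_R u = g'` and `χ` vanishes on the boundary layer. [folklore] -/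
theorem mulVec_corrW (hn : 1 ≤ n) (hR : IsBlockUnion n R) (hR₀ : IsBlockUnion n R₀) (h : R ⊆ R₀) (ha : 0 < a)
    (hm : 0 ≤ m2) (χ u g' : ↥R → ℝ) (hχ : ∀ y ∈ bdR R R₀, χ y = 0) (hu : (fineOpR n a m2 R).mulVec u = g') :
    (fineOpR n a m2 R₀).mulVec (corrW n a m2 R₀ χ u g') = extTo R₀ (comm n a m2 R χ u - (1 - χ) * g') := by
  have h1 : (fineOpR n a m2 R₀).mulVec (extTo R₀ (χ * u)) = extTo R₀ ((fineOpR n a m2 R).mulVec (χ * u)) :=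
    mulVec_extTo hR h (χ * u) (fun y hy => by simp [hχ y hy])
  have h2 : (fineOpR n a m2 R₀).mulVec ((fineOpR n a m2 R₀)⁻¹.mulVec (extTo R₀ g')) = extTo R₀ g' :=
    mulVec_inv_mulVec hn hR₀ ha hm _
  have h3 : comm n a m2 R χ u - (1 - χ) * g' = (fineOpR n a m2 R).mulVec (χ * u) - g' := by
    rw [comm, hu]; ring
  rw [corrW, Matrix.mulVec_sub, h1, h2, h3, extTo_sub]

/-- **(W2)** `δG g' = (1−χ)u + W|_R` for `u = G g'`. [folklore] -/
theorem dG_eq (h : R ⊆ R₀) (χ g' : ↥R → ℝ) :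
    dG n a m2 h g'
      = (1 - χ) * (fineOpR n a m2 R)⁻¹.mulVec g' + resTo h (corrW n a m2 R₀ χ ((fineOpR n a m2 R)⁻¹.mulVec g') g') := by
  rw [dG, corrW, resTo_sub, resTo_extTo]
  ring

end Decomp

/-! ## §4  Tools: conjugation error for a Lipschitz weight, countings, differences along bonds, `pq ≤ (ε/2)p² + q²/(2ε)` -/

section Tools

variable {n : ℕ} {R : Finset (Fin (d + 1) → ℤ)}

/-- **CONJUGATION-ERROR BOUND FOR ANY `δ`-LIPSCHITZ WEIGHT** (the proof of `B4Cor23Zero.herr_region` uses only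
`|φ j − φ k| ≤ δ·dist_η(j,k)`): `−(min(2,a)/2)‖w‖² ≤ Σ_{j,k}(e^{φ_j−φ_k} − 1)H_jk w_j w_k`.
[cite: CombesThomas1973, §II] [folklore] -/
theorem herr_region_lip (hn : 1 ≤ n) (hR : IsBlockUnion n R) {a δ : ℝ} (m2 : ℝ) (ha : 0 < a) (hδ0 : 0 ≤ δ)
    (hδ1 : δ ≤ 1) (hsmall : 2 * ((d : ℝ) + 1) * δ ^ 2 + a * (Real.exp δ - 1) ≤ min 2 a / 2)
    (φ : ↥R → ℝ) (hlip : ∀ j k : ↥R, |φ j - φ k| ≤ δ * edistR n R j k) (w : ↥R → ℝ) :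
    -(min 2 a / 2) * (w ⬝ᵥ w)
      ≤ ∑ j, ∑ k, (Real.exp (φ j - φ k) - 1) * fineOpR n a m2 R j k * (w j * w k) := by
  classical
  have hn0 : (0 : ℝ) < n := by exact_mod_cast hn
  have hn1 : (1 : ℝ) ≤ n := by exact_mod_cast hn
  have hη : (0 : ℝ) < 1 / (n : ℝ) := by positivity
  have hη1 : 1 / (n : ℝ) ≤ 1 := by rw [div_le_one hn0]; exact hn1
  have hsplit : ∑ j, ∑ k, (Real.exp (φ j - φ k) - 1) * fineOpR n a m2 R j k * (w j * w k)
      = ∑ j, ∑ k, (Real.exp (φ j - φ k) - 1) * fineOpR n a 0 R j k * (w j * w k) := by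
    refine Finset.sum_congr rfl fun j _ => Finset.sum_congr rfl fun k _ => ?_
    rw [fineOpR_eq_add_smul n a m2 R, Matrix.add_apply, Matrix.smul_apply, Matrix.one_apply, smul_eq_mul]
    by_cases hjk : j = k
    · subst hjk; simp
    · simp [hjk]
  rw [hsplit]
  have hcard : ∀ b : ↥(R.image (blk n)), ((Finset.univ.filter fun i => rblk n R i = b).card : ℝ) = (n : ℝ) ^ (d + 1) := by
    intro b
    rw [card_filter_rblk hn hR b]
    push_cast
    rfl
  have hc : ∀ j k : ↥R, adjC n R j k ≠ 0 → adjC n R j k = ((1 / (n : ℝ)) ^ 2)⁻¹ ∧ |φ j - φ k| ≤ δ * (1 / (n : ℝ)) := by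
    intro j k hjk
    have hadj : k.1 ∈ nbrs j.1 := by
      by_contra h
      exact hjk (if_neg h)
    refine ⟨?_, ?_⟩
    · simp only [adjC, hadj, if_true]
      field_simp
    · refine (hlip j k).trans (mul_le_mul_of_nonneg_left ?_ hδ0)
      show (1 / (n : ℝ)) * supNorm (j.1 - k.1) ≤ 1 / (n : ℝ)
      calc (1 / (n : ℝ)) * supNorm (j.1 - k.1) ≤ (1 / (n : ℝ)) * 1 :=
            mul_le_mul_of_nonneg_left (supNorm_sub_le_one_of_mem_nbrs hadj) hη.le
        _ = 1 / (n : ℝ) := mul_one _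
  have hδη : δ * (1 / (n : ℝ)) ≤ 1 := by
    calc δ * (1 / (n : ℝ)) ≤ 1 * 1 := mul_le_mul hδ1 hη1 hη.le zero_le_one
      _ = 1 := one_mul 1
  have hΘ : ∀ j k : ↥R, rblk n R j = rblk n R k → |φ j - φ k| ≤ δ := by
    intro j k hjk
    have hb : blk n j.1 = blk n k.1 := congrArg Subtype.val hjk
    refine (hlip j k).trans ?_
    have hd : edistR n R j k ≤ 1 := by
      show (1 / (n : ℝ)) * supNorm (j.1 - k.1) ≤ 1
      calc (1 / (n : ℝ)) * supNorm (j.1 - k.1) ≤ (1 / (n : ℝ)) * ((n : ℝ) - 1) :=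
            mul_le_mul_of_nonneg_left (supNorm_sub_le_of_blk_eq hn hb) hη.le
        _ ≤ 1 := by rw [div_mul_eq_mul_div, one_mul, div_le_one hn0]; linarith
    calc δ * edistR n R j k ≤ δ * 1 := mul_le_mul_of_nonneg_left hd hδ0
      _ = δ := mul_one δ
  have hε0 : 0 ≤ Real.exp δ - 1 := by linarith [Real.add_one_le_exp δ]
  have hκQ : ∀ b : ↥(R.image (blk n)),
      a / ((Finset.univ.filter fun i => rblk n R i = b).card : ℝ) * (Real.exp δ - 1)
        * ∑ k : ↥R, (if rblk n R k = b then (1 : ℝ) else 0) ^ 2 ≤ a * (Real.exp δ - 1) := by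
    intro b
    have hsq : ∑ k : ↥R, (if rblk n R k = b then (1 : ℝ) else 0) ^ 2
        = ((Finset.univ.filter fun i => rblk n R i = b).card : ℝ) := by
      simp_rw [ite_pow, one_pow, zero_pow two_ne_zero]
      rw [Finset.sum_boole]
    rw [hsq, hcard]
    have hpow : ((n : ℝ) ^ (d + 1)) ≠ 0 := by positivity
    rw [mul_assoc, mul_comm (Real.exp δ - 1), ← mul_assoc, div_mul_cancel₀ a hpow]
  have h := conjError_lap_add_blocks_ge (adjC n R) (adjC_symm n R) (adjC_nonneg n R) (rblk n R)
    (fun b => a / ((Finset.univ.filter fun i => rblk n R i = b).card : ℝ))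
    (fun b => div_nonneg ha.le (Nat.cast_nonneg _))
    (fun b j => if rblk n R j = b then (1 : ℝ) else 0) (fun b j hj => if_neg hj)
    (fineOpR n a 0 R) (fineOpR_zero_eq hn hR a) φ (2 * ((d : ℝ) + 1) * δ ^ 2) (a * (Real.exp δ - 1))
    (lapDefect_le (adjC n R) φ hη hδη hc (fun j => card_filter_adjC_ne_zero_le n R j))
    (fun _ => Real.exp δ - 1) (fun _ => hε0)
    (fun b j k hj hk => blockDefect_le (rblk n R) φ δ hΘ b j k hj hk) hκQ w
  have hww : 0 ≤ w ⬝ᵥ w := by simp only [dotProduct]; exact Finset.sum_nonneg fun j _ => mul_self_nonneg _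
  nlinarith

/-- the neighbour indicator. [folklore] -/
def nbI (x y : ↥R) : ℝ := if y.1 ∈ nbrs x.1 then 1 else 0

/-- the same-block indicator. [folklore] -/
def bkI (n : ℕ) (x y : ↥R) : ℝ := if blk n y.1 = blk n x.1 then 1 else 0

/-- the neighbour indicator is nonnegative. [folklore] -/
theorem nbI_nonneg (x y : ↥R) : 0 ≤ nbI x y := by unfold nbI; split_ifs <;> norm_num

/-- the block indicator is nonnegative. [folklore] -/
theorem bkI_nonneg (x y : ↥R) : 0 ≤ bkI n x y := by unfold bkI; split_ifs <;> norm_num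

/-- the neighbour indicator is symmetric. [folklore] -/
theorem nbI_comm (x y : ↥R) : nbI x y = nbI y x := by
  unfold nbI
  by_cases h : y.1 ∈ nbrs x.1
  · rw [if_pos h, if_pos (nbrs_comm.1 h)]
  · rw [if_neg h, if_neg (fun h' => h (nbrs_comm.1 h'))]

/-- the block indicator is symmetric. [folklore] -/
theorem bkI_comm (x y : ↥R) : bkI n x y = bkI n y x := by
  unfold bkI
  by_cases h : blk n y.1 = blk n x.1
  · rw [if_pos h, if_pos h.symm]
  · rw [if_neg h, if_neg (fun h' => h h'.symm)]

/-- at most `2(d+1)` neighbours. [folklore] -/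
theorem sum_nbI_le (x : ↥R) : ∑ y, nbI x y ≤ 2 * ((d : ℝ) + 1) := by
  classical
  unfold nbI
  rw [Finset.sum_boole]
  have h1 : (Finset.univ.filter fun y : ↥R => y.1 ∈ nbrs x.1).card ≤ (nbrs x.1).card := by
    refine Finset.card_le_card_of_injOn (fun y : ↥R => y.1) ?_ ?_
    · intro y hy
      exact (Finset.mem_filter.1 (Finset.mem_coe.1 hy)).2
    · exact Set.injOn_of_injective Subtype.val_injective
  rw [card_nbrs] at h1
  exact_mod_cast h1

/-- column count of neighbours. [folklore] -/
theorem sum_nbI_le' (y : ↥R) : ∑ x, nbI x y ≤ 2 * ((d : ℝ) + 1) := by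
  calc ∑ x, nbI x y = ∑ x, nbI y x := Finset.sum_congr rfl fun x _ => nbI_comm x y
    _ ≤ 2 * ((d : ℝ) + 1) := sum_nbI_le y

/-- exactly `n^{d+1}` block-mates (union of blocks). [folklore] -/
theorem sum_bkI_eq (hn : 1 ≤ n) (hR : IsBlockUnion n R) (x : ↥R) : ∑ y, bkI n x y = (n : ℝ) ^ (d + 1) := by
  classical
  unfold bkI
  rw [Finset.sum_boole]
  have h1 : (Finset.univ.filter fun y : ↥R => blk n y.1 = blk n x.1)
      = Finset.univ.filter fun y : ↥R => rblk n R y = rblk n R x := by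
    refine Finset.filter_congr fun y _ => ?_
    constructor
    · intro h; exact Subtype.ext h
    · intro h; exact congrArg Subtype.val h
  rw [h1, card_filter_rblk hn hR (rblk n R x)]
  push_cast
  rfl

/-- row count of block mates. [folklore] -/
theorem sum_bkI_le (hn : 1 ≤ n) (hR : IsBlockUnion n R) (x : ↥R) : ∑ y, bkI n x y ≤ (n : ℝ) ^ (d + 1) :=
  (sum_bkI_eq hn hR x).le

/-- column count of block mates. [folklore] -/
theorem sum_bkI_le' (hn : 1 ≤ n) (hR : IsBlockUnion n R) (y : ↥R) : ∑ x, bkI n x y ≤ (n : ℝ) ^ (d + 1) := by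
  calc ∑ x, bkI n x y = ∑ x, bkI n y x := Finset.sum_congr rfl fun x _ => bkI_comm x y
    _ ≤ (n : ℝ) ^ (d + 1) := sum_bkI_le hn hR y

/-- **counting**: a kernel with row and column sums `≤ z` against `F(x) + G(y)`. [folklore] -/
theorem sum_sum_mul_add_le (K : ↥R → ↥R → ℝ) {z : ℝ} (hrow : ∀ x, ∑ y, K x y ≤ z)
    (hcol : ∀ y, ∑ x, K x y ≤ z) (F G : ↥R → ℝ) (hF : ∀ x, 0 ≤ F x) (hG : ∀ y, 0 ≤ G y) :
    ∑ x, ∑ y, K x y * (F x + G y) ≤ z * (∑ x, F x + ∑ y, G y) := by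
  have h1 : ∑ x, ∑ y, K x y * (F x + G y) = ∑ x, F x * ∑ y, K x y + ∑ y, G y * ∑ x, K x y := by
    have : ∑ x, ∑ y, K x y * (F x + G y) = ∑ x, ∑ y, K x y * F x + ∑ x, ∑ y, K x y * G y := by
      rw [← Finset.sum_add_distrib]
      exact Finset.sum_congr rfl fun x _ => by rw [← Finset.sum_add_distrib]; exact Finset.sum_congr rfl fun y _ => by ring
    rw [this, Finset.sum_comm (f := fun x y => K x y * G y)]
    congr 1
    · exact Finset.sum_congr rfl fun x _ => by rw [Finset.mul_sum]; exact Finset.sum_congr rfl fun y _ => by ring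
    · exact Finset.sum_congr rfl fun y _ => by rw [Finset.mul_sum]; exact Finset.sum_congr rfl fun x _ => by ring
  rw [h1, mul_add, Finset.mul_sum, Finset.mul_sum]
  refine add_le_add (Finset.sum_le_sum fun x _ => ?_) (Finset.sum_le_sum fun y _ => ?_)
  · rw [mul_comm z]; exact mul_le_mul_of_nonneg_left (hrow x) (hF x)
  · rw [mul_comm z]; exact mul_le_mul_of_nonneg_left (hcol y) (hG y)

/-- **a difference across a bond is an `η`-derivative**: for `y ~ x` in `R`,
`n|u y − u x| ≤ Σ_μ (|D_μu(x)| + |D_μu(y)|)`. [folklore] -/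
theorem nat_mul_abs_sub_le (u : ↥R → ℝ) {x y : ↥R} (hy : y.1 ∈ nbrs x.1) :
    (n : ℝ) * |u y - u x| ≤ ∑ μ, (|fdiff n R μ u x| + |fdiff n R μ u y|) := by
  have hn0 : (0 : ℝ) ≤ n := Nat.cast_nonneg n
  obtain ⟨i, hi | hi⟩ := mem_nbrs.1 hy
  · have he : x.1 + uvec i = y.1 := by rw [hi]; rfl
    have hmem : x.1 + uvec i ∈ R := by rw [he]; exact y.2
    have hyx : (⟨x.1 + uvec i, hmem⟩ : ↥R) = y := Subtype.ext he
    have h1 : (n : ℝ) * |u y - u x| = |fdiff n R i u x| := by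
      rw [fdiff_of_mem u hmem, hyx, abs_mul, abs_of_nonneg hn0]
    calc (n : ℝ) * |u y - u x| ≤ |fdiff n R i u x| + |fdiff n R i u y| := by
          rw [h1]; linarith [abs_nonneg (fdiff n R i u y)]
      _ ≤ ∑ μ, (|fdiff n R μ u x| + |fdiff n R μ u y|) :=
          Finset.single_le_sum (f := fun μ => |fdiff n R μ u x| + |fdiff n R μ u y|)
            (fun μ _ => by positivity) (Finset.mem_univ i)
  · have he : y.1 + uvec i = x.1 := by rw [hi]; show x.1 - Pi.single i 1 + Pi.single i 1 = x.1; abel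
    have hmem : y.1 + uvec i ∈ R := by rw [he]; exact x.2
    have hxy : (⟨y.1 + uvec i, hmem⟩ : ↥R) = x := Subtype.ext he
    have h1 : (n : ℝ) * |u y - u x| = |fdiff n R i u y| := by
      rw [fdiff_of_mem u hmem, hxy, abs_mul, abs_of_nonneg hn0, abs_sub_comm]
    calc (n : ℝ) * |u y - u x| ≤ |fdiff n R i u x| + |fdiff n R i u y| := by
          rw [h1]; linarith [abs_nonneg (fdiff n R i u x)]
      _ ≤ ∑ μ, (|fdiff n R μ u x| + |fdiff n R μ u y|) :=
          Finset.single_le_sum (f := fun μ => |fdiff n R μ u x| + |fdiff n R μ u y|)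
            (fun μ _ => by positivity) (Finset.mem_univ i)

/-- `pq ≤ (ε/2)p² + q²/(2ε)`. [folklore] -/
theorem mul_le_eps (p q : ℝ) {ε : ℝ} (hε : 0 < ε) : p * q ≤ ε / 2 * p ^ 2 + 1 / (2 * ε) * q ^ 2 := by
  have key : p * q * (2 * ε) ≤ (ε / 2 * p ^ 2 + 1 / (2 * ε) * q ^ 2) * (2 * ε) := by
    have : (ε / 2 * p ^ 2 + 1 / (2 * ε) * q ^ 2) * (2 * ε) = ε ^ 2 * p ^ 2 + q ^ 2 := by
      field_simp
    rw [this]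
    nlinarith [sq_nonneg (ε * p - q)]
  exact le_of_mul_le_mul_right key (by positivity)

/-- weight comparison across `dist_η ≤ 1`: `e^{ψ x} ≤ e^{δ} e^{ψ y}`. [folklore] -/
theorem exp_le_exp_mul {ψx ψy δ : ℝ} (h : |ψx - ψy| ≤ δ) : Real.exp ψx ≤ Real.exp δ * Real.exp ψy := by
  rw [← Real.exp_add]
  exact Real.exp_le_exp.2 (by linarith [(abs_le.1 h).2])

end Tools

/-! ## §5  The commutator pairing: antisymmetrisation, pointwise bounds, counting -/

section AMGM

variable {ι : Type*} [Fintype ι]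

/-- weighted AM-GM for a product of absolute values. [folklore] -/
theorem abs_mul_abs_le_eps (p q : ℝ) {ε : ℝ} (hε : 0 < ε) : |p| * |q| ≤ ε / 2 * p ^ 2 + 1 / (2 * ε) * q ^ 2 := by
  have := mul_le_eps |p| |q| hε
  rwa [sq_abs, sq_abs] at this

/-- `|p| Σ_μ(|q_μ| + |q'_μ|) ≤ |ι| ε p² + (1/2ε) Σ_μ (q_μ² + q'_μ²)`. [folklore] -/
theorem am1 (p : ℝ) (q q' : ι → ℝ) {ε : ℝ} (hε : 0 < ε) :
    |p| * ∑ μ, (|q μ| + |q' μ|)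
      ≤ (Fintype.card ι : ℝ) * ε * p ^ 2 + 1 / (2 * ε) * ∑ μ, (q μ ^ 2 + q' μ ^ 2) := by
  rw [Finset.mul_sum]
  calc ∑ μ, |p| * (|q μ| + |q' μ|)
      ≤ ∑ μ, (ε * p ^ 2 + 1 / (2 * ε) * (q μ ^ 2 + q' μ ^ 2)) := by
        refine Finset.sum_le_sum fun μ _ => ?_
        have h1 := abs_mul_abs_le_eps p (q μ) hε
        have h2 := abs_mul_abs_le_eps p (q' μ) hε
        nlinarith
    _ = (Fintype.card ι : ℝ) * ε * p ^ 2 + 1 / (2 * ε) * ∑ μ, (q μ ^ 2 + q' μ ^ 2) := by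
        rw [Finset.sum_add_distrib, Finset.sum_const, Finset.card_univ, nsmul_eq_mul, Finset.mul_sum]; ring

/-- `|p| (Σ_μ(|q_μ| + |q'_μ|) + 2δ|s|) ≤ (ε/2)Σ_μ(q_μ² + q'_μ²) + 2ε s² + ((2|ι|+1)/(2ε)) p²` for `|δ| ≤ 1`. [folklore] -/
theorem am2 (p s : ℝ) (q q' : ι → ℝ) {ε δ : ℝ} (hε : 0 < ε) (hδ0 : 0 ≤ δ) (hδ1 : δ ≤ 1) :
    |p| * (∑ μ, (|q μ| + |q' μ|) + 2 * δ * |s|)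
      ≤ ε / 2 * ∑ μ, (q μ ^ 2 + q' μ ^ 2) + 2 * ε * s ^ 2
        + (2 * (Fintype.card ι : ℝ) + 1) / (2 * ε) * p ^ 2 := by
  have hA : |p| * ∑ μ, (|q μ| + |q' μ|) ≤ ε / 2 * ∑ μ, (q μ ^ 2 + q' μ ^ 2) + (Fintype.card ι : ℝ) / ε * p ^ 2 := by
    rw [Finset.mul_sum]
    calc ∑ μ, |p| * (|q μ| + |q' μ|)
        ≤ ∑ μ, (ε / 2 * (q μ ^ 2 + q' μ ^ 2) + 1 / ε * p ^ 2) := by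
          refine Finset.sum_le_sum fun μ _ => ?_
          have h1 := abs_mul_abs_le_eps (q μ) p hε
          have h2 := abs_mul_abs_le_eps (q' μ) p hε
          have e1 : |p| * |q μ| = |q μ| * |p| := mul_comm _ _
          have e2 : |p| * |q' μ| = |q' μ| * |p| := mul_comm _ _
          have e3 : 1 / (2 * ε) * p ^ 2 + 1 / (2 * ε) * p ^ 2 = 1 / ε * p ^ 2 := by field_simp; ring
          nlinarith
      _ = ε / 2 * ∑ μ, (q μ ^ 2 + q' μ ^ 2) + (Fintype.card ι : ℝ) / ε * p ^ 2 := by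
          rw [Finset.sum_add_distrib, Finset.sum_const, Finset.card_univ, nsmul_eq_mul, Finset.mul_sum]; ring
  have hB : |p| * (2 * δ * |s|) ≤ 2 * ε * s ^ 2 + 1 / (2 * ε) * p ^ 2 := by
    have h1 := abs_mul_abs_le_eps (2 * δ * s) p hε
    have e1 : |p| * (2 * δ * |s|) = |2 * δ * s| * |p| := by
      rw [abs_mul, abs_mul, abs_of_nonneg (by norm_num : (0:ℝ) ≤ 2), abs_of_nonneg hδ0]; ring
    rw [e1]
    have h2 : ε / 2 * (2 * δ * s) ^ 2 ≤ 2 * ε * s ^ 2 := by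
      have hεs : 0 ≤ ε * s ^ 2 := by positivity
      have : δ ^ 2 ≤ 1 := by nlinarith
      calc ε / 2 * (2 * δ * s) ^ 2 = 2 * (ε * s ^ 2) * δ ^ 2 := by ring
        _ ≤ 2 * (ε * s ^ 2) * 1 := mul_le_mul_of_nonneg_left this (by positivity)
        _ = 2 * ε * s ^ 2 := by ring
    linarith
  have e : (2 * (Fintype.card ι : ℝ) + 1) / (2 * ε) * p ^ 2
      = (Fintype.card ι : ℝ) / ε * p ^ 2 + 1 / (2 * ε) * p ^ 2 := by field_simp
  rw [mul_add, e]
  linarith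

/-- `|p|(|q| + |q'|) ≤ ε p² + (1/2ε)(q² + q'²)`. [folklore] -/
theorem am3 (p q q' : ℝ) {ε : ℝ} (hε : 0 < ε) : |p| * (|q| + |q'|) ≤ ε * p ^ 2 + 1 / (2 * ε) * (q ^ 2 + q' ^ 2) := by
  have h1 := abs_mul_abs_le_eps p q hε
  have h2 := abs_mul_abs_le_eps p q' hε
  nlinarith

/-- `|p|(|s| + |s'|) ≤ (ε/2)(s² + s'²) + (1/ε) p²`. [folklore] -/
theorem am4 (p s s' : ℝ) {ε : ℝ} (hε : 0 < ε) : |p| * (|s| + |s'|) ≤ ε / 2 * (s ^ 2 + s' ^ 2) + 1 / ε * p ^ 2 := by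
  have h1 := abs_mul_abs_le_eps s p hε
  have h2 := abs_mul_abs_le_eps s' p hε
  have e3 : 1 / (2 * ε) * p ^ 2 + 1 / (2 * ε) * p ^ 2 = 1 / ε * p ^ 2 := by field_simp; ring
  nlinarith [mul_comm |p| |s|, mul_comm |p| |s'|]

end AMGM

section Core

variable {n : ℕ} {R R₀ : Finset (Fin (d + 1) → ℤ)} {a m2 : ℝ}

/-- **THE ANTISYMMETRISED COMMUTATOR PAIRING**: for `H` symmetric,
`2 Σ_x V_x ([H,χ]u)_x = Σ_{x,y} H_xy (χ_y − χ_x)(V_x(u_y − u_x) − u_x(V_y − V_x))`. [folklore] -/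
theorem two_commPairing_eq (χ u V : ↥R → ℝ) :
    2 * ∑ x, V x * comm n a m2 R χ u x
      = ∑ x, ∑ y, fineOpR n a m2 R x y * (χ y - χ x) * (V x * (u y - u x) - u x * (V y - V x)) := by
  have hsym : ∀ x y : ↥R, fineOpR n a m2 R y x = fineOpR n a m2 R x y :=
    fun x y => (fineOpR_isSymm n a m2 R).apply x y
  have h1 : ∑ x, V x * comm n a m2 R χ u x = ∑ x, ∑ y, fineOpR n a m2 R x y * (χ y - χ x) * (V x * u y) := by
    refine Finset.sum_congr rfl fun x _ => ?_
    rw [comm_apply, Finset.mul_sum]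
    exact Finset.sum_congr rfl fun y _ => by ring
  have h2 : ∑ x, V x * comm n a m2 R χ u x = ∑ x, ∑ y, -(fineOpR n a m2 R x y * (χ y - χ x) * (V y * u x)) := by
    rw [h1, Finset.sum_comm]
    refine Finset.sum_congr rfl fun x _ => Finset.sum_congr rfl fun y _ => ?_
    rw [hsym x y]; ring
  rw [two_mul]
  nth_rewrite 1 [h1]
  rw [h2, ← Finset.sum_add_distrib]
  refine Finset.sum_congr rfl fun x _ => ?_
  rw [← Finset.sum_add_distrib]
  exact Finset.sum_congr rfl fun y _ => by ring

/-- `|χ y − χ x| ≤ 1` for `0 ≤ χ ≤ 1`. [folklore] -/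
theorem abs_sub_le_one_of_unit {χ : ↥R → ℝ} (h0 : ∀ x, 0 ≤ χ x) (h1 : ∀ x, χ x ≤ 1) (x y : ↥R) :
    |χ y - χ x| ≤ 1 := by
  rw [abs_le]; constructor <;> linarith [h0 x, h1 x, h0 y, h1 y]

/-- the coefficient of one term: `|H x y (χ y − χ x)| ≤ n·[y ~ x] + (a/n^{d+1})·[same block]` (`x ≠ y`; `χ` is
`1`-Lipschitz for `dist_η` and takes values in `[0,1]`). [folklore] -/
theorem coef_le (hn : 1 ≤ n) (ha : 0 ≤ a) (χ : ↥R → ℝ) (hχ0 : ∀ x, 0 ≤ χ x) (hχ1 : ∀ x, χ x ≤ 1)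
    (hχlip : ∀ x y, |χ x - χ y| ≤ edistR n R x y) {x y : ↥R} (hxy : x ≠ y) :
    |fineOpR n a m2 R x y * (χ y - χ x)| ≤ (n : ℝ) * nbI x y + a * ((n : ℝ) ^ (d + 1))⁻¹ * bkI n x y := by
  have hn0 : (0 : ℝ) < n := by exact_mod_cast hn
  have hab0 : 0 ≤ a * ((n : ℝ) ^ (d + 1))⁻¹ := by positivity
  have hB0 := bkI_nonneg (n := n) x y
  rw [abs_mul]
  have hHb := abs_fineOpR_offdiag_le (n := n) (m2 := m2) (R := R) ha hxy
  have hχb1 : |χ y - χ x| ≤ 1 := abs_sub_le_one_of_unit hχ0 hχ1 x y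
  have hnb : (n : ℝ) ^ 2 * nbI x y * |χ y - χ x| ≤ (n : ℝ) * nbI x y := by
    unfold nbI
    by_cases hnb : y.1 ∈ nbrs x.1
    · rw [if_pos hnb, mul_one, mul_one]
      have this : |χ y - χ x| ≤ 1 / (n : ℝ) :=
        (hχlip y x).trans ((edistR_comm y x).le.trans (edistR_le_of_mem_nbrs hn hnb))
      calc (n : ℝ) ^ 2 * |χ y - χ x| ≤ (n : ℝ) ^ 2 * (1 / (n : ℝ)) :=
            mul_le_mul_of_nonneg_left this (by positivity)
        _ = n := by field_simp
    · rw [if_neg hnb]; simp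
  have hbk : a * ((n : ℝ) ^ (d + 1))⁻¹ * bkI n x y * |χ y - χ x| ≤ a * ((n : ℝ) ^ (d + 1))⁻¹ * bkI n x y := by
    calc a * ((n : ℝ) ^ (d + 1))⁻¹ * bkI n x y * |χ y - χ x| ≤ a * ((n : ℝ) ^ (d + 1))⁻¹ * bkI n x y * 1 :=
          mul_le_mul_of_nonneg_left hχb1 (mul_nonneg hab0 hB0)
      _ = _ := mul_one _
  have hHb' : |fineOpR n a m2 R x y| ≤ (n : ℝ) ^ 2 * nbI x y + a * ((n : ℝ) ^ (d + 1))⁻¹ * bkI n x y := by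
    simpa [nbI, bkI] using hHb
  calc |fineOpR n a m2 R x y| * |χ y - χ x|
      ≤ ((n : ℝ) ^ 2 * nbI x y + a * ((n : ℝ) ^ (d + 1))⁻¹ * bkI n x y) * |χ y - χ x| :=
        mul_le_mul_of_nonneg_right hHb' (abs_nonneg _)
    _ = (n : ℝ) ^ 2 * nbI x y * |χ y - χ x| + a * ((n : ℝ) ^ (d + 1))⁻¹ * bkI n x y * |χ y - χ x| := by ring
    _ ≤ _ := add_le_add hnb hbk

/-- the `n`-scaled difference of the conjugated weight–corrector product along a bond:
`n|e^{φ_k}w_k − e^{φ_j}w_j| ≤ e^{φ_j}(Σ_μ(|D_μw(j)| + |D_μw(k)|) + 2δ|w_k|)` for `k ~ j`, `|φ_j − φ_k| ≤ δη`, `δ ≤ 1`.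
[folklore] -/
theorem nat_mul_abs_dV_le (hn : 1 ≤ n) {δ : ℝ} (hδ1 : δ ≤ 1) (φ : ↥R → ℝ)
    (hφ : ∀ j k : ↥R, k.1 ∈ nbrs j.1 → |φ j - φ k| ≤ δ / (n : ℝ)) (w : ↥R → ℝ) {j k : ↥R}
    (hjk : k.1 ∈ nbrs j.1) :
    (n : ℝ) * |Real.exp (φ k) * w k - Real.exp (φ j) * w j|
      ≤ Real.exp (φ j) * (∑ μ, (|fdiff n R μ w j| + |fdiff n R μ w k|) + 2 * δ * |w k|) := by
  have hn0 : (0 : ℝ) < n := by exact_mod_cast hn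
  have hex0 : 0 < Real.exp (φ j) := Real.exp_pos _
  have hid : Real.exp (φ k) * w k - Real.exp (φ j) * w j
      = Real.exp (φ j) * (w k - w j) + Real.exp (φ j) * (Real.exp (φ k - φ j) - 1) * w k := by
    rw [Real.exp_sub]; field_simp; ring
  have hDw := nat_mul_abs_sub_le (n := n) w hjk
  have hexp1 : (n : ℝ) * |Real.exp (φ k - φ j) - 1| ≤ 2 * δ :=
    nat_mul_abs_exp_sub_one_le hn hδ1 (by rw [abs_sub_comm]; exact hφ _ _ hjk)
  calc (n : ℝ) * |Real.exp (φ k) * w k - Real.exp (φ j) * w j|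
      ≤ (n : ℝ) * (|Real.exp (φ j) * (w k - w j)| + |Real.exp (φ j) * (Real.exp (φ k - φ j) - 1) * w k|) := by
        rw [hid]; exact mul_le_mul_of_nonneg_left (abs_add_le _ _) hn0.le
    _ = Real.exp (φ j) * ((n : ℝ) * |w k - w j|)
        + Real.exp (φ j) * ((n : ℝ) * |Real.exp (φ k - φ j) - 1|) * |w k| := by
        rw [abs_mul, abs_mul, abs_mul, abs_of_pos hex0]; ring
    _ ≤ Real.exp (φ j) * (∑ μ, (|fdiff n R μ w j| + |fdiff n R μ w k|)) + Real.exp (φ j) * (2 * δ) * |w k| := by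
        refine add_le_add (mul_le_mul_of_nonneg_left hDw hex0.le) ?_
        exact mul_le_mul_of_nonneg_right (mul_le_mul_of_nonneg_left hexp1 hex0.le) (abs_nonneg _)
    _ = _ := by ring

/-- the neighbour part of one term, with the weights inserted. [folklore] -/
theorem nbrPart_le (hn : 1 ≤ n) (h : R ⊆ R₀) {δ r : ℝ} (hδ0 : 0 ≤ δ) (hδ1 : δ ≤ 1) (ψ : ↥R → ℝ)
    (φ : ↥R₀ → ℝ) (hφ : ∀ j k : ↥R₀, k.1 ∈ nbrs j.1 → |φ j - φ k| ≤ δ / (n : ℝ)) (u : ↥R → ℝ) (w : ↥R₀ → ℝ)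
    {x y : ↥R} (hnb : y.1 ∈ nbrs x.1)
    (hexr : Real.exp (φ (incl h x)) ≤ Real.exp (-(δ * r)) * Real.exp (ψ x))
    (hψxy : Real.exp (ψ x) ≤ Real.exp δ * Real.exp (ψ y)) :
    Real.exp (φ (incl h x)) * |w (incl h x)| * ((n : ℝ) * |u y - u x|)
        + |u x| * ((n : ℝ) * |Real.exp (φ (incl h y)) * w (incl h y) - Real.exp (φ (incl h x)) * w (incl h x)|)
      ≤ Real.exp (δ - δ * r) *
        (|w (incl h x)| * ∑ μ, (|Real.exp (ψ x) * fdiff n R μ u x| + |Real.exp (ψ y) * fdiff n R μ u y|)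
          + Real.exp (ψ x) * |u x|
            * (∑ μ, (|fdiff n R₀ μ w (incl h x)| + |fdiff n R₀ μ w (incl h y)|) + 2 * δ * |w (incl h y)|)) := by
  have hn0 : (0 : ℝ) < n := by exact_mod_cast hn
  have hex0 : 0 < Real.exp (φ (incl h x)) := Real.exp_pos _
  have heψx : 0 < Real.exp (ψ x) := Real.exp_pos _
  have heψy : 0 < Real.exp (ψ y) := Real.exp_pos _
  have her0 : 0 < Real.exp (-(δ * r)) := Real.exp_pos _
  have hθeq : Real.exp (-(δ * r)) * Real.exp δ = Real.exp (δ - δ * r) := by rw [← Real.exp_add]; congr 1; ring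
  have hθge : Real.exp (-(δ * r)) ≤ Real.exp (δ - δ * r) := Real.exp_le_exp.2 (by linarith)
  have hnb0 : (incl h y).1 ∈ nbrs (incl h x).1 := hnb
  have hDu := nat_mul_abs_sub_le (n := n) u hnb
  have hS0 : 0 ≤ ∑ μ, (|fdiff n R μ u x| + |fdiff n R μ u y|) := Finset.sum_nonneg fun _ _ => by positivity
  have hSw0 : 0 ≤ ∑ μ, (|fdiff n R₀ μ w (incl h x)| + |fdiff n R₀ μ w (incl h y)|) :=
    Finset.sum_nonneg fun _ _ => by positivity
  have hS1 : 0 ≤ ∑ μ, (|fdiff n R₀ μ w (incl h x)| + |fdiff n R₀ μ w (incl h y)|) + 2 * δ * |w (incl h y)| := by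
    positivity
  -- `n|V y − V x| ≤ e^{φ x̂}(Σ(|Dw x̂| + |Dw ŷ|) + 2δ|w ŷ|)`
  have hDV := nat_mul_abs_dV_le hn hδ1 φ hφ w hnb0
  have h1 : Real.exp (φ (incl h x)) * |w (incl h x)| * ((n : ℝ) * |u y - u x|)
        + |u x| * ((n : ℝ) * |Real.exp (φ (incl h y)) * w (incl h y) - Real.exp (φ (incl h x)) * w (incl h x)|)
      ≤ Real.exp (φ (incl h x)) * (|w (incl h x)| * ∑ μ, (|fdiff n R μ u x| + |fdiff n R μ u y|)
          + |u x| * (∑ μ, (|fdiff n R₀ μ w (incl h x)| + |fdiff n R₀ μ w (incl h y)|) + 2 * δ * |w (incl h y)|)) := by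
    have a1 := mul_le_mul_of_nonneg_left hDu (mul_nonneg hex0.le (abs_nonneg (w (incl h x))))
    have a2 := mul_le_mul_of_nonneg_left hDV (abs_nonneg (u x))
    calc _ ≤ Real.exp (φ (incl h x)) * |w (incl h x)| * ∑ μ, (|fdiff n R μ u x| + |fdiff n R μ u y|)
          + |u x| * (Real.exp (φ (incl h x))
            * (∑ μ, (|fdiff n R₀ μ w (incl h x)| + |fdiff n R₀ μ w (incl h y)|) + 2 * δ * |w (incl h y)|)) :=
          add_le_add a1 a2
      _ = _ := by ring
  have h2 : Real.exp (ψ x) * ∑ μ, (|fdiff n R μ u x| + |fdiff n R μ u y|)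
      ≤ Real.exp δ * ∑ μ, (|Real.exp (ψ x) * fdiff n R μ u x| + |Real.exp (ψ y) * fdiff n R μ u y|) := by
    rw [Finset.mul_sum, Finset.mul_sum]
    refine Finset.sum_le_sum fun μ _ => ?_
    rw [abs_mul, abs_mul, abs_of_pos heψx, abs_of_pos heψy]
    have hδ1' : (1 : ℝ) ≤ Real.exp δ := by linarith [Real.add_one_le_exp δ]
    have t1 : Real.exp (ψ x) * |fdiff n R μ u x| ≤ Real.exp δ * (Real.exp (ψ x) * |fdiff n R μ u x|) :=
      le_mul_of_one_le_left (by positivity) hδ1'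
    have t2 : Real.exp (ψ x) * |fdiff n R μ u y| ≤ Real.exp δ * (Real.exp (ψ y) * |fdiff n R μ u y|) := by
      have := mul_le_mul_of_nonneg_right hψxy (abs_nonneg (fdiff n R μ u y))
      linarith
    rw [mul_add, mul_add]
    exact add_le_add t1 t2
  have h3 : Real.exp (φ (incl h x)) * (|w (incl h x)| * ∑ μ, (|fdiff n R μ u x| + |fdiff n R μ u y|))
      ≤ Real.exp (δ - δ * r)
        * (|w (incl h x)| * ∑ μ, (|Real.exp (ψ x) * fdiff n R μ u x| + |Real.exp (ψ y) * fdiff n R μ u y|)) := by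
    calc Real.exp (φ (incl h x)) * (|w (incl h x)| * ∑ μ, (|fdiff n R μ u x| + |fdiff n R μ u y|))
        ≤ Real.exp (-(δ * r)) * Real.exp (ψ x) * (|w (incl h x)| * ∑ μ, (|fdiff n R μ u x| + |fdiff n R μ u y|)) :=
          mul_le_mul_of_nonneg_right hexr (mul_nonneg (abs_nonneg _) hS0)
      _ = Real.exp (-(δ * r)) * |w (incl h x)| * (Real.exp (ψ x) * ∑ μ, (|fdiff n R μ u x| + |fdiff n R μ u y|)) := by
          ring
      _ ≤ Real.exp (-(δ * r)) * |w (incl h x)|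
            * (Real.exp δ * ∑ μ, (|Real.exp (ψ x) * fdiff n R μ u x| + |Real.exp (ψ y) * fdiff n R μ u y|)) :=
          mul_le_mul_of_nonneg_left h2 (mul_nonneg her0.le (abs_nonneg _))
      _ = _ := by rw [← hθeq]; ring
  have h4 : Real.exp (φ (incl h x))
        * (|u x| * (∑ μ, (|fdiff n R₀ μ w (incl h x)| + |fdiff n R₀ μ w (incl h y)|) + 2 * δ * |w (incl h y)|))
      ≤ Real.exp (δ - δ * r) * (Real.exp (ψ x) * |u x|
        * (∑ μ, (|fdiff n R₀ μ w (incl h x)| + |fdiff n R₀ μ w (incl h y)|) + 2 * δ * |w (incl h y)|)) := by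
    calc Real.exp (φ (incl h x))
          * (|u x| * (∑ μ, (|fdiff n R₀ μ w (incl h x)| + |fdiff n R₀ μ w (incl h y)|) + 2 * δ * |w (incl h y)|))
        ≤ Real.exp (-(δ * r)) * Real.exp (ψ x)
          * (|u x| * (∑ μ, (|fdiff n R₀ μ w (incl h x)| + |fdiff n R₀ μ w (incl h y)|) + 2 * δ * |w (incl h y)|)) :=
          mul_le_mul_of_nonneg_right hexr (mul_nonneg (abs_nonneg _) hS1)
      _ = Real.exp (-(δ * r)) * (Real.exp (ψ x) * |u x|
          * (∑ μ, (|fdiff n R₀ μ w (incl h x)| + |fdiff n R₀ μ w (incl h y)|) + 2 * δ * |w (incl h y)|)) := by ring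
      _ ≤ _ := mul_le_mul_of_nonneg_right hθge (mul_nonneg (mul_nonneg heψx.le (abs_nonneg _)) hS1)
  calc _ ≤ _ := h1
    _ = Real.exp (φ (incl h x)) * (|w (incl h x)| * ∑ μ, (|fdiff n R μ u x| + |fdiff n R μ u y|))
        + Real.exp (φ (incl h x))
          * (|u x| * (∑ μ, (|fdiff n R₀ μ w (incl h x)| + |fdiff n R₀ μ w (incl h y)|) + 2 * δ * |w (incl h y)|)) :=
        mul_add _ _ _
    _ ≤ _ := add_le_add h3 h4
    _ = _ := by ring

/-- the block part of one term, with the weights inserted. [folklore] -/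
theorem blkPart_le (h : R ⊆ R₀) {δ r : ℝ} (hδ0 : 0 ≤ δ) (ψ : ↥R → ℝ) (φ : ↥R₀ → ℝ) (u : ↥R → ℝ)
    (w : ↥R₀ → ℝ) {x y : ↥R}
    (hexr : Real.exp (φ (incl h x)) ≤ Real.exp (-(δ * r)) * Real.exp (ψ x))
    (heyr : Real.exp (φ (incl h y)) ≤ Real.exp (-(δ * r)) * Real.exp (ψ y))
    (hψxy : Real.exp (ψ x) ≤ Real.exp δ * Real.exp (ψ y)) (hψyx : Real.exp (ψ y) ≤ Real.exp δ * Real.exp (ψ x)) :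
    Real.exp (φ (incl h x)) * |w (incl h x)| * |u y - u x|
        + |u x| * |Real.exp (φ (incl h y)) * w (incl h y) - Real.exp (φ (incl h x)) * w (incl h x)|
      ≤ Real.exp (δ - δ * r) *
        (|w (incl h x)| * (Real.exp (ψ y) * |u y| + Real.exp (ψ x) * |u x|)
          + Real.exp (ψ x) * |u x| * (|w (incl h y)| + |w (incl h x)|)) := by
  have hex0 : 0 < Real.exp (φ (incl h x)) := Real.exp_pos _
  have hey0 : 0 < Real.exp (φ (incl h y)) := Real.exp_pos _
  have heψx : 0 < Real.exp (ψ x) := Real.exp_pos _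
  have her0 : 0 < Real.exp (-(δ * r)) := Real.exp_pos _
  have hθeq : Real.exp (-(δ * r)) * Real.exp δ = Real.exp (δ - δ * r) := by rw [← Real.exp_add]; congr 1; ring
  have hδ1' : (1 : ℝ) ≤ Real.exp δ := by linarith [Real.add_one_le_exp δ]
  have h1 : Real.exp (φ (incl h x)) * |w (incl h x)| * |u y - u x|
      ≤ Real.exp (δ - δ * r) * (|w (incl h x)| * (Real.exp (ψ y) * |u y| + Real.exp (ψ x) * |u x|)) := by
    calc Real.exp (φ (incl h x)) * |w (incl h x)| * |u y - u x|
        ≤ Real.exp (φ (incl h x)) * |w (incl h x)| * (|u y| + |u x|) :=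
          mul_le_mul_of_nonneg_left (abs_sub _ _) (by positivity)
      _ ≤ Real.exp (-(δ * r)) * Real.exp (ψ x) * |w (incl h x)| * (|u y| + |u x|) := by
          have := mul_le_mul_of_nonneg_right hexr (abs_nonneg (w (incl h x)))
          exact mul_le_mul_of_nonneg_right this (by positivity)
      _ = Real.exp (-(δ * r)) * |w (incl h x)| * (Real.exp (ψ x) * |u y| + Real.exp (ψ x) * |u x|) := by ring
      _ ≤ Real.exp (-(δ * r)) * |w (incl h x)|
            * (Real.exp δ * (Real.exp (ψ y) * |u y|) + Real.exp δ * (Real.exp (ψ x) * |u x|)) := by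
          refine mul_le_mul_of_nonneg_left (add_le_add ?_ ?_) (by positivity)
          · calc Real.exp (ψ x) * |u y| ≤ Real.exp δ * Real.exp (ψ y) * |u y| :=
                mul_le_mul_of_nonneg_right hψxy (abs_nonneg _)
              _ = _ := by ring
          · exact le_mul_of_one_le_left (by positivity) hδ1'
      _ = _ := by rw [← hθeq]; ring
  have h2 : |u x| * |Real.exp (φ (incl h y)) * w (incl h y) - Real.exp (φ (incl h x)) * w (incl h x)|
      ≤ Real.exp (δ - δ * r) * (Real.exp (ψ x) * |u x| * (|w (incl h y)| + |w (incl h x)|)) := by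
    calc |u x| * |Real.exp (φ (incl h y)) * w (incl h y) - Real.exp (φ (incl h x)) * w (incl h x)|
        ≤ |u x| * (Real.exp (φ (incl h y)) * |w (incl h y)| + Real.exp (φ (incl h x)) * |w (incl h x)|) := by
          refine mul_le_mul_of_nonneg_left ?_ (abs_nonneg _)
          calc _ ≤ |Real.exp (φ (incl h y)) * w (incl h y)| + |Real.exp (φ (incl h x)) * w (incl h x)| := abs_sub _ _
            _ = _ := by rw [abs_mul, abs_mul, abs_of_pos hey0, abs_of_pos hex0]
      _ ≤ |u x| * (Real.exp (-(δ * r)) * Real.exp (ψ y) * |w (incl h y)|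
            + Real.exp (-(δ * r)) * Real.exp (ψ x) * |w (incl h x)|) := by
          refine mul_le_mul_of_nonneg_left (add_le_add ?_ ?_) (abs_nonneg _)
          · exact mul_le_mul_of_nonneg_right heyr (abs_nonneg _)
          · exact mul_le_mul_of_nonneg_right hexr (abs_nonneg _)
      _ ≤ |u x| * (Real.exp (-(δ * r)) * (Real.exp δ * Real.exp (ψ x)) * |w (incl h y)|
            + Real.exp (-(δ * r)) * (Real.exp δ * Real.exp (ψ x)) * |w (incl h x)|) := by
          refine mul_le_mul_of_nonneg_left (add_le_add ?_ ?_) (abs_nonneg _)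
          · exact mul_le_mul_of_nonneg_right (mul_le_mul_of_nonneg_left hψyx her0.le) (abs_nonneg _)
          · exact mul_le_mul_of_nonneg_right
              (mul_le_mul_of_nonneg_left (le_mul_of_one_le_left heψx.le hδ1') her0.le) (abs_nonneg _)
      _ = _ := by rw [← hθeq]; ring
  exact (add_le_add h1 h2).trans (le_of_eq (by ring))

set_option maxHeartbeats 400000 in
/-- **THE POINTWISE BOUND** on one term of the antisymmetrised commutator pairing (weights on the collar, first
differences of `χ`, `pq ≤ (ε/2)p² + q²/(2ε)`). [folklore] -/
theorem commTerm_le (hn : 1 ≤ n) (h : R ⊆ R₀) (ha : 0 < a) {δ r ε : ℝ} (hδ0 : 0 ≤ δ) (hδ1 : δ ≤ 1)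
    (hε : 0 < ε) (χ : ↥R → ℝ) (hχ0 : ∀ x, 0 ≤ χ x) (hχ1 : ∀ x, χ x ≤ 1)
    (hχlip : ∀ x y, |χ x - χ y| ≤ edistR n R x y) (C' : Finset ↥R)
    (hχC : ∀ x y, edistR n R x y ≤ 1 → χ x ≠ χ y → x ∈ C') (ψ : ↥R → ℝ)
    (hψ : ∀ x y, edistR n R x y ≤ 1 → |ψ x - ψ y| ≤ δ) (φ : ↥R₀ → ℝ)
    (hφ : ∀ j k : ↥R₀, k.1 ∈ nbrs j.1 → |φ j - φ k| ≤ δ / (n : ℝ))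
    (hφC : ∀ x ∈ C', φ (incl h x) ≤ ψ x - δ * r) (u : ↥R → ℝ) (w : ↥R₀ → ℝ) (x y : ↥R) :
    |fineOpR n a m2 R x y * (χ y - χ x)
        * (Real.exp (φ (incl h x)) * w (incl h x) * (u y - u x)
            - u x * (Real.exp (φ (incl h y)) * w (incl h y) - Real.exp (φ (incl h x)) * w (incl h x)))|
      ≤ Real.exp (δ - δ * r) *
        (nbI x y *
            (ε * ((((d : ℝ) + 1) * w (incl h x) ^ 2 + 1 / 2 * ∑ μ, fdiff n R₀ μ w (incl h x) ^ 2)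
                    + (1 / 2 * ∑ μ, fdiff n R₀ μ w (incl h y) ^ 2 + 2 * w (incl h y) ^ 2))
              + ε⁻¹ * ((1 / 2 * ∑ μ, (Real.exp (ψ x) * fdiff n R μ u x) ^ 2
                        + (2 * ((d : ℝ) + 1) + 1) / 2 * (Real.exp (ψ x) * u x) ^ 2)
                    + 1 / 2 * ∑ μ, (Real.exp (ψ y) * fdiff n R μ u y) ^ 2))
          + a * ((n : ℝ) ^ (d + 1))⁻¹ * bkI n x y *
            (ε * (3 / 2 * w (incl h x) ^ 2 + 1 / 2 * w (incl h y) ^ 2)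
              + ε⁻¹ * (3 / 2 * (Real.exp (ψ x) * u x) ^ 2 + 1 / 2 * (Real.exp (ψ y) * u y) ^ 2))) := by
  have hθ0 : 0 < Real.exp (δ - δ * r) := Real.exp_pos _
  have hab0 : 0 ≤ a * ((n : ℝ) ^ (d + 1))⁻¹ := by positivity
  have hN0 := nbI_nonneg x y
  have hB0 := bkI_nonneg (n := n) x y
  have s1 : 0 ≤ ∑ μ, fdiff n R₀ μ w (incl h x) ^ 2 := Finset.sum_nonneg fun _ _ => sq_nonneg _
  have s2 : 0 ≤ ∑ μ, fdiff n R₀ μ w (incl h y) ^ 2 := Finset.sum_nonneg fun _ _ => sq_nonneg _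
  have s3 : 0 ≤ ∑ μ, (Real.exp (ψ x) * fdiff n R μ u x) ^ 2 := Finset.sum_nonneg fun _ _ => sq_nonneg _
  have s4 : 0 ≤ ∑ μ, (Real.exp (ψ y) * fdiff n R μ u y) ^ 2 := Finset.sum_nonneg fun _ _ => sq_nonneg _
  have hRHS : 0 ≤ Real.exp (δ - δ * r) *
        (nbI x y *
            (ε * ((((d : ℝ) + 1) * w (incl h x) ^ 2 + 1 / 2 * ∑ μ, fdiff n R₀ μ w (incl h x) ^ 2)
                    + (1 / 2 * ∑ μ, fdiff n R₀ μ w (incl h y) ^ 2 + 2 * w (incl h y) ^ 2))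
              + ε⁻¹ * ((1 / 2 * ∑ μ, (Real.exp (ψ x) * fdiff n R μ u x) ^ 2
                        + (2 * ((d : ℝ) + 1) + 1) / 2 * (Real.exp (ψ x) * u x) ^ 2)
                    + 1 / 2 * ∑ μ, (Real.exp (ψ y) * fdiff n R μ u y) ^ 2))
          + a * ((n : ℝ) ^ (d + 1))⁻¹ * bkI n x y *
            (ε * (3 / 2 * w (incl h x) ^ 2 + 1 / 2 * w (incl h y) ^ 2)
              + ε⁻¹ * (3 / 2 * (Real.exp (ψ x) * u x) ^ 2 + 1 / 2 * (Real.exp (ψ y) * u y) ^ 2))) := by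
    positivity
  -- trivial cases
  by_cases hc : χ x = χ y
  · rw [hc, sub_self, mul_zero, zero_mul, abs_zero]; exact hRHS
  have hxy : x ≠ y := fun e => hc (by rw [e])
  by_cases hH0 : fineOpR n a m2 R x y = 0
  · rw [hH0, zero_mul, zero_mul, abs_zero]; exact hRHS
  -- live case: both points in the collar
  have hd1 : edistR n R x y ≤ 1 := edistR_le_one_of_ne_zero hn hxy hH0
  have hxC : x ∈ C' := hχC x y hd1 hc
  have hyC : y ∈ C' := hχC y x (by rw [edistR_comm]; exact hd1) (Ne.symm hc)
  have hexr : Real.exp (φ (incl h x)) ≤ Real.exp (-(δ * r)) * Real.exp (ψ x) := by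
    rw [← Real.exp_add]; exact Real.exp_le_exp.2 (by linarith [hφC x hxC])
  have heyr : Real.exp (φ (incl h y)) ≤ Real.exp (-(δ * r)) * Real.exp (ψ y) := by
    rw [← Real.exp_add]; exact Real.exp_le_exp.2 (by linarith [hφC y hyC])
  have hψxy : Real.exp (ψ x) ≤ Real.exp δ * Real.exp (ψ y) := exp_le_exp_mul (hψ x y hd1)
  have hψyx : Real.exp (ψ y) ≤ Real.exp δ * Real.exp (ψ x) :=
    exp_le_exp_mul (by rw [abs_sub_comm]; exact hψ x y hd1)
  -- the two factors
  have hcoef := coef_le (m2 := m2) hn ha.le χ hχ0 hχ1 hχlip hxy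
  have hfac : |Real.exp (φ (incl h x)) * w (incl h x) * (u y - u x)
        - u x * (Real.exp (φ (incl h y)) * w (incl h y) - Real.exp (φ (incl h x)) * w (incl h x))|
      ≤ Real.exp (φ (incl h x)) * |w (incl h x)| * |u y - u x|
        + |u x| * |Real.exp (φ (incl h y)) * w (incl h y) - Real.exp (φ (incl h x)) * w (incl h x)| := by
    calc _ ≤ |Real.exp (φ (incl h x)) * w (incl h x) * (u y - u x)|
          + |u x * (Real.exp (φ (incl h y)) * w (incl h y) - Real.exp (φ (incl h x)) * w (incl h x))| := abs_sub _ _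
      _ = _ := by rw [abs_mul, abs_mul, abs_mul, abs_of_pos (Real.exp_pos _)]
  -- neighbour part
  have hNpart : nbI x y * (Real.exp (φ (incl h x)) * |w (incl h x)| * ((n : ℝ) * |u y - u x|)
        + |u x| * ((n : ℝ) * |Real.exp (φ (incl h y)) * w (incl h y) - Real.exp (φ (incl h x)) * w (incl h x)|))
      ≤ nbI x y * (Real.exp (δ - δ * r) *
        (|w (incl h x)| * ∑ μ, (|Real.exp (ψ x) * fdiff n R μ u x| + |Real.exp (ψ y) * fdiff n R μ u y|)
          + Real.exp (ψ x) * |u x|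
            * (∑ μ, (|fdiff n R₀ μ w (incl h x)| + |fdiff n R₀ μ w (incl h y)|) + 2 * δ * |w (incl h y)|))) := by
    unfold nbI
    by_cases hnb : y.1 ∈ nbrs x.1
    · rw [if_pos hnb, one_mul, one_mul]
      exact nbrPart_le hn h hδ0 hδ1 ψ φ hφ u w hnb hexr hψxy
    · rw [if_neg hnb, zero_mul, zero_mul]
  have hBpart := blkPart_le h hδ0 ψ φ u w hexr heyr hψxy hψyx
  -- `pq ≤ (ε/2)p² + q²/(2ε)`
  have hA1 := am1 (w (incl h x)) (fun μ => Real.exp (ψ x) * fdiff n R μ u x)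
    (fun μ => Real.exp (ψ y) * fdiff n R μ u y) hε
  have hA2 := am2 (Real.exp (ψ x) * |u x|) (w (incl h y)) (fun μ => fdiff n R₀ μ w (incl h x))
    (fun μ => fdiff n R₀ μ w (incl h y)) hε hδ0 hδ1
  have hA3 := am3 (w (incl h x)) (Real.exp (ψ y) * |u y|) (Real.exp (ψ x) * |u x|) hε
  have hA4 := am4 (Real.exp (ψ x) * |u x|) (w (incl h y)) (w (incl h x)) hε
  simp only [Fintype.card_fin, Nat.cast_add, Nat.cast_one] at hA1 hA2
  have hY0x0 : 0 ≤ Real.exp (ψ x) * |u x| := by positivity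
  have hY0y0 : 0 ≤ Real.exp (ψ y) * |u y| := by positivity
  have hY0x2 : (Real.exp (ψ x) * |u x|) ^ 2 = (Real.exp (ψ x) * u x) ^ 2 := by rw [mul_pow, sq_abs, mul_pow]
  have hY0y2 : (Real.exp (ψ y) * |u y|) ^ 2 = (Real.exp (ψ y) * u y) ^ 2 := by rw [mul_pow, sq_abs, mul_pow]
  rw [abs_of_nonneg hY0x0] at hA2 hA4
  rw [abs_of_nonneg hY0y0, abs_of_nonneg hY0x0] at hA3
  rw [hY0x2] at hA2 hA3 hA4
  rw [hY0y2] at hA3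
  have hsplit1 : ∑ μ, ((Real.exp (ψ x) * fdiff n R μ u x) ^ 2 + (Real.exp (ψ y) * fdiff n R μ u y) ^ 2)
      = ∑ μ, (Real.exp (ψ x) * fdiff n R μ u x) ^ 2 + ∑ μ, (Real.exp (ψ y) * fdiff n R μ u y) ^ 2 :=
    Finset.sum_add_distrib
  have hsplit2 : ∑ μ, (fdiff n R₀ μ w (incl h x) ^ 2 + fdiff n R₀ μ w (incl h y) ^ 2)
      = ∑ μ, fdiff n R₀ μ w (incl h x) ^ 2 + ∑ μ, fdiff n R₀ μ w (incl h y) ^ 2 := Finset.sum_add_distrib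
  rw [hsplit1] at hA1
  rw [hsplit2] at hA2
  -- assemble
  rw [abs_mul]
  calc |fineOpR n a m2 R x y * (χ y - χ x)|
        * |Real.exp (φ (incl h x)) * w (incl h x) * (u y - u x)
            - u x * (Real.exp (φ (incl h y)) * w (incl h y) - Real.exp (φ (incl h x)) * w (incl h x))|
      ≤ ((n : ℝ) * nbI x y + a * ((n : ℝ) ^ (d + 1))⁻¹ * bkI n x y)
          * (Real.exp (φ (incl h x)) * |w (incl h x)| * |u y - u x|
            + |u x| * |Real.exp (φ (incl h y)) * w (incl h y) - Real.exp (φ (incl h x)) * w (incl h x)|) :=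
        mul_le_mul hcoef hfac (abs_nonneg _) (by positivity)
    _ = nbI x y * (Real.exp (φ (incl h x)) * |w (incl h x)| * ((n : ℝ) * |u y - u x|)
          + |u x| * ((n : ℝ) * |Real.exp (φ (incl h y)) * w (incl h y) - Real.exp (φ (incl h x)) * w (incl h x)|))
        + a * ((n : ℝ) ^ (d + 1))⁻¹ * bkI n x y * (Real.exp (φ (incl h x)) * |w (incl h x)| * |u y - u x|
          + |u x| * |Real.exp (φ (incl h y)) * w (incl h y) - Real.exp (φ (incl h x)) * w (incl h x)|) := by ring
    _ ≤ nbI x y * (Real.exp (δ - δ * r) *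
          (|w (incl h x)| * ∑ μ, (|Real.exp (ψ x) * fdiff n R μ u x| + |Real.exp (ψ y) * fdiff n R μ u y|)
            + Real.exp (ψ x) * |u x|
              * (∑ μ, (|fdiff n R₀ μ w (incl h x)| + |fdiff n R₀ μ w (incl h y)|) + 2 * δ * |w (incl h y)|)))
        + a * ((n : ℝ) ^ (d + 1))⁻¹ * bkI n x y * (Real.exp (δ - δ * r) *
          (|w (incl h x)| * (Real.exp (ψ y) * |u y| + Real.exp (ψ x) * |u x|)
            + Real.exp (ψ x) * |u x| * (|w (incl h y)| + |w (incl h x)|))) :=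
        add_le_add hNpart (mul_le_mul_of_nonneg_left hBpart (mul_nonneg hab0 hB0))
    _ ≤ nbI x y * (Real.exp (δ - δ * r) *
          ((((d : ℝ) + 1) * ε * w (incl h x) ^ 2
              + 1 / (2 * ε) * (∑ μ, (Real.exp (ψ x) * fdiff n R μ u x) ^ 2
                + ∑ μ, (Real.exp (ψ y) * fdiff n R μ u y) ^ 2))
            + (ε / 2 * (∑ μ, fdiff n R₀ μ w (incl h x) ^ 2 + ∑ μ, fdiff n R₀ μ w (incl h y) ^ 2)
              + 2 * ε * w (incl h y) ^ 2 + (2 * ((d : ℝ) + 1) + 1) / (2 * ε) * (Real.exp (ψ x) * u x) ^ 2)))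
        + a * ((n : ℝ) ^ (d + 1))⁻¹ * bkI n x y * (Real.exp (δ - δ * r) *
          ((ε * w (incl h x) ^ 2 + 1 / (2 * ε) * ((Real.exp (ψ y) * u y) ^ 2 + (Real.exp (ψ x) * u x) ^ 2))
            + (ε / 2 * (w (incl h y) ^ 2 + w (incl h x) ^ 2) + 1 / ε * (Real.exp (ψ x) * u x) ^ 2))) := by
        refine add_le_add (mul_le_mul_of_nonneg_left (mul_le_mul_of_nonneg_left (add_le_add hA1 hA2) hθ0.le) hN0)
          (mul_le_mul_of_nonneg_left (mul_le_mul_of_nonneg_left (add_le_add hA3 hA4) hθ0.le)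
            (mul_nonneg hab0 hB0))
    _ = _ := by
        field_simp
        ring
/-- linearity of a double sum with two kernels and four weights. [folklore] -/
theorem sum_sum_lin4 (K₁ K₂ A B C D : ↥R → ↥R → ℝ) (c₁ c₂ c₃ c₄ : ℝ) :
    ∑ x, ∑ y, (c₁ * (K₁ x y * A x y) + c₂ * (K₁ x y * B x y) + c₃ * (K₂ x y * C x y) + c₄ * (K₂ x y * D x y))
      = c₁ * ∑ x, ∑ y, K₁ x y * A x y + c₂ * ∑ x, ∑ y, K₁ x y * B x y
        + c₃ * ∑ x, ∑ y, K₂ x y * C x y + c₄ * ∑ x, ∑ y, K₂ x y * D x y := by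
  simp only [Finset.sum_add_distrib, Finset.mul_sum]

set_option maxHeartbeats 400000 in
/-- **THE COMMUTATOR PAIRING BOUND** (antisymmetrisation + pointwise bound + counting: each point has `≤ 2(d+1)`
neighbours and exactly `n^{d+1}` block-mates):
`2|Σ_x e^{φ(x̂)} w(x̂) ([H,χ]u)(x)| ≤ e^{δ−δr}(ε·A + ε⁻¹·B)` with
`A = 2(d+1)((d+3)Σ_x w(x̂)² + Σ_{x,μ} (D_μw)(x̂)²) + 2a Σ_x w(x̂)²` and
`B = 2(d+1)(Σ_{x,μ}(e^{ψ}D_μu)(x)² + ((2d+3)/2)Σ_x (e^{ψ}u)(x)²) + 2a Σ_x (e^{ψ}u)(x)²`. [folklore] -/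
theorem two_abs_commPairing_le (hn : 1 ≤ n) (hR : IsBlockUnion n R) (h : R ⊆ R₀) (ha : 0 < a) {δ r ε : ℝ}
    (hδ0 : 0 ≤ δ) (hδ1 : δ ≤ 1) (hε : 0 < ε) (χ : ↥R → ℝ) (hχ0 : ∀ x, 0 ≤ χ x) (hχ1 : ∀ x, χ x ≤ 1)
    (hχlip : ∀ x y, |χ x - χ y| ≤ edistR n R x y) (C' : Finset ↥R)
    (hχC : ∀ x y, edistR n R x y ≤ 1 → χ x ≠ χ y → x ∈ C') (ψ : ↥R → ℝ)
    (hψ : ∀ x y, edistR n R x y ≤ 1 → |ψ x - ψ y| ≤ δ) (φ : ↥R₀ → ℝ)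
    (hφ : ∀ j k : ↥R₀, k.1 ∈ nbrs j.1 → |φ j - φ k| ≤ δ / (n : ℝ))
    (hφC : ∀ x ∈ C', φ (incl h x) ≤ ψ x - δ * r) (u : ↥R → ℝ) (w : ↥R₀ → ℝ) :
    2 * |∑ x, Real.exp (φ (incl h x)) * w (incl h x) * comm n a m2 R χ u x|
      ≤ Real.exp (δ - δ * r) *
        (ε * (2 * ((d : ℝ) + 1) * (((d : ℝ) + 3) * ∑ x, w (incl h x) ^ 2
                + ∑ x, ∑ μ, fdiff n R₀ μ w (incl h x) ^ 2)
              + 2 * a * ∑ x, w (incl h x) ^ 2)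
          + ε⁻¹ * (2 * ((d : ℝ) + 1) * (∑ x, ∑ μ, (Real.exp (ψ x) * fdiff n R μ u x) ^ 2
                + (2 * ((d : ℝ) + 1) + 1) / 2 * ∑ x, (Real.exp (ψ x) * u x) ^ 2)
              + 2 * a * ∑ x, (Real.exp (ψ x) * u x) ^ 2)) := by
  have hn0 : (0 : ℝ) < n := by exact_mod_cast hn
  have hθ0 : 0 < Real.exp (δ - δ * r) := Real.exp_pos _
  -- the four weight functions
  set F1 : ↥R → ℝ := fun x => ((d : ℝ) + 1) * w (incl h x) ^ 2 + 1 / 2 * ∑ μ, fdiff n R₀ μ w (incl h x) ^ 2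
    with hF1
  set G1 : ↥R → ℝ := fun y => 1 / 2 * ∑ μ, fdiff n R₀ μ w (incl h y) ^ 2 + 2 * w (incl h y) ^ 2 with hG1
  set F2 : ↥R → ℝ := fun x => 1 / 2 * ∑ μ, (Real.exp (ψ x) * fdiff n R μ u x) ^ 2
    + (2 * ((d : ℝ) + 1) + 1) / 2 * (Real.exp (ψ x) * u x) ^ 2 with hF2
  set G2 : ↥R → ℝ := fun y => 1 / 2 * ∑ μ, (Real.exp (ψ y) * fdiff n R μ u y) ^ 2 with hG2
  set F3 : ↥R → ℝ := fun x => 3 / 2 * w (incl h x) ^ 2 with hF3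
  set G3 : ↥R → ℝ := fun y => 1 / 2 * w (incl h y) ^ 2 with hG3
  set F4 : ↥R → ℝ := fun x => 3 / 2 * (Real.exp (ψ x) * u x) ^ 2 with hF4
  set G4 : ↥R → ℝ := fun y => 1 / 2 * (Real.exp (ψ y) * u y) ^ 2 with hG4
  have hF1p : ∀ x, 0 ≤ F1 x := fun x => by
    simp only [hF1]; have := Finset.sum_nonneg (s := Finset.univ) fun μ (_ : μ ∈ Finset.univ) =>
      sq_nonneg (fdiff n R₀ μ w (incl h x)); positivity
  have hG1p : ∀ y, 0 ≤ G1 y := fun y => by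
    simp only [hG1]; have := Finset.sum_nonneg (s := Finset.univ) fun μ (_ : μ ∈ Finset.univ) =>
      sq_nonneg (fdiff n R₀ μ w (incl h y)); positivity
  have hF2p : ∀ x, 0 ≤ F2 x := fun x => by
    simp only [hF2]; have := Finset.sum_nonneg (s := Finset.univ) fun μ (_ : μ ∈ Finset.univ) =>
      sq_nonneg (Real.exp (ψ x) * fdiff n R μ u x); positivity
  have hG2p : ∀ y, 0 ≤ G2 y := fun y => by
    simp only [hG2]; have := Finset.sum_nonneg (s := Finset.univ) fun μ (_ : μ ∈ Finset.univ) =>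
      sq_nonneg (Real.exp (ψ y) * fdiff n R μ u y); positivity
  have hF3p : ∀ x, 0 ≤ F3 x := fun x => by simp only [hF3]; positivity
  have hG3p : ∀ y, 0 ≤ G3 y := fun y => by simp only [hG3]; positivity
  have hF4p : ∀ x, 0 ≤ F4 x := fun x => by simp only [hF4]; positivity
  have hG4p : ∀ y, 0 ≤ G4 y := fun y => by simp only [hG4]; positivity
  -- pointwise
  have hpt : ∀ x y, |fineOpR n a m2 R x y * (χ y - χ x)
        * (Real.exp (φ (incl h x)) * w (incl h x) * (u y - u x)
            - u x * (Real.exp (φ (incl h y)) * w (incl h y) - Real.exp (φ (incl h x)) * w (incl h x)))|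
      ≤ Real.exp (δ - δ * r) * ε * (nbI x y * (F1 x + G1 y)) + Real.exp (δ - δ * r) * ε⁻¹ * (nbI x y * (F2 x + G2 y))
        + Real.exp (δ - δ * r) * (a * ((n : ℝ) ^ (d + 1))⁻¹) * ε * (bkI n x y * (F3 x + G3 y))
        + Real.exp (δ - δ * r) * (a * ((n : ℝ) ^ (d + 1))⁻¹) * ε⁻¹ * (bkI n x y * (F4 x + G4 y)) := by
    intro x y
    refine (commTerm_le (m2 := m2) hn h ha hδ0 hδ1 hε χ hχ0 hχ1 hχlip C' hχC ψ hψ φ hφ hφC u w x y).trans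
      (le_of_eq ?_)
    simp only [hF1, hG1, hF2, hG2, hF3, hG3, hF4, hG4]
    ring
  -- antisymmetrise and sum
  have hP := two_commPairing_eq (n := n) (a := a) (m2 := m2) χ u (fun x => Real.exp (φ (incl h x)) * w (incl h x))
  have h2abs : 2 * |∑ x, Real.exp (φ (incl h x)) * w (incl h x) * comm n a m2 R χ u x|
      = |∑ x, ∑ y, fineOpR n a m2 R x y * (χ y - χ x)
          * (Real.exp (φ (incl h x)) * w (incl h x) * (u y - u x)
            - u x * (Real.exp (φ (incl h y)) * w (incl h y) - Real.exp (φ (incl h x)) * w (incl h x)))| := by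
    rw [← hP, abs_mul, abs_two]
  rw [h2abs]
  have hsum := sum_sum_lin4 (R := R) nbI (bkI n) (fun x y => F1 x + G1 y) (fun x y => F2 x + G2 y)
    (fun x y => F3 x + G3 y) (fun x y => F4 x + G4 y) (Real.exp (δ - δ * r) * ε) (Real.exp (δ - δ * r) * ε⁻¹)
    (Real.exp (δ - δ * r) * (a * ((n : ℝ) ^ (d + 1))⁻¹) * ε)
    (Real.exp (δ - δ * r) * (a * ((n : ℝ) ^ (d + 1))⁻¹) * ε⁻¹)
  have hb1 := sum_sum_mul_add_le nbI sum_nbI_le sum_nbI_le' F1 G1 hF1p hG1p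
  have hb2 := sum_sum_mul_add_le nbI sum_nbI_le sum_nbI_le' F2 G2 hF2p hG2p
  have hb3 := sum_sum_mul_add_le (bkI n) (sum_bkI_le hn hR) (sum_bkI_le' hn hR) F3 G3 hF3p hG3p
  have hb4 := sum_sum_mul_add_le (bkI n) (sum_bkI_le hn hR) (sum_bkI_le' hn hR) F4 G4 hF4p hG4p
  -- evaluate the single sums
  have e1 : ∑ x, F1 x + ∑ y, G1 y
      = ((d : ℝ) + 3) * ∑ x, w (incl h x) ^ 2 + ∑ x, ∑ μ, fdiff n R₀ μ w (incl h x) ^ 2 := by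
    simp only [hF1, hG1, Finset.sum_add_distrib, ← Finset.mul_sum]; ring
  have e2 : ∑ x, F2 x + ∑ y, G2 y
      = ∑ x, ∑ μ, (Real.exp (ψ x) * fdiff n R μ u x) ^ 2
        + (2 * ((d : ℝ) + 1) + 1) / 2 * ∑ x, (Real.exp (ψ x) * u x) ^ 2 := by
    simp only [hF2, hG2, Finset.sum_add_distrib, ← Finset.mul_sum]; ring
  have e3 : ∑ x, F3 x + ∑ y, G3 y = 2 * ∑ x, w (incl h x) ^ 2 := by
    simp only [hF3, hG3, ← Finset.mul_sum]; ring
  have e4 : ∑ x, F4 x + ∑ y, G4 y = 2 * ∑ x, (Real.exp (ψ x) * u x) ^ 2 := by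
    simp only [hF4, hG4, ← Finset.mul_sum]; ring
  rw [e1] at hb1
  rw [e2] at hb2
  rw [e3] at hb3
  rw [e4] at hb4
  have hk1 : 0 ≤ Real.exp (δ - δ * r) * ε := by positivity
  have hk2 : 0 ≤ Real.exp (δ - δ * r) * ε⁻¹ := by positivity
  have hk3 : 0 ≤ Real.exp (δ - δ * r) * (a * ((n : ℝ) ^ (d + 1))⁻¹) * ε := by positivity
  have hk4 : 0 ≤ Real.exp (δ - δ * r) * (a * ((n : ℝ) ^ (d + 1))⁻¹) * ε⁻¹ := by positivity
  have han : a * ((n : ℝ) ^ (d + 1))⁻¹ * (n : ℝ) ^ (d + 1) = a := by field_simp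
  calc |∑ x, ∑ y, fineOpR n a m2 R x y * (χ y - χ x)
          * (Real.exp (φ (incl h x)) * w (incl h x) * (u y - u x)
            - u x * (Real.exp (φ (incl h y)) * w (incl h y) - Real.exp (φ (incl h x)) * w (incl h x)))|
      ≤ ∑ x, |∑ y, fineOpR n a m2 R x y * (χ y - χ x)
          * (Real.exp (φ (incl h x)) * w (incl h x) * (u y - u x)
            - u x * (Real.exp (φ (incl h y)) * w (incl h y) - Real.exp (φ (incl h x)) * w (incl h x)))| :=
        Finset.abs_sum_le_sum_abs _ _
    _ ≤ ∑ x, ∑ y, |fineOpR n a m2 R x y * (χ y - χ x)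
          * (Real.exp (φ (incl h x)) * w (incl h x) * (u y - u x)
            - u x * (Real.exp (φ (incl h y)) * w (incl h y) - Real.exp (φ (incl h x)) * w (incl h x)))| :=
        Finset.sum_le_sum fun x _ => Finset.abs_sum_le_sum_abs _ _
    _ ≤ ∑ x, ∑ y, (Real.exp (δ - δ * r) * ε * (nbI x y * (F1 x + G1 y))
          + Real.exp (δ - δ * r) * ε⁻¹ * (nbI x y * (F2 x + G2 y))
          + Real.exp (δ - δ * r) * (a * ((n : ℝ) ^ (d + 1))⁻¹) * ε * (bkI n x y * (F3 x + G3 y))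
          + Real.exp (δ - δ * r) * (a * ((n : ℝ) ^ (d + 1))⁻¹) * ε⁻¹ * (bkI n x y * (F4 x + G4 y))) :=
        Finset.sum_le_sum fun x _ => Finset.sum_le_sum fun y _ => hpt x y
    _ = _ := hsum
    _ ≤ Real.exp (δ - δ * r) * ε
          * (2 * ((d : ℝ) + 1) * (((d : ℝ) + 3) * ∑ x, w (incl h x) ^ 2 + ∑ x, ∑ μ, fdiff n R₀ μ w (incl h x) ^ 2))
        + Real.exp (δ - δ * r) * ε⁻¹
          * (2 * ((d : ℝ) + 1) * (∑ x, ∑ μ, (Real.exp (ψ x) * fdiff n R μ u x) ^ 2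
            + (2 * ((d : ℝ) + 1) + 1) / 2 * ∑ x, (Real.exp (ψ x) * u x) ^ 2))
        + Real.exp (δ - δ * r) * (a * ((n : ℝ) ^ (d + 1))⁻¹) * ε
          * ((n : ℝ) ^ (d + 1) * (2 * ∑ x, w (incl h x) ^ 2))
        + Real.exp (δ - δ * r) * (a * ((n : ℝ) ^ (d + 1))⁻¹) * ε⁻¹
          * ((n : ℝ) ^ (d + 1) * (2 * ∑ x, (Real.exp (ψ x) * u x) ^ 2)) :=
        add_le_add (add_le_add (add_le_add (mul_le_mul_of_nonneg_left hb1 hk1)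
          (mul_le_mul_of_nonneg_left hb2 hk2)) (mul_le_mul_of_nonneg_left hb3 hk3))
          (mul_le_mul_of_nonneg_left hb4 hk4)
    _ = _ := by
        have e5 : ∀ X : ℝ, Real.exp (δ - δ * r) * (a * ((n : ℝ) ^ (d + 1))⁻¹) * ε * ((n : ℝ) ^ (d + 1) * X)
            = Real.exp (δ - δ * r) * ε * (a * X) := fun X => by
          calc _ = Real.exp (δ - δ * r) * ε * ((a * ((n : ℝ) ^ (d + 1))⁻¹ * (n : ℝ) ^ (d + 1)) * X) := by ring
            _ = _ := by rw [han]
        have e6 : ∀ X : ℝ, Real.exp (δ - δ * r) * (a * ((n : ℝ) ^ (d + 1))⁻¹) * ε⁻¹ * ((n : ℝ) ^ (d + 1) * X)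
            = Real.exp (δ - δ * r) * ε⁻¹ * (a * X) := fun X => by
          calc _ = Real.exp (δ - δ * r) * ε⁻¹ * ((a * ((n : ℝ) ^ (d + 1))⁻¹ * (n : ℝ) ^ (d + 1)) * X) := by ring
            _ = _ := by rw [han]
        rw [e5, e6]; ring

end Core

/-! ## §5b  The source pairing and the energy bound for the corrector -/

section Energy

variable {n : ℕ} {R R₀ : Finset (Fin (d + 1) → ℤ)} {a m2 : ℝ}

/-- `2|p||q| ≤ ε p² + ε⁻¹ q²`. [folklore] -/
theorem two_abs_mul_abs_le (p q : ℝ) {ε : ℝ} (hε : 0 < ε) : 2 * (|p| * |q|) ≤ ε * p ^ 2 + ε⁻¹ * q ^ 2 := by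
  have h1 := abs_mul_abs_le_eps p q hε
  have e : ε * p ^ 2 + ε⁻¹ * q ^ 2 = 2 * (ε / 2 * p ^ 2 + 1 / (2 * ε) * q ^ 2) := by ring
  rw [e]; linarith

/-- **SOURCE PAIRING, CASE `g' = f'`**: `2|Σ_x e^{φ(x̂)}w(x̂)(1−χ(x))f'(x)| ≤ ε e^{−2δr}Σ_x w(x̂)² + ε⁻¹Σ f'²`
(on `supp f'` the weight `ψ ≤ 0`, and `χ(x) ≠ 1` puts `x` in the collar where `φ ≤ ψ − δr`). [folklore] -/
theorem two_abs_srcPairingA_le (h : R ⊆ R₀) {δ r ε : ℝ} (hε : 0 < ε) (χ : ↥R → ℝ) (hχ0 : ∀ x, 0 ≤ χ x)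
    (hχ1 : ∀ x, χ x ≤ 1) (C' : Finset ↥R) (hχC1 : ∀ x, χ x ≠ 1 → x ∈ C') (ψ f' : ↥R → ℝ)
    (hψT : ∀ x, f' x ≠ 0 → ψ x ≤ 0) (φ : ↥R₀ → ℝ) (hφC : ∀ x ∈ C', φ (incl h x) ≤ ψ x - δ * r)
    (w : ↥R₀ → ℝ) :
    2 * |∑ x, Real.exp (φ (incl h x)) * w (incl h x) * ((1 - χ x) * f' x)|
      ≤ ε * Real.exp (-(2 * (δ * r))) * ∑ x, w (incl h x) ^ 2 + ε⁻¹ * ∑ x, f' x ^ 2 := by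
  have hpt : ∀ x, |Real.exp (φ (incl h x)) * w (incl h x) * ((1 - χ x) * f' x)|
      ≤ |Real.exp (-(δ * r)) * w (incl h x)| * |f' x| := by
    intro x
    by_cases hf : f' x = 0
    · simp [hf]
    by_cases hc : χ x = 1
    · rw [hc, sub_self, zero_mul, mul_zero, abs_zero]; positivity
    have hxC := hχC1 x hc
    have hex : Real.exp (φ (incl h x)) ≤ Real.exp (-(δ * r)) :=
      Real.exp_le_exp.2 (by linarith [hφC x hxC, hψT x hf])
    have h1c : |1 - χ x| ≤ 1 := by rw [abs_le]; constructor <;> linarith [hχ0 x, hχ1 x]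
    calc |Real.exp (φ (incl h x)) * w (incl h x) * ((1 - χ x) * f' x)|
        = Real.exp (φ (incl h x)) * |w (incl h x)| * (|1 - χ x| * |f' x|) := by
          rw [abs_mul, abs_mul, abs_mul, abs_of_pos (Real.exp_pos _)]
      _ ≤ Real.exp (-(δ * r)) * |w (incl h x)| * (1 * |f' x|) :=
          mul_le_mul (mul_le_mul_of_nonneg_right hex (abs_nonneg _))
            (mul_le_mul_of_nonneg_right h1c (abs_nonneg _)) (by positivity) (by positivity)
      _ = _ := by rw [abs_mul, abs_of_pos (Real.exp_pos _)]; ring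
  have hexp2 : ∀ x, (Real.exp (-(δ * r)) * w (incl h x)) ^ 2 = Real.exp (-(2 * (δ * r))) * w (incl h x) ^ 2 := by
    intro x; rw [mul_pow, sq (Real.exp _), ← Real.exp_add]; congr 1; congr 1; ring
  calc 2 * |∑ x, Real.exp (φ (incl h x)) * w (incl h x) * ((1 - χ x) * f' x)|
      ≤ 2 * ∑ x, |Real.exp (-(δ * r)) * w (incl h x)| * |f' x| :=
        mul_le_mul_of_nonneg_left ((Finset.abs_sum_le_sum_abs _ _).trans (Finset.sum_le_sum fun x _ => hpt x))
          (by norm_num)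
    _ = ∑ x, 2 * (|Real.exp (-(δ * r)) * w (incl h x)| * |f' x|) := by rw [Finset.mul_sum]
    _ ≤ ∑ x, (ε * (Real.exp (-(δ * r)) * w (incl h x)) ^ 2 + ε⁻¹ * f' x ^ 2) :=
        Finset.sum_le_sum fun x _ => two_abs_mul_abs_le _ _ hε
    _ = _ := by
        simp only [hexp2, Finset.sum_add_distrib, ← Finset.mul_sum]; ring

/-- shifted squares along the inclusion: `Σ_{x∈R} (ext ω)(x̂ + e_ν)² ≤ Σ_{j∈R₀} ω(j)²`. [folklore] -/
theorem sum_incl_shift_sq_le (h : R ⊆ R₀) (ν : Fin (d + 1)) (ω : ↥R₀ → ℝ) :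
    ∑ x, extR ω ((incl h x).1 + uvec ν) ^ 2 ≤ ∑ j, ω j ^ 2 := by
  classical
  have : ∑ x, extR ω ((incl h x).1 + uvec ν) ^ 2
      = ∑ j ∈ (Finset.univ : Finset ↥R).map ⟨incl h, incl_injective h⟩, extR ω (j.1 + uvec ν) ^ 2 := by
    rw [Finset.sum_map]; rfl
  rw [this]; exact sum_sq_shift_le ν ω _

/-- **THE `D_ν`-DERIVATIVE OF THE CUT-OFF CONJUGATED CORRECTOR ON THE SUPPORT OF THE SOURCE**: for `f'(x) ≠ 0`,
`|D_ν(e^{φ}w(1−χ))(x)| ≤ e^{2δ−δr}(Σ_μ(|D_μw(x̂)| + |D_μw(x̂+e_ν)|) + 2δ|w(x̂+e_ν)| + |w(x̂)|)`. [folklore] -/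
theorem abs_fdiff_cutV_le (hn : 1 ≤ n) (h : R ⊆ R₀) {δ r : ℝ} (hδ0 : 0 ≤ δ) (hδ1 : δ ≤ 1) (χ : ↥R → ℝ)
    (hχ0 : ∀ x, 0 ≤ χ x) (hχ1 : ∀ x, χ x ≤ 1) (hχlip : ∀ x y, |χ x - χ y| ≤ edistR n R x y)
    (C' : Finset ↥R) (hχC : ∀ x y, edistR n R x y ≤ 1 → χ x ≠ χ y → x ∈ C') (hχC1 : ∀ x, χ x ≠ 1 → x ∈ C')
    (ψ : ↥R → ℝ) (hψ : ∀ x y, edistR n R x y ≤ 1 → |ψ x - ψ y| ≤ δ) (f' : ↥R → ℝ)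
    (hψT : ∀ x, f' x ≠ 0 → ψ x ≤ 0) (φ : ↥R₀ → ℝ)
    (hφ : ∀ j k : ↥R₀, k.1 ∈ nbrs j.1 → |φ j - φ k| ≤ δ / (n : ℝ))
    (hφC : ∀ x ∈ C', φ (incl h x) ≤ ψ x - δ * r) (w : ↥R₀ → ℝ) (ν : Fin (d + 1)) {x : ↥R}
    (hx : f' x ≠ 0) :
    |fdiff n R ν (fun y => Real.exp (φ (incl h y)) * w (incl h y) * (1 - χ y)) x|
      ≤ Real.exp (2 * δ - δ * r) *
        (∑ μ, (|fdiff n R₀ μ w (incl h x)| + |extR (fdiff n R₀ μ w) ((incl h x).1 + uvec ν)|)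
          + 2 * δ * |extR w ((incl h x).1 + uvec ν)| + |w (incl h x)|) := by
  have hn0 : (0 : ℝ) < n := by exact_mod_cast hn
  have hn1 : (1 : ℝ) ≤ n := by exact_mod_cast hn
  have hΘ0 : 0 < Real.exp (2 * δ - δ * r) := Real.exp_pos _
  have hRHS : 0 ≤ Real.exp (2 * δ - δ * r) *
        (∑ μ, (|fdiff n R₀ μ w (incl h x)| + |extR (fdiff n R₀ μ w) ((incl h x).1 + uvec ν)|)
          + 2 * δ * |extR w ((incl h x).1 + uvec ν)| + |w (incl h x)|) := by
    have := Finset.sum_nonneg (s := Finset.univ) fun μ (_ : μ ∈ Finset.univ) =>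
      add_nonneg (abs_nonneg (fdiff n R₀ μ w (incl h x))) (abs_nonneg (extR (fdiff n R₀ μ w) ((incl h x).1 + uvec ν)))
    positivity
  have hψx : ψ x ≤ 0 := hψT x hx
  by_cases hx' : x.1 + uvec ν ∈ R
  · set x' : ↥R := ⟨x.1 + uvec ν, hx'⟩ with hx'def
    have hx'0 : (incl h x).1 + uvec ν ∈ R₀ := h hx'
    have ev1 : ∀ μ, extR (fdiff n R₀ μ w) ((incl h x).1 + uvec ν) = fdiff n R₀ μ w (incl h x') := fun μ => by
      rw [extR_of_mem _ hx'0]; rfl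
    have ev2 : extR w ((incl h x).1 + uvec ν) = w (incl h x') := by rw [extR_of_mem _ hx'0]; rfl
    have hnb : x'.1 ∈ nbrs x.1 := add_uvec_mem_nbrs x.1 ν
    have hnb0 : (incl h x').1 ∈ nbrs (incl h x).1 := hnb
    have hdn : edistR n R x x' ≤ 1 / (n : ℝ) := edistR_le_of_mem_nbrs hn hnb
    have h1n : 1 / (n : ℝ) ≤ 1 := by rw [div_le_one hn0]; exact hn1
    have hd : edistR n R x x' ≤ 1 := hdn.trans h1n
    rw [fdiff_of_mem _ hx']
    -- decomposition of the difference
    have hdec : (n : ℝ) * (Real.exp (φ (incl h x')) * w (incl h x') * (1 - χ x')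
          - Real.exp (φ (incl h x)) * w (incl h x) * (1 - χ x))
        = (1 - χ x') * ((n : ℝ) * (Real.exp (φ (incl h x')) * w (incl h x') - Real.exp (φ (incl h x)) * w (incl h x)))
          + (n : ℝ) * (χ x - χ x') * (Real.exp (φ (incl h x)) * w (incl h x)) := by ring
    -- term 1
    have hT1 : |(1 - χ x') * ((n : ℝ) * (Real.exp (φ (incl h x')) * w (incl h x')
          - Real.exp (φ (incl h x)) * w (incl h x)))|
        ≤ Real.exp (2 * δ - δ * r) *
          (∑ μ, (|fdiff n R₀ μ w (incl h x)| + |fdiff n R₀ μ w (incl h x')|) + 2 * δ * |w (incl h x')|) := by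
      by_cases hc1 : χ x' = 1
      · rw [hc1, sub_self, zero_mul, abs_zero]
        have := Finset.sum_nonneg (s := Finset.univ) fun μ (_ : μ ∈ Finset.univ) =>
          add_nonneg (abs_nonneg (fdiff n R₀ μ w (incl h x))) (abs_nonneg (fdiff n R₀ μ w (incl h x')))
        positivity
      have hx'C := hχC1 x' hc1
      have hψ' : ψ x' ≤ ψ x + δ := by
        have := hψ x x' hd; rw [abs_le] at this; linarith
      have hφx : φ (incl h x) ≤ 2 * δ - δ * r := by
        have h1 := hφ (incl h x) (incl h x') hnb0
        rw [abs_le] at h1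
        have h2 : δ / (n : ℝ) ≤ δ := by rw [div_le_iff₀ hn0]; nlinarith
        linarith [hφC x' hx'C, h1.2]
      have hDV := nat_mul_abs_dV_le hn hδ1 φ hφ w hnb0
      have h1c : |1 - χ x'| ≤ 1 := by rw [abs_le]; constructor <;> linarith [hχ0 x', hχ1 x']
      have hS : 0 ≤ ∑ μ, (|fdiff n R₀ μ w (incl h x)| + |fdiff n R₀ μ w (incl h x')|) + 2 * δ * |w (incl h x')| := by
        have := Finset.sum_nonneg (s := Finset.univ) fun μ (_ : μ ∈ Finset.univ) =>
          add_nonneg (abs_nonneg (fdiff n R₀ μ w (incl h x))) (abs_nonneg (fdiff n R₀ μ w (incl h x')))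
        positivity
      rw [abs_mul, abs_mul, abs_of_nonneg hn0.le]
      calc |1 - χ x'| * ((n : ℝ) * |Real.exp (φ (incl h x')) * w (incl h x') - Real.exp (φ (incl h x)) * w (incl h x)|)
          ≤ 1 * (Real.exp (φ (incl h x))
              * (∑ μ, (|fdiff n R₀ μ w (incl h x)| + |fdiff n R₀ μ w (incl h x')|) + 2 * δ * |w (incl h x')|)) :=
            mul_le_mul h1c hDV (by positivity) (by norm_num)
        _ ≤ 1 * (Real.exp (2 * δ - δ * r)
              * (∑ μ, (|fdiff n R₀ μ w (incl h x)| + |fdiff n R₀ μ w (incl h x')|) + 2 * δ * |w (incl h x')|)) := by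
            refine mul_le_mul_of_nonneg_left (mul_le_mul_of_nonneg_right (Real.exp_le_exp.2 hφx) hS) (by norm_num)
        _ = _ := one_mul _
    -- term 2
    have hT2 : |(n : ℝ) * (χ x - χ x') * (Real.exp (φ (incl h x)) * w (incl h x))|
        ≤ Real.exp (2 * δ - δ * r) * |w (incl h x)| := by
      by_cases hc2 : χ x = χ x'
      · rw [hc2, sub_self, mul_zero, zero_mul, abs_zero]; positivity
      have hxC := hχC x x' hd hc2
      have hφx : φ (incl h x) ≤ 2 * δ - δ * r := by linarith [hφC x hxC]
      have hnχ : (n : ℝ) * |χ x - χ x'| ≤ 1 := by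
        calc (n : ℝ) * |χ x - χ x'| ≤ (n : ℝ) * (1 / (n : ℝ)) :=
              mul_le_mul_of_nonneg_left ((hχlip x x').trans hdn) hn0.le
          _ = 1 := by field_simp
      rw [abs_mul, abs_mul, abs_mul, abs_of_nonneg hn0.le, abs_of_pos (Real.exp_pos _)]
      calc (n : ℝ) * |χ x - χ x'| * (Real.exp (φ (incl h x)) * |w (incl h x)|)
          ≤ 1 * (Real.exp (2 * δ - δ * r) * |w (incl h x)|) :=
            mul_le_mul hnχ (mul_le_mul_of_nonneg_right (Real.exp_le_exp.2 hφx) (abs_nonneg _))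
              (by positivity) (by norm_num)
        _ = _ := one_mul _
    rw [hdec]
    refine (abs_add_le _ _).trans ?_
    refine (add_le_add hT1 hT2).trans (le_of_eq ?_)
    simp only [ev1, ev2]
    ring
  · rw [fdiff_of_not_mem _ hx', abs_zero]; exact hRHS

/-- `(Σ_μ(p_μ + q_μ) + s + t)² ≤ 4(d+1)(Σ_μ(p_μ² + q_μ²) + s² + t²)` over `Fin (d+1)`. [folklore] -/
theorem sq_bigsum_le (p q : Fin (d + 1) → ℝ) (s t : ℝ) :
    (∑ μ, (p μ + q μ) + s + t) ^ 2 ≤ 4 * ((d : ℝ) + 1) * (∑ μ, (p μ ^ 2 + q μ ^ 2) + s ^ 2 + t ^ 2) := by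
  have hA := sq_sum_le_card_mul_sum_sq (s := (Finset.univ : Finset (Fin (d + 1)))) (f := p)
  have hB := sq_sum_le_card_mul_sum_sq (s := (Finset.univ : Finset (Fin (d + 1)))) (f := q)
  simp only [Finset.card_univ, Fintype.card_fin, Nat.cast_add, Nat.cast_one] at hA hB
  simp only [Finset.sum_add_distrib]
  have h4 : (∑ μ, p μ + ∑ μ, q μ + s + t) ^ 2
      ≤ 4 * ((∑ μ, p μ) ^ 2 + (∑ μ, q μ) ^ 2 + s ^ 2 + t ^ 2) := by
    nlinarith [sq_nonneg (∑ μ, p μ - ∑ μ, q μ), sq_nonneg (∑ μ, p μ - s), sq_nonneg (∑ μ, p μ - t),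
      sq_nonneg (∑ μ, q μ - s), sq_nonneg (∑ μ, q μ - t), sq_nonneg (s - t)]
  have hd1 : (1 : ℝ) ≤ (d : ℝ) + 1 := by have : (0 : ℝ) ≤ d := Nat.cast_nonneg d; linarith
  have hp0 : 0 ≤ ∑ μ, p μ ^ 2 := Finset.sum_nonneg fun _ _ => sq_nonneg _
  have hq0 : 0 ≤ ∑ μ, q μ ^ 2 := Finset.sum_nonneg fun _ _ => sq_nonneg _
  nlinarith [mul_le_mul_of_nonneg_right hd1 hp0, mul_le_mul_of_nonneg_right hd1 hq0,
    mul_le_mul_of_nonneg_right hd1 (sq_nonneg s), mul_le_mul_of_nonneg_right hd1 (sq_nonneg t)]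

set_option maxHeartbeats 400000 in
/-- **SOURCE PAIRING, CASE `g' = D_ν^⊤f'`** (move `D_ν` onto the weighted side, never onto `f'`):
`2|Σ_x e^{φ(x̂)}w(x̂)(1−χ(x))(D_ν^⊤f')(x)| ≤ ε e^{4δ−2δr}·4(d+1)·(2Σ_{μ,j}(D_μw)_j² + 5Σ_j w_j²) + ε⁻¹Σ f'²`. [folklore] -/
theorem two_abs_srcPairingB_le (hn : 1 ≤ n) (h : R ⊆ R₀) {δ r ε : ℝ} (hδ0 : 0 ≤ δ) (hδ1 : δ ≤ 1)
    (hε : 0 < ε) (χ : ↥R → ℝ) (hχ0 : ∀ x, 0 ≤ χ x) (hχ1 : ∀ x, χ x ≤ 1)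
    (hχlip : ∀ x y, |χ x - χ y| ≤ edistR n R x y) (C' : Finset ↥R)
    (hχC : ∀ x y, edistR n R x y ≤ 1 → χ x ≠ χ y → x ∈ C') (hχC1 : ∀ x, χ x ≠ 1 → x ∈ C')
    (ψ : ↥R → ℝ) (hψ : ∀ x y, edistR n R x y ≤ 1 → |ψ x - ψ y| ≤ δ) (f' : ↥R → ℝ)
    (hψT : ∀ x, f' x ≠ 0 → ψ x ≤ 0) (φ : ↥R₀ → ℝ)
    (hφ : ∀ j k : ↥R₀, k.1 ∈ nbrs j.1 → |φ j - φ k| ≤ δ / (n : ℝ))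
    (hφC : ∀ x ∈ C', φ (incl h x) ≤ ψ x - δ * r) (w : ↥R₀ → ℝ) (ν : Fin (d + 1)) :
    2 * |∑ x, Real.exp (φ (incl h x)) * w (incl h x) * ((1 - χ x) * fdiffT n R ν f' x)|
      ≤ ε * (Real.exp (4 * δ - 2 * (δ * r)) * (4 * ((d : ℝ) + 1))
          * (2 * ∑ μ, ∑ j, fdiff n R₀ μ w j ^ 2 + 5 * ∑ j, w j ^ 2))
        + ε⁻¹ * ∑ x, f' x ^ 2 := by
  set g : ↥R → ℝ := fun y => Real.exp (φ (incl h y)) * w (incl h y) * (1 - χ y) with hg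
  -- move `D_ν` to the weighted side
  have hP : ∑ x, Real.exp (φ (incl h x)) * w (incl h x) * ((1 - χ x) * fdiffT n R ν f' x)
      = ∑ x, fdiff n R ν g x * f' x := by
    have h1 : ∑ x, Real.exp (φ (incl h x)) * w (incl h x) * ((1 - χ x) * fdiffT n R ν f' x)
        = g ⬝ᵥ fdiffT n R ν f' := by
      simp only [dotProduct, hg]; exact Finset.sum_congr rfl fun x _ => by ring
    rw [h1, dot_fdiffT]; rfl
  rw [hP]
  -- the pointwise bound `B x`
  set B : ↥R → ℝ := fun x => Real.exp (2 * δ - δ * r) *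
        (∑ μ, (|fdiff n R₀ μ w (incl h x)| + |extR (fdiff n R₀ μ w) ((incl h x).1 + uvec ν)|)
          + 2 * δ * |extR w ((incl h x).1 + uvec ν)| + |w (incl h x)|) with hB
  have hB0 : ∀ x, 0 ≤ B x := fun x => by
    simp only [hB]
    have := Finset.sum_nonneg (s := Finset.univ) fun μ (_ : μ ∈ Finset.univ) =>
      add_nonneg (abs_nonneg (fdiff n R₀ μ w (incl h x))) (abs_nonneg (extR (fdiff n R₀ μ w) ((incl h x).1 + uvec ν)))
    positivity
  have hpt : ∀ x, 2 * |fdiff n R ν g x * f' x| ≤ ε * B x ^ 2 + ε⁻¹ * f' x ^ 2 := by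
    intro x
    by_cases hx : f' x = 0
    · rw [hx, mul_zero, abs_zero, mul_zero]; have := hB0 x; positivity
    have hb : |fdiff n R ν g x| ≤ B x :=
      abs_fdiff_cutV_le hn h hδ0 hδ1 χ hχ0 hχ1 hχlip C' hχC hχC1 ψ hψ f' hψT φ hφ hφC w ν hx
    calc 2 * |fdiff n R ν g x * f' x| = 2 * (|fdiff n R ν g x| * |f' x|) := by rw [abs_mul]
      _ ≤ 2 * (|B x| * |f' x|) := by
          rw [abs_of_nonneg (hB0 x)]
          exact mul_le_mul_of_nonneg_left (mul_le_mul_of_nonneg_right hb (abs_nonneg _)) (by norm_num)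
      _ ≤ _ := two_abs_mul_abs_le _ _ hε
  -- sum of `B x²`
  have hBsq : ∀ x, B x ^ 2 ≤ Real.exp (4 * δ - 2 * (δ * r)) * (4 * ((d : ℝ) + 1))
      * (∑ μ, (fdiff n R₀ μ w (incl h x) ^ 2 + extR (fdiff n R₀ μ w) ((incl h x).1 + uvec ν) ^ 2)
          + (2 * δ * |extR w ((incl h x).1 + uvec ν)|) ^ 2 + w (incl h x) ^ 2) := by
    intro x
    have hcs := sq_bigsum_le (fun μ => |fdiff n R₀ μ w (incl h x)|)
      (fun μ => |extR (fdiff n R₀ μ w) ((incl h x).1 + uvec ν)|) (2 * δ * |extR w ((incl h x).1 + uvec ν)|)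
      |w (incl h x)|
    simp only [sq_abs] at hcs
    have hexp : Real.exp (2 * δ - δ * r) ^ 2 = Real.exp (4 * δ - 2 * (δ * r)) := by
      rw [sq, ← Real.exp_add]; congr 1; ring
    calc B x ^ 2 = Real.exp (4 * δ - 2 * (δ * r)) *
          (∑ μ, (|fdiff n R₀ μ w (incl h x)| + |extR (fdiff n R₀ μ w) ((incl h x).1 + uvec ν)|)
            + 2 * δ * |extR w ((incl h x).1 + uvec ν)| + |w (incl h x)|) ^ 2 := by
          simp only [hB]; rw [mul_pow, hexp]
      _ ≤ Real.exp (4 * δ - 2 * (δ * r)) * (4 * ((d : ℝ) + 1)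
          * (∑ μ, (fdiff n R₀ μ w (incl h x) ^ 2 + extR (fdiff n R₀ μ w) ((incl h x).1 + uvec ν) ^ 2)
            + (2 * δ * |extR w ((incl h x).1 + uvec ν)|) ^ 2 + w (incl h x) ^ 2)) :=
          mul_le_mul_of_nonneg_left hcs (Real.exp_pos _).le
      _ = _ := by ring
  have hsumB : ∑ x, B x ^ 2 ≤ Real.exp (4 * δ - 2 * (δ * r)) * (4 * ((d : ℝ) + 1))
      * (2 * ∑ μ, ∑ j, fdiff n R₀ μ w j ^ 2 + 5 * ∑ j, w j ^ 2) := by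
    have s1 : ∑ x, ∑ μ, (fdiff n R₀ μ w (incl h x) ^ 2 + extR (fdiff n R₀ μ w) ((incl h x).1 + uvec ν) ^ 2)
        ≤ 2 * ∑ μ, ∑ j, fdiff n R₀ μ w j ^ 2 := by
      rw [Finset.sum_comm, two_mul, ← Finset.sum_add_distrib]
      refine Finset.sum_le_sum fun μ _ => ?_
      rw [Finset.sum_add_distrib]
      exact add_le_add (sum_incl_le h (fun j => fdiff n R₀ μ w j ^ 2) (fun _ => sq_nonneg _) _)
        (sum_incl_shift_sq_le h ν _)
    have s2 : ∑ x, (2 * δ * |extR w ((incl h x).1 + uvec ν)|) ^ 2 ≤ 4 * ∑ j, w j ^ 2 := by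
      have hδ2 : δ ^ 2 ≤ 1 := by nlinarith
      calc ∑ x, (2 * δ * |extR w ((incl h x).1 + uvec ν)|) ^ 2
          = 4 * δ ^ 2 * ∑ x, extR w ((incl h x).1 + uvec ν) ^ 2 := by
            rw [Finset.mul_sum]; exact Finset.sum_congr rfl fun x _ => by rw [mul_pow, mul_pow, sq_abs]; ring
        _ ≤ 4 * 1 * ∑ j, w j ^ 2 := by
            refine mul_le_mul (mul_le_mul_of_nonneg_left hδ2 (by norm_num)) (sum_incl_shift_sq_le h ν w)
              (Finset.sum_nonneg fun _ _ => sq_nonneg _) (by norm_num)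
        _ = _ := by ring
    have s3 : ∑ x, w (incl h x) ^ 2 ≤ ∑ j, w j ^ 2 := sum_incl_le h (fun j => w j ^ 2) (fun _ => sq_nonneg _) _
    have hK : 0 ≤ Real.exp (4 * δ - 2 * (δ * r)) * (4 * ((d : ℝ) + 1)) := by positivity
    calc ∑ x, B x ^ 2
        ≤ ∑ x, Real.exp (4 * δ - 2 * (δ * r)) * (4 * ((d : ℝ) + 1))
          * (∑ μ, (fdiff n R₀ μ w (incl h x) ^ 2 + extR (fdiff n R₀ μ w) ((incl h x).1 + uvec ν) ^ 2)
            + (2 * δ * |extR w ((incl h x).1 + uvec ν)|) ^ 2 + w (incl h x) ^ 2) :=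
          Finset.sum_le_sum fun x _ => hBsq x
      _ = Real.exp (4 * δ - 2 * (δ * r)) * (4 * ((d : ℝ) + 1))
          * (∑ x, ∑ μ, (fdiff n R₀ μ w (incl h x) ^ 2 + extR (fdiff n R₀ μ w) ((incl h x).1 + uvec ν) ^ 2)
            + ∑ x, (2 * δ * |extR w ((incl h x).1 + uvec ν)|) ^ 2 + ∑ x, w (incl h x) ^ 2) := by
          rw [← Finset.mul_sum, Finset.sum_add_distrib, Finset.sum_add_distrib]
      _ ≤ Real.exp (4 * δ - 2 * (δ * r)) * (4 * ((d : ℝ) + 1))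
          * (2 * ∑ μ, ∑ j, fdiff n R₀ μ w j ^ 2 + 4 * ∑ j, w j ^ 2 + ∑ j, w j ^ 2) :=
          mul_le_mul_of_nonneg_left (add_le_add (add_le_add s1 s2) s3) hK
      _ = _ := by ring
  calc 2 * |∑ x, fdiff n R ν g x * f' x| ≤ 2 * ∑ x, |fdiff n R ν g x * f' x| :=
        mul_le_mul_of_nonneg_left (Finset.abs_sum_le_sum_abs _ _) (by norm_num)
    _ = ∑ x, 2 * |fdiff n R ν g x * f' x| := by rw [Finset.mul_sum]
    _ ≤ ∑ x, (ε * B x ^ 2 + ε⁻¹ * f' x ^ 2) := Finset.sum_le_sum fun x _ => hpt x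
    _ = ε * ∑ x, B x ^ 2 + ε⁻¹ * ∑ x, f' x ^ 2 := by
        rw [Finset.sum_add_distrib, Finset.mul_sum, Finset.mul_sum]
    _ ≤ _ := add_le_add (mul_le_mul_of_nonneg_left hsumB hε.le) le_rfl

/-- the constant multiplying the weighted norms of `u = G_R g'` in the corrector energy bound. [folklore] -/
def alphaC (d : ℕ) (a : ℝ) : ℝ :=
  2 * ((d : ℝ) + 1) * (((d : ℝ) + 3) / min 2 a + ((d : ℝ) + 1)) + 2 * a / min 2 a

/-- the constant multiplying `‖f'‖²` in the corrector energy bound. [folklore] -/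
def gammaC (d : ℕ) (a : ℝ) : ℝ := 4 * ((d : ℝ) + 1) * (2 * ((d : ℝ) + 1) + 5 / min 2 a)

/-- `α > 0`. [folklore] -/
theorem alphaC_pos (d : ℕ) {a : ℝ} (ha : 0 < a) : 0 < alphaC d a := by
  have : 0 < min 2 a := lt_min (by norm_num) ha
  unfold alphaC; positivity

/-- `γ > 0`. [folklore] -/
theorem gammaC_pos (d : ℕ) {a : ℝ} (ha : 0 < a) : 0 < gammaC d a := by
  have : 0 < min 2 a := lt_min (by norm_num) ha
  unfold gammaC; positivity

set_option maxHeartbeats 400000 in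
/-- **Real.exp (δ - δ * r)E CORRECTOR ENERGY BOUND.**  Let `R ⊆ R₀` be unions of blocks, `H = H_R`, `H₀ = H_{R₀}` the operators of
(1.6) at `A = 0`, `u = G_R g'` with `g' ∈ {f', D_ν^⊤f'}`, `χ : R → [0,1]` `1`-Lipschitz for `dist_η`, vanishing on
the boundary layer, with `{χ ≠ 1}` and the jump set of `χ` inside the collar `C'`; `ψ` a `δ`-slowly varying weight
with `ψ ≤ 0` on `supp f'`; `φ` a `δ`-Lipschitz weight on `R₀` with `φ ≤ ψ − δr` on the collar.  Then the conjugated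
corrector `w = e^{φ}W`, `W = ext(χu) − G_{R₀} ext g'`, has energy
`⟨w, H₀w⟩ ≤ 8e^{4δ−2δr}(α·B(u) + γ‖f'‖²)`, `B(u) = 2(d+1)(Σ(e^{ψ}D_μu)² + ((2d+3)/2)Σ(e^{ψ}u)²) + 2aΣ(e^{ψ}u)²`.
Mechanism: `E ≤ 2P₁ − 2P₂` (conjugated pairing identity + coercivity (1.8) + the `η`-uniform conjugation error),
the commutator pairing bound and the source pairing bounds with `ε = 1/(4θα)`, `ε₂ = 1/(4Θγ)`, absorption.
[cite: CombesThomas1973, §II] [folklore] -/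
theorem energyW_le (hn : 1 ≤ n) (hR : IsBlockUnion n R) (hR₀ : IsBlockUnion n R₀) (h : R ⊆ R₀) (ha : 0 < a)
    (hm : 0 ≤ m2) {δ r : ℝ} (hδ0 : 0 ≤ δ) (hδ1 : δ ≤ 1)
    (hsmall : 2 * ((d : ℝ) + 1) * δ ^ 2 + a * (Real.exp δ - 1) ≤ min 2 a / 2)
    (χ : ↥R → ℝ) (hχ0 : ∀ x, 0 ≤ χ x) (hχ1 : ∀ x, χ x ≤ 1) (hχlip : ∀ x y, |χ x - χ y| ≤ edistR n R x y)
    (hχbd : ∀ y ∈ bdR R R₀, χ y = 0) (C' : Finset ↥R)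
    (hχC : ∀ x y, edistR n R x y ≤ 1 → χ x ≠ χ y → x ∈ C') (hχC1 : ∀ x, χ x ≠ 1 → x ∈ C')
    (ψ : ↥R → ℝ) (hψ : ∀ x y, edistR n R x y ≤ 1 → |ψ x - ψ y| ≤ δ) (f' : ↥R → ℝ)
    (hψT : ∀ x, f' x ≠ 0 → ψ x ≤ 0) (φ : ↥R₀ → ℝ) (hφlip : ∀ j k, |φ j - φ k| ≤ δ * edistR n R₀ j k)
    (hφC : ∀ x ∈ C', φ (incl h x) ≤ ψ x - δ * r) (u g' : ↥R → ℝ) (hu : (fineOpR n a m2 R).mulVec u = g')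
    (hg' : g' = f' ∨ ∃ ν, g' = fdiffT n R ν f') (w : ↥R₀ → ℝ)
    (hw : ∀ j, w j = Real.exp (φ j) * corrW n a m2 R₀ χ u g' j) :
    w ⬝ᵥ (fineOpR n a m2 R₀).mulVec w
      ≤ 8 * Real.exp (4 * δ - 2 * (δ * r)) *
        (alphaC d a * (2 * ((d : ℝ) + 1) * (∑ x, ∑ μ, (Real.exp (ψ x) * fdiff n R μ u x) ^ 2
              + (2 * ((d : ℝ) + 1) + 1) / 2 * ∑ x, (Real.exp (ψ x) * u x) ^ 2)
            + 2 * a * ∑ x, (Real.exp (ψ x) * u x) ^ 2)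
          + gammaC d a * (∑ x, f' x ^ 2)) := by
  have hn0 : (0 : ℝ) < n := by exact_mod_cast hn
  have hσ : 0 < min 2 a := lt_min (by norm_num) ha
  -- positivity and the basic norm bounds in terms of the energy
  have hposw : min 2 a * (w ⬝ᵥ w) ≤ (w ⬝ᵥ (fineOpR n a m2 R₀).mulVec w) := hpos_region hn hR₀ ha.le hm w
  have hww : 0 ≤ w ⬝ᵥ w := dotProduct_self_nonneg' w
  have hE0 : 0 ≤ (w ⬝ᵥ (fineOpR n a m2 R₀).mulVec w) := le_trans (mul_nonneg hσ.le hww) hposw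
  have hSw₀ : ∑ j, w j ^ 2 ≤ (w ⬝ᵥ (fineOpR n a m2 R₀).mulVec w) / min 2 a := by
    rw [← dotProduct_self_eq_sum_sq, le_div_iff₀ hσ]; linarith
  have hSD₀ : ∀ μ, ∑ j, fdiff n R₀ μ w j ^ 2 ≤ (w ⬝ᵥ (fineOpR n a m2 R₀).mulVec w) := fun μ => sum_fdiff_sq_le_form hn hR₀ ha.le hm μ w
  have hSw : ∑ x, w (incl h x) ^ 2 ≤ (w ⬝ᵥ (fineOpR n a m2 R₀).mulVec w) / min 2 a :=
    (sum_incl_le h (fun j => w j ^ 2) (fun _ => sq_nonneg _) _).trans hSw₀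
  have hSD' : ∑ x, ∑ μ, fdiff n R₀ μ w (incl h x) ^ 2 ≤ ((d : ℝ) + 1) * (w ⬝ᵥ (fineOpR n a m2 R₀).mulVec w) := by
    rw [Finset.sum_comm]
    calc ∑ μ, ∑ x, fdiff n R₀ μ w (incl h x) ^ 2 ≤ ∑ μ : Fin (d + 1), (w ⬝ᵥ (fineOpR n a m2 R₀).mulVec w) :=
          Finset.sum_le_sum fun μ _ =>
            (sum_incl_le h (fun j => fdiff n R₀ μ w j ^ 2) (fun _ => sq_nonneg _) _).trans (hSD₀ μ)
      _ = ((d : ℝ) + 1) * (w ⬝ᵥ (fineOpR n a m2 R₀).mulVec w) := by simp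
  have hSD₀' : ∑ μ, ∑ j, fdiff n R₀ μ w j ^ 2 ≤ ((d : ℝ) + 1) * (w ⬝ᵥ (fineOpR n a m2 R₀).mulVec w) := by
    calc ∑ μ, ∑ j, fdiff n R₀ μ w j ^ 2 ≤ ∑ μ : Fin (d + 1), (w ⬝ᵥ (fineOpR n a m2 R₀).mulVec w) := Finset.sum_le_sum fun μ _ => hSD₀ μ
      _ = ((d : ℝ) + 1) * (w ⬝ᵥ (fineOpR n a m2 R₀).mulVec w) := by simp
  have hB0 : 0 ≤ (2 * ((d : ℝ) + 1) * (∑ x, ∑ μ, (Real.exp (ψ x) * fdiff n R μ u x) ^ 2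
              + (2 * ((d : ℝ) + 1) + 1) / 2 * ∑ x, (Real.exp (ψ x) * u x) ^ 2)
            + 2 * a * ∑ x, (Real.exp (ψ x) * u x) ^ 2) := by
    have s1 : 0 ≤ ∑ x, ∑ μ, (Real.exp (ψ x) * fdiff n R μ u x) ^ 2 :=
      Finset.sum_nonneg fun _ _ => Finset.sum_nonneg fun _ _ => sq_nonneg _
    have s2 : 0 ≤ ∑ x, (Real.exp (ψ x) * u x) ^ 2 := Finset.sum_nonneg fun _ _ => sq_nonneg _
    positivity
  have hF0 : 0 ≤ (∑ x, f' x ^ 2) := Finset.sum_nonneg fun _ _ => sq_nonneg _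
  have hα := alphaC_pos d ha
  have hγ := gammaC_pos d ha
  have hθ0 : 0 < Real.exp (δ - δ * r) := Real.exp_pos _
  have hΘ0 : 0 < Real.exp (4 * δ - 2 * (δ * r)) := Real.exp_pos _
  have hθΘ : Real.exp (δ - δ * r) * Real.exp (δ - δ * r) ≤ Real.exp (4 * δ - 2 * (δ * r)) := by
    rw [← Real.exp_add]; exact Real.exp_le_exp.2 (by nlinarith)
  -- `E ≤ 2P₁ − 2P₂`
  have hφ : ∀ j k : ↥R₀, k.1 ∈ nbrs j.1 → |φ j - φ k| ≤ δ / (n : ℝ) := by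
    intro j k hjk
    calc |φ j - φ k| ≤ δ * edistR n R₀ j k := hφlip j k
      _ ≤ δ * (1 / (n : ℝ)) := mul_le_mul_of_nonneg_left (edistR_le_of_mem_nbrs hn hjk) hδ0
      _ = δ / (n : ℝ) := by ring
  have hE2 : (w ⬝ᵥ (fineOpR n a m2 R₀).mulVec w) ≤ 2 * ∑ x, Real.exp (φ (incl h x)) * w (incl h x) * comm n a m2 R χ u x
      - 2 * ∑ x, Real.exp (φ (incl h x)) * w (incl h x) * ((1 - χ x) * g' x) := by
    have h1 := energy_le_two_conjPairing (fineOpR n a m2 R₀) (min 2 a) φ (hpos_region hn hR₀ ha.le hm)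
      (herr_region_lip hn hR₀ m2 ha hδ0 hδ1 hsmall φ hφlip) (corrW n a m2 R₀ χ u g') w hw
    have h2 : (fineOpR n a m2 R₀).mulVec (corrW n a m2 R₀ χ u g') = extTo R₀ (comm n a m2 R χ u - (1 - χ) * g') :=
      mulVec_corrW hn hR hR₀ h ha hm χ u g' hχbd hu
    rw [h2] at h1
    have h3 : ∑ j, w j * (Real.exp (φ j) * extTo R₀ (comm n a m2 R χ u - (1 - χ) * g') j)
        = ∑ x, Real.exp (φ (incl h x)) * w (incl h x) * comm n a m2 R χ u x
          - ∑ x, Real.exp (φ (incl h x)) * w (incl h x) * ((1 - χ x) * g' x) := by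
      calc ∑ j, w j * (Real.exp (φ j) * extTo R₀ (comm n a m2 R χ u - (1 - χ) * g') j)
          = ∑ j, extTo R₀ (comm n a m2 R χ u - (1 - χ) * g') j * (w j * Real.exp (φ j)) :=
            Finset.sum_congr rfl fun j _ => by ring
        _ = ∑ x, (comm n a m2 R χ u - (1 - χ) * g') x * (w (incl h x) * Real.exp (φ (incl h x))) :=
            sum_extTo_mul h _ _
        _ = _ := by
            rw [← Finset.sum_sub_distrib]
            refine Finset.sum_congr rfl fun x _ => ?_
            simp only [Pi.sub_apply, Pi.mul_apply, Pi.one_apply]; ring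
    rw [h3] at h1
    linarith
  -- `2|P₁| ≤ E/4 + 4ΘαB`
  have hε₁0 : 0 < 1 / (4 * Real.exp (δ - δ * r) * alphaC d a) := by positivity
  have hP1 := two_abs_commPairing_le (m2 := m2) hn hR h ha hδ0 hδ1 hε₁0 χ hχ0 hχ1 hχlip C' hχC ψ hψ φ hφ
    hφC u w
  have hA : 2 * ((d : ℝ) + 1) * (((d : ℝ) + 3) * ∑ x, w (incl h x) ^ 2
        + ∑ x, ∑ μ, fdiff n R₀ μ w (incl h x) ^ 2) + 2 * a * ∑ x, w (incl h x) ^ 2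
      ≤ alphaC d a * (w ⬝ᵥ (fineOpR n a m2 R₀).mulVec w) := by
    have e : alphaC d a * (w ⬝ᵥ (fineOpR n a m2 R₀).mulVec w)
        = 2 * ((d : ℝ) + 1) * (((d : ℝ) + 3) * ((w ⬝ᵥ (fineOpR n a m2 R₀).mulVec w) / min 2 a) + ((d : ℝ) + 1) * (w ⬝ᵥ (fineOpR n a m2 R₀).mulVec w))
          + 2 * a * ((w ⬝ᵥ (fineOpR n a m2 R₀).mulVec w) / min 2 a) := by
      simp only [alphaC]; ring
    rw [e]
    have hd3 : 0 ≤ (d : ℝ) + 3 := by positivity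
    have hz : 0 ≤ 2 * ((d : ℝ) + 1) := by positivity
    have t1 := mul_le_mul_of_nonneg_left hSw hd3
    have t2 := mul_le_mul_of_nonneg_left (add_le_add t1 hSD') hz
    have t3 := mul_le_mul_of_nonneg_left hSw (by positivity : 0 ≤ 2 * a)
    linarith
  have hP1' : 2 * |∑ x, Real.exp (φ (incl h x)) * w (incl h x) * comm n a m2 R χ u x|
      ≤ (w ⬝ᵥ (fineOpR n a m2 R₀).mulVec w) / 4 + 4 * Real.exp (4 * δ - 2 * (δ * r)) * alphaC d a * (2 * ((d : ℝ) + 1) * (∑ x, ∑ μ, (Real.exp (ψ x) * fdiff n R μ u x) ^ 2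
              + (2 * ((d : ℝ) + 1) + 1) / 2 * ∑ x, (Real.exp (ψ x) * u x) ^ 2)
            + 2 * a * ∑ x, (Real.exp (ψ x) * u x) ^ 2) := by
    refine hP1.trans ?_
    have h1 : Real.exp (δ - δ * r) * (1 / (4 * Real.exp (δ - δ * r) * alphaC d a)
          * (2 * ((d : ℝ) + 1) * (((d : ℝ) + 3) * ∑ x, w (incl h x) ^ 2
              + ∑ x, ∑ μ, fdiff n R₀ μ w (incl h x) ^ 2) + 2 * a * ∑ x, w (incl h x) ^ 2)
          + (1 / (4 * Real.exp (δ - δ * r) * alphaC d a))⁻¹ * (2 * ((d : ℝ) + 1) * (∑ x, ∑ μ, (Real.exp (ψ x) * fdiff n R μ u x) ^ 2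
              + (2 * ((d : ℝ) + 1) + 1) / 2 * ∑ x, (Real.exp (ψ x) * u x) ^ 2)
            + 2 * a * ∑ x, (Real.exp (ψ x) * u x) ^ 2))
        ≤ Real.exp (δ - δ * r) * (1 / (4 * Real.exp (δ - δ * r) * alphaC d a) * (alphaC d a * (w ⬝ᵥ (fineOpR n a m2 R₀).mulVec w))
          + (1 / (4 * Real.exp (δ - δ * r) * alphaC d a))⁻¹ * (2 * ((d : ℝ) + 1) * (∑ x, ∑ μ, (Real.exp (ψ x) * fdiff n R μ u x) ^ 2
              + (2 * ((d : ℝ) + 1) + 1) / 2 * ∑ x, (Real.exp (ψ x) * u x) ^ 2)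
            + 2 * a * ∑ x, (Real.exp (ψ x) * u x) ^ 2)) :=
      mul_le_mul_of_nonneg_left (add_le_add (mul_le_mul_of_nonneg_left hA hε₁0.le) le_rfl) hθ0.le
    have h2 : Real.exp (δ - δ * r) * (1 / (4 * Real.exp (δ - δ * r) * alphaC d a) * (alphaC d a * (w ⬝ᵥ (fineOpR n a m2 R₀).mulVec w))
          + (1 / (4 * Real.exp (δ - δ * r) * alphaC d a))⁻¹ * (2 * ((d : ℝ) + 1) * (∑ x, ∑ μ, (Real.exp (ψ x) * fdiff n R μ u x) ^ 2
              + (2 * ((d : ℝ) + 1) + 1) / 2 * ∑ x, (Real.exp (ψ x) * u x) ^ 2)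
            + 2 * a * ∑ x, (Real.exp (ψ x) * u x) ^ 2))
        = (w ⬝ᵥ (fineOpR n a m2 R₀).mulVec w) / 4 + 4 * (Real.exp (δ - δ * r) * Real.exp (δ - δ * r)) * alphaC d a * (2 * ((d : ℝ) + 1) * (∑ x, ∑ μ, (Real.exp (ψ x) * fdiff n R μ u x) ^ 2
              + (2 * ((d : ℝ) + 1) + 1) / 2 * ∑ x, (Real.exp (ψ x) * u x) ^ 2)
            + 2 * a * ∑ x, (Real.exp (ψ x) * u x) ^ 2) := by
      field_simp
    have h3 : 4 * (Real.exp (δ - δ * r) * Real.exp (δ - δ * r)) * alphaC d a * (2 * ((d : ℝ) + 1) * (∑ x, ∑ μ, (Real.exp (ψ x) * fdiff n R μ u x) ^ 2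
              + (2 * ((d : ℝ) + 1) + 1) / 2 * ∑ x, (Real.exp (ψ x) * u x) ^ 2)
            + 2 * a * ∑ x, (Real.exp (ψ x) * u x) ^ 2) ≤ 4 * Real.exp (4 * δ - 2 * (δ * r)) * alphaC d a * (2 * ((d : ℝ) + 1) * (∑ x, ∑ μ, (Real.exp (ψ x) * fdiff n R μ u x) ^ 2
              + (2 * ((d : ℝ) + 1) + 1) / 2 * ∑ x, (Real.exp (ψ x) * u x) ^ 2)
            + 2 * a * ∑ x, (Real.exp (ψ x) * u x) ^ 2) :=
      mul_le_mul_of_nonneg_right (mul_le_mul_of_nonneg_right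
        (mul_le_mul_of_nonneg_left hθΘ (by norm_num)) hα.le) hB0
    linarith
  -- `2|P₂| ≤ E/4 + 4ΘγF`
  have hε₂0 : 0 < 1 / (4 * Real.exp (4 * δ - 2 * (δ * r)) * gammaC d a) := by positivity
  have hP2' : 2 * |∑ x, Real.exp (φ (incl h x)) * w (incl h x) * ((1 - χ x) * g' x)|
      ≤ (w ⬝ᵥ (fineOpR n a m2 R₀).mulVec w) / 4 + 4 * Real.exp (4 * δ - 2 * (δ * r)) * gammaC d a * (∑ x, f' x ^ 2) := by
    have key : 2 * |∑ x, Real.exp (φ (incl h x)) * w (incl h x) * ((1 - χ x) * g' x)|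
        ≤ 1 / (4 * Real.exp (4 * δ - 2 * (δ * r)) * gammaC d a) * (Real.exp (4 * δ - 2 * (δ * r)) * (gammaC d a * (w ⬝ᵥ (fineOpR n a m2 R₀).mulVec w)))
          + (1 / (4 * Real.exp (4 * δ - 2 * (δ * r)) * gammaC d a))⁻¹ * (∑ x, f' x ^ 2) := by
      rcases hg' with hg | ⟨ν, hg⟩
      · rw [hg]
        refine (two_abs_srcPairingA_le h hε₂0 χ hχ0 hχ1 C' hχC1 ψ f' hψT φ hφC w).trans ?_
        have h1 : Real.exp (-(2 * (δ * r))) ≤ Real.exp (4 * δ - 2 * (δ * r)) := Real.exp_le_exp.2 (by nlinarith)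
        have hγσ : 1 ≤ gammaC d a * min 2 a := by
          have hd0 : (0 : ℝ) ≤ d := Nat.cast_nonneg d
          have e : gammaC d a * min 2 a = 4 * ((d : ℝ) + 1) * (2 * ((d : ℝ) + 1) * min 2 a + 5) := by
            simp only [gammaC]; field_simp
          rw [e]
          have hq : 0 ≤ (d : ℝ) ^ 2 * min 2 a := by positivity
          have hdσ : 0 ≤ (d : ℝ) * min 2 a := by positivity
          nlinarith [hq, hdσ, hσ.le, hd0]
        have h2 : ∑ x, w (incl h x) ^ 2 ≤ gammaC d a * (w ⬝ᵥ (fineOpR n a m2 R₀).mulVec w) := by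
          refine hSw.trans ?_
          rw [div_le_iff₀ hσ]
          calc (w ⬝ᵥ (fineOpR n a m2 R₀).mulVec w) = 1 * (w ⬝ᵥ (fineOpR n a m2 R₀).mulVec w) := (one_mul _).symm
            _ ≤ (gammaC d a * min 2 a) * (w ⬝ᵥ (fineOpR n a m2 R₀).mulVec w) := mul_le_mul_of_nonneg_right hγσ hE0
            _ = gammaC d a * (w ⬝ᵥ (fineOpR n a m2 R₀).mulVec w) * min 2 a := by ring
        have h3 : Real.exp (-(2 * (δ * r))) * ∑ x, w (incl h x) ^ 2 ≤ Real.exp (4 * δ - 2 * (δ * r)) * (gammaC d a * (w ⬝ᵥ (fineOpR n a m2 R₀).mulVec w)) :=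
          mul_le_mul h1 h2 (Finset.sum_nonneg fun _ _ => sq_nonneg _) hΘ0.le
        have h4 := mul_le_mul_of_nonneg_left h3 hε₂0.le
        calc 1 / (4 * Real.exp (4 * δ - 2 * (δ * r)) * gammaC d a) * Real.exp (-(2 * (δ * r))) * ∑ x, w (incl h x) ^ 2
              + (1 / (4 * Real.exp (4 * δ - 2 * (δ * r)) * gammaC d a))⁻¹ * (∑ x, f' x ^ 2)
            = 1 / (4 * Real.exp (4 * δ - 2 * (δ * r)) * gammaC d a) * (Real.exp (-(2 * (δ * r))) * ∑ x, w (incl h x) ^ 2)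
              + (1 / (4 * Real.exp (4 * δ - 2 * (δ * r)) * gammaC d a))⁻¹ * (∑ x, f' x ^ 2) := by ring
          _ ≤ _ := add_le_add h4 le_rfl
      · rw [hg]
        refine (two_abs_srcPairingB_le hn h hδ0 hδ1 hε₂0 χ hχ0 hχ1 hχlip C' hχC hχC1 ψ hψ f' hψT φ hφ hφC w
          ν).trans ?_
        have h2 : Real.exp (4 * δ - 2 * (δ * r)) * (4 * ((d : ℝ) + 1))
              * (2 * ∑ μ, ∑ j, fdiff n R₀ μ w j ^ 2 + 5 * ∑ j, w j ^ 2)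
            ≤ Real.exp (4 * δ - 2 * (δ * r)) * (gammaC d a * (w ⬝ᵥ (fineOpR n a m2 R₀).mulVec w)) := by
          have e : Real.exp (4 * δ - 2 * (δ * r)) * (gammaC d a * (w ⬝ᵥ (fineOpR n a m2 R₀).mulVec w))
              = Real.exp (4 * δ - 2 * (δ * r)) * (4 * ((d : ℝ) + 1)) * (2 * (((d : ℝ) + 1) * (w ⬝ᵥ (fineOpR n a m2 R₀).mulVec w)) + 5 * ((w ⬝ᵥ (fineOpR n a m2 R₀).mulVec w) / min 2 a)) := by
            simp only [gammaC]; ring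
          rw [e]
          have t1 := mul_le_mul_of_nonneg_left hSD₀' (by norm_num : (0 : ℝ) ≤ 2)
          have t2 := mul_le_mul_of_nonneg_left hSw₀ (by norm_num : (0 : ℝ) ≤ 5)
          exact mul_le_mul_of_nonneg_left (add_le_add t1 t2) (by positivity)
        exact add_le_add (mul_le_mul_of_nonneg_left h2 hε₂0.le) le_rfl
    refine key.trans (le_of_eq ?_)
    field_simp
  -- absorb
  have a1 := le_abs_self (∑ x, Real.exp (φ (incl h x)) * w (incl h x) * comm n a m2 R χ u x)
  have a2 := neg_abs_le (∑ x, Real.exp (φ (incl h x)) * w (incl h x) * ((1 - χ x) * g' x))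
  have hfin : (w ⬝ᵥ (fineOpR n a m2 R₀).mulVec w) ≤ (w ⬝ᵥ (fineOpR n a m2 R₀).mulVec w) / 4 + 4 * Real.exp (4 * δ - 2 * (δ * r)) * alphaC d a * (2 * ((d : ℝ) + 1) * (∑ x, ∑ μ, (Real.exp (ψ x) * fdiff n R μ u x) ^ 2
              + (2 * ((d : ℝ) + 1) + 1) / 2 * ∑ x, (Real.exp (ψ x) * u x) ^ 2)
            + 2 * a * ∑ x, (Real.exp (ψ x) * u x) ^ 2) + ((w ⬝ᵥ (fineOpR n a m2 R₀).mulVec w) / 4 + 4 * Real.exp (4 * δ - 2 * (δ * r)) * gammaC d a * (∑ x, f' x ^ 2)) := by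
    linarith
  linarith

end Energy

/-! ## §6  Extraction on the observation set `S = supp f` -/

section Extract

variable {n : ℕ} {R R₀ : Finset (Fin (d + 1) → ℤ)} {a m2 : ℝ}

/-- `fdiff` is additive. [folklore] -/
theorem fdiff_add (μ : Fin (d + 1)) (u v : ↥R → ℝ) : fdiff n R μ (u + v) = fdiff n R μ u + fdiff n R μ v := by
  rw [← fdiffM_mulVec, ← fdiffM_mulVec, ← fdiffM_mulVec, Matrix.mulVec_add]

/-- `(p + q)² ≤ 2(p² + q²)`. [folklore] -/
theorem add_sq_le_two (p q : ℝ) : (p + q) ^ 2 ≤ 2 * (p ^ 2 + q ^ 2) := by nlinarith [sq_nonneg (p - q)]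

/-- **weighted norm of the Green's function**: `Σ(e^{ψ}u)² = ‖w'‖² ≤ ⟨w',Hw'⟩/min(2,a)` for `w' = e^{ψ}u`. [folklore] -/
theorem weightedSq_le_energy (hn : 1 ≤ n) (hR : IsBlockUnion n R) (ha : 0 < a) (hm : 0 ≤ m2) (ψ u w' : ↥R → ℝ)
    (hw' : ∀ j, w' j = Real.exp (ψ j) * u j) :
    ∑ x, (Real.exp (ψ x) * u x) ^ 2 ≤ (w' ⬝ᵥ (fineOpR n a m2 R).mulVec w') / min 2 a := by
  have hσ : 0 < min 2 a := lt_min (by norm_num) ha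
  have h1 : ∑ x, (Real.exp (ψ x) * u x) ^ 2 = w' ⬝ᵥ w' := by
    rw [dotProduct_self_eq_sum_sq]; exact Finset.sum_congr rfl fun j _ => by rw [hw' j]
  rw [h1, le_div_iff₀ hσ, mul_comm]
  exact hpos_region hn hR ha.le hm w'

/-- **weighted gradient of the Green's function**: `Σ_x(e^{ψ(x)}D_μu(x))² ≤ 2(1 + 4δ²/min(2,a))⟨w',Hw'⟩` for
`w' = e^{ψ}u`, `ψ` the Combes–Thomas weight (oscillation `≤ δη` across a bond). [folklore] -/
theorem weightedFdiffSq_le_energy (hn : 1 ≤ n) (hR : IsBlockUnion n R) (ha : 0 < a) (hm : 0 ≤ m2) {δ : ℝ}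
    (hδ0 : 0 ≤ δ) (hδ1 : δ ≤ 1) (T : Finset ↥R) (hT : T.Nonempty) (u w' : ↥R → ℝ)
    (hw' : ∀ j, w' j = Real.exp (ctw n R δ T hT j) * u j) (μ : Fin (d + 1)) :
    ∑ x, (Real.exp (ctw n R δ T hT x) * fdiff n R μ u x) ^ 2
      ≤ 2 * (1 + 4 * δ ^ 2 / min 2 a) * (w' ⬝ᵥ (fineOpR n a m2 R).mulVec w') := by
  have hσ : 0 < min 2 a := lt_min (by norm_num) ha
  have hLip : ∀ (x : ↥R) (h : x.1 + uvec μ ∈ R), |ctw n R δ T hT ⟨x.1 + uvec μ, h⟩ - ctw n R δ T hT x| ≤ δ / (n : ℝ) :=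
    fun x h => abs_ctw_step_le hδ0 T hT x μ h
  have hx : ∀ x, (Real.exp (ctw n R δ T hT x) * fdiff n R μ u x) ^ 2
      ≤ 2 * (fdiff n R μ w' x ^ 2 + 4 * δ ^ 2 * extR w' (x.1 + uvec μ) ^ 2) := by
    intro x
    have h1 := exp_mul_abs_fdiff_le hn hδ1 (ctw n R δ T hT) u w' hw' μ hLip x
    have h0 : 0 ≤ Real.exp (ctw n R δ T hT x) * |fdiff n R μ u x| := by positivity
    calc (Real.exp (ctw n R δ T hT x) * fdiff n R μ u x) ^ 2
        = (Real.exp (ctw n R δ T hT x) * |fdiff n R μ u x|) ^ 2 := by rw [mul_pow, mul_pow, sq_abs]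
      _ ≤ (|fdiff n R μ w' x| + 2 * δ * |extR w' (x.1 + uvec μ)|) ^ 2 := pow_le_pow_left₀ h0 h1 2
      _ ≤ 2 * (|fdiff n R μ w' x| ^ 2 + (2 * δ * |extR w' (x.1 + uvec μ)|) ^ 2) := add_sq_le_two _ _
      _ = _ := by rw [sq_abs, mul_pow, sq_abs]; ring
  have hD := sum_fdiff_sq_le_form hn hR ha.le hm μ w'
  have hS := sum_sq_shift_le μ w' Finset.univ
  have hww : ∑ y, w' y ^ 2 ≤ (w' ⬝ᵥ (fineOpR n a m2 R).mulVec w') / min 2 a := by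
    rw [← dotProduct_self_eq_sum_sq, le_div_iff₀ hσ, mul_comm]; exact hpos_region hn hR ha.le hm w'
  calc ∑ x, (Real.exp (ctw n R δ T hT x) * fdiff n R μ u x) ^ 2
      ≤ ∑ x : ↥R, 2 * (fdiff n R μ w' x ^ 2 + 4 * δ ^ 2 * extR w' (x.1 + uvec μ) ^ 2) :=
        Finset.sum_le_sum fun x _ => hx x
    _ = 2 * (∑ x : ↥R, fdiff n R μ w' x ^ 2 + 4 * δ ^ 2 * ∑ x : ↥R, extR w' (x.1 + uvec μ) ^ 2) := by
        rw [Finset.mul_sum, ← Finset.sum_add_distrib, Finset.mul_sum]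
    _ ≤ 2 * ((w' ⬝ᵥ (fineOpR n a m2 R).mulVec w')
        + 4 * δ ^ 2 * ((w' ⬝ᵥ (fineOpR n a m2 R).mulVec w') / min 2 a)) := by
        have := mul_le_mul_of_nonneg_left (hS.trans hww) (by positivity : 0 ≤ 4 * δ ^ 2)
        linarith
    _ = _ := by field_simp

/-- the restricted corrector's bond difference is dominated by the corrector's: `|D_μ(res W)(x)| ≤ |D_μW(x̂)|`.
[folklore] -/
theorem abs_fdiff_resTo_le (h : R ⊆ R₀) (μ : Fin (d + 1)) (W : ↥R₀ → ℝ) (x : ↥R) :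
    |fdiff n R μ (resTo h W) x| ≤ |fdiff n R₀ μ W (incl h x)| := by
  by_cases hx : x.1 + uvec μ ∈ R
  · have hx0 : (incl h x).1 + uvec μ ∈ R₀ := h hx
    rw [fdiff_of_mem _ hx, fdiff_of_mem _ hx0]; rfl
  · rw [fdiff_of_not_mem _ hx, abs_zero]; exact abs_nonneg _

/-- **corrector values on `S`**: `Σ_{x∈S} W(x̂)² ≤ e^{−2lo}‖w‖² ≤ e^{−2lo}⟨w,H₀w⟩/min(2,a)` if `lo ≤ φ` on `Ŝ`.
[folklore] -/
theorem sum_resW_sq_le (hn : 1 ≤ n) (hR₀ : IsBlockUnion n R₀) (h : R ⊆ R₀) (ha : 0 < a) (hm : 0 ≤ m2)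
    (φ W w : ↥R₀ → ℝ) (hw : ∀ j, w j = Real.exp (φ j) * W j) (S : Finset ↥R) {lo : ℝ}
    (hlo : ∀ x ∈ S, lo ≤ φ (incl h x)) :
    ∑ x ∈ S, resTo h W x ^ 2 ≤ Real.exp (-(2 * lo)) / min 2 a * (w ⬝ᵥ (fineOpR n a m2 R₀).mulVec w) := by
  classical
  have hσ : 0 < min 2 a := lt_min (by norm_num) ha
  have h1 : ∑ x ∈ S, resTo h W x ^ 2 = ∑ j ∈ S.map ⟨incl h, incl_injective h⟩, W j ^ 2 := by
    rw [Finset.sum_map]; rfl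
  have h2 := setSq_le_of_weightedSq φ W (S.map ⟨incl h, incl_injective h⟩) lo (by
    intro j hj
    rw [Finset.mem_map] at hj
    obtain ⟨x, hx, rfl⟩ := hj
    exact hlo x hx)
  have h3 : ∑ j, (Real.exp (φ j) * W j) ^ 2 = w ⬝ᵥ w := by
    rw [dotProduct_self_eq_sum_sq]; exact Finset.sum_congr rfl fun j _ => by rw [hw j]
  have hww : w ⬝ᵥ w ≤ (w ⬝ᵥ (fineOpR n a m2 R₀).mulVec w) / min 2 a := by
    rw [le_div_iff₀ hσ, mul_comm]; exact hpos_region hn hR₀ ha.le hm w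
  rw [h1]
  calc _ ≤ Real.exp (-(2 * lo)) * ∑ j, (Real.exp (φ j) * W j) ^ 2 := h2
    _ ≤ Real.exp (-(2 * lo)) * ((w ⬝ᵥ (fineOpR n a m2 R₀).mulVec w) / min 2 a) := by
        rw [h3]; exact mul_le_mul_of_nonneg_left hww (Real.exp_pos _).le
    _ = _ := by ring

/-- **corrector gradients on `S`**: `Σ_{x∈S}(D_μ res W)(x)² ≤ 2e^{−2lo}(1 + 4δ²/min(2,a))⟨w,H₀w⟩` if `lo ≤ φ` on `Ŝ`
and `φ` is `δ`-Lipschitz. [folklore] -/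
theorem sum_fdiff_resW_sq_le (hn : 1 ≤ n) (hR₀ : IsBlockUnion n R₀) (h : R ⊆ R₀) (ha : 0 < a) (hm : 0 ≤ m2)
    {δ : ℝ} (hδ0 : 0 ≤ δ) (hδ1 : δ ≤ 1) (φ W w : ↥R₀ → ℝ) (hφlip : ∀ j k, |φ j - φ k| ≤ δ * edistR n R₀ j k)
    (hw : ∀ j, w j = Real.exp (φ j) * W j) (S : Finset ↥R) {lo : ℝ} (hlo : ∀ x ∈ S, lo ≤ φ (incl h x))
    (μ : Fin (d + 1)) :
    ∑ x ∈ S, fdiff n R μ (resTo h W) x ^ 2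
      ≤ 2 * Real.exp (-(2 * lo)) * (1 + 4 * δ ^ 2 / min 2 a) * (w ⬝ᵥ (fineOpR n a m2 R₀).mulVec w) := by
  classical
  have hσ : 0 < min 2 a := lt_min (by norm_num) ha
  have hLip : ∀ (j : ↥R₀) (hj : j.1 + uvec μ ∈ R₀), |φ ⟨j.1 + uvec μ, hj⟩ - φ j| ≤ δ / (n : ℝ) := by
    intro j hj
    calc |φ ⟨j.1 + uvec μ, hj⟩ - φ j| ≤ δ * edistR n R₀ ⟨j.1 + uvec μ, hj⟩ j := hφlip _ _
      _ ≤ δ * (1 / (n : ℝ)) := by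
          refine mul_le_mul_of_nonneg_left ?_ hδ0
          rw [edistR_comm]; exact edistR_step_le j μ hj
      _ = δ / (n : ℝ) := by ring
  have hx : ∀ x ∈ S, fdiff n R μ (resTo h W) x ^ 2
      ≤ Real.exp (-(2 * lo)) * (2 * (fdiff n R₀ μ w (incl h x) ^ 2
        + 4 * δ ^ 2 * extR w ((incl h x).1 + uvec μ) ^ 2)) := by
    intro x hxS
    have h0 := abs_fdiff_resTo_le (n := n) h μ W x
    have h1 := exp_mul_abs_fdiff_le hn hδ1 φ W w hw μ hLip (incl h x)
    have h2 : Real.exp lo * |fdiff n R μ (resTo h W) x|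
        ≤ |fdiff n R₀ μ w (incl h x)| + 2 * δ * |extR w ((incl h x).1 + uvec μ)| :=
      (mul_le_mul (Real.exp_le_exp.2 (hlo x hxS)) h0 (abs_nonneg _) (Real.exp_pos _).le).trans h1
    have h3 : (Real.exp lo * |fdiff n R μ (resTo h W) x|) ^ 2
        ≤ 2 * (fdiff n R₀ μ w (incl h x) ^ 2 + 4 * δ ^ 2 * extR w ((incl h x).1 + uvec μ) ^ 2) := by
      calc _ ≤ (|fdiff n R₀ μ w (incl h x)| + 2 * δ * |extR w ((incl h x).1 + uvec μ)|) ^ 2 :=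
            pow_le_pow_left₀ (by positivity) h2 2
        _ ≤ 2 * (|fdiff n R₀ μ w (incl h x)| ^ 2 + (2 * δ * |extR w ((incl h x).1 + uvec μ)|) ^ 2) :=
            add_sq_le_two _ _
        _ = _ := by rw [sq_abs, mul_pow, sq_abs]; ring
    have hexp : Real.exp (-(2 * lo)) * Real.exp lo ^ 2 = 1 := by
      rw [sq, ← Real.exp_add, ← Real.exp_add, ← Real.exp_zero]; congr 1; ring
    calc fdiff n R μ (resTo h W) x ^ 2
        = Real.exp (-(2 * lo)) * (Real.exp lo * |fdiff n R μ (resTo h W) x|) ^ 2 := by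
          rw [mul_pow, sq_abs, ← mul_assoc, hexp, one_mul]
      _ ≤ _ := mul_le_mul_of_nonneg_left h3 (Real.exp_pos _).le
  have hD : ∑ x ∈ S, fdiff n R₀ μ w (incl h x) ^ 2 ≤ w ⬝ᵥ (fineOpR n a m2 R₀).mulVec w :=
    (sum_incl_le h (fun j => fdiff n R₀ μ w j ^ 2) (fun _ => sq_nonneg _) S).trans
      (sum_fdiff_sq_le_form hn hR₀ ha.le hm μ w)
  have hSh : ∑ x ∈ S, extR w ((incl h x).1 + uvec μ) ^ 2 ≤ (w ⬝ᵥ (fineOpR n a m2 R₀).mulVec w) / min 2 a := by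
    have h1 : ∑ x ∈ S, extR w ((incl h x).1 + uvec μ) ^ 2
        = ∑ j ∈ S.map ⟨incl h, incl_injective h⟩, extR w (j.1 + uvec μ) ^ 2 := by rw [Finset.sum_map]; rfl
    rw [h1]
    refine (sum_sq_shift_le μ w _).trans ?_
    rw [← dotProduct_self_eq_sum_sq, le_div_iff₀ hσ, mul_comm]; exact hpos_region hn hR₀ ha.le hm w
  calc ∑ x ∈ S, fdiff n R μ (resTo h W) x ^ 2
      ≤ ∑ x ∈ S, Real.exp (-(2 * lo)) * (2 * (fdiff n R₀ μ w (incl h x) ^ 2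
          + 4 * δ ^ 2 * extR w ((incl h x).1 + uvec μ) ^ 2)) := Finset.sum_le_sum hx
    _ = Real.exp (-(2 * lo)) * (2 * (∑ x ∈ S, fdiff n R₀ μ w (incl h x) ^ 2
          + 4 * δ ^ 2 * ∑ x ∈ S, extR w ((incl h x).1 + uvec μ) ^ 2)) := by
        rw [← Finset.mul_sum]; congr 1; rw [Finset.mul_sum, ← Finset.sum_add_distrib, Finset.mul_sum]
    _ ≤ Real.exp (-(2 * lo)) * (2 * ((w ⬝ᵥ (fineOpR n a m2 R₀).mulVec w)
          + 4 * δ ^ 2 * ((w ⬝ᵥ (fineOpR n a m2 R₀).mulVec w) / min 2 a))) := by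
        have := mul_le_mul_of_nonneg_left hSh (by positivity : 0 ≤ 4 * δ ^ 2)
        have h2 : 2 * (∑ x ∈ S, fdiff n R₀ μ w (incl h x) ^ 2 + 4 * δ ^ 2 * ∑ x ∈ S, extR w ((incl h x).1 + uvec μ) ^ 2)
            ≤ 2 * ((w ⬝ᵥ (fineOpR n a m2 R₀).mulVec w) + 4 * δ ^ 2 * ((w ⬝ᵥ (fineOpR n a m2 R₀).mulVec w) / min 2 a)) := by
          linarith
        exact mul_le_mul_of_nonneg_left h2 (Real.exp_pos _).le
    _ = _ := by field_simp

/-- **cut-off Green's function values on `S`**: `Σ_{x∈S}((1−χ)u)(x)² ≤ e^{−2lo₂}Σ(e^{ψ}u)²` when `χ ≠ 1` only on the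
collar and `lo₂ ≤ ψ` at the points of `S` within `dist_η ≤ 1` of the collar. [folklore] -/
theorem sum_cutU_sq_le (χ : ↥R → ℝ) (hχ0 : ∀ x, 0 ≤ χ x) (hχ1 : ∀ x, χ x ≤ 1) (C' : Finset ↥R)
    (hχC1 : ∀ x, χ x ≠ 1 → x ∈ C') (ψ u : ↥R → ℝ) (S : Finset ↥R) {lo₂ : ℝ}
    (hlo₂ : ∀ x ∈ S, ∀ y ∈ C', edistR n R x y ≤ 1 → lo₂ ≤ ψ x) :
    ∑ x ∈ S, ((1 - χ) * u) x ^ 2 ≤ Real.exp (-(2 * lo₂)) * ∑ x, (Real.exp (ψ x) * u x) ^ 2 := by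
  have hx : ∀ x ∈ S, ((1 - χ) * u) x ^ 2 ≤ Real.exp (-(2 * lo₂)) * (Real.exp (ψ x) * u x) ^ 2 := by
    intro x hxS
    simp only [Pi.mul_apply, Pi.sub_apply, Pi.one_apply]
    by_cases hc : χ x = 1
    · rw [hc, sub_self, zero_mul, zero_pow two_ne_zero]; positivity
    have hxC := hχC1 x hc
    have hψ := hlo₂ x hxS x hxC (by rw [edistR_self]; norm_num)
    have h1c : (1 - χ x) ^ 2 ≤ 1 := by nlinarith [hχ0 x, hχ1 x]
    have hexp : 1 ≤ Real.exp (-(2 * lo₂)) * Real.exp (ψ x) ^ 2 := by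
      rw [sq, ← Real.exp_add, ← Real.exp_add]; exact Real.one_le_exp (by linarith)
    calc ((1 - χ x) * u x) ^ 2 = (1 - χ x) ^ 2 * u x ^ 2 := mul_pow _ _ _
      _ ≤ 1 * u x ^ 2 := mul_le_mul_of_nonneg_right h1c (sq_nonneg _)
      _ ≤ (Real.exp (-(2 * lo₂)) * Real.exp (ψ x) ^ 2) * u x ^ 2 := mul_le_mul_of_nonneg_right hexp (sq_nonneg _)
      _ = _ := by ring
  calc ∑ x ∈ S, ((1 - χ) * u) x ^ 2 ≤ ∑ x ∈ S, Real.exp (-(2 * lo₂)) * (Real.exp (ψ x) * u x) ^ 2 :=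
        Finset.sum_le_sum hx
    _ ≤ ∑ x, Real.exp (-(2 * lo₂)) * (Real.exp (ψ x) * u x) ^ 2 :=
        Finset.sum_le_univ_sum_of_nonneg fun x => by positivity
    _ = _ := by rw [Finset.mul_sum]

/-- **cut-off Green's function gradients on `S`**: `Σ_{x∈S}(D_μ((1−χ)u))(x)² ≤ 2e^{−2lo₂}(Σ(e^{ψ}D_μu)² + Σ(e^{ψ}u)²)`.
[folklore] -/
theorem sum_fdiff_cutU_sq_le (hn : 1 ≤ n) (χ : ↥R → ℝ) (hχ0 : ∀ x, 0 ≤ χ x) (hχ1 : ∀ x, χ x ≤ 1)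
    (hχlip : ∀ x y, |χ x - χ y| ≤ edistR n R x y) (C' : Finset ↥R)
    (hχC : ∀ x y, edistR n R x y ≤ 1 → χ x ≠ χ y → x ∈ C') (hχC1 : ∀ x, χ x ≠ 1 → x ∈ C') (ψ u : ↥R → ℝ)
    (S : Finset ↥R) {lo₂ : ℝ} (hlo₂ : ∀ x ∈ S, ∀ y ∈ C', edistR n R x y ≤ 1 → lo₂ ≤ ψ x) (μ : Fin (d + 1)) :
    ∑ x ∈ S, fdiff n R μ ((1 - χ) * u) x ^ 2
      ≤ 2 * Real.exp (-(2 * lo₂)) *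
        (∑ x, (Real.exp (ψ x) * fdiff n R μ u x) ^ 2 + ∑ x, (Real.exp (ψ x) * u x) ^ 2) := by
  have hn0 : (0 : ℝ) < n := by exact_mod_cast hn
  have hn1 : (1 : ℝ) ≤ n := by exact_mod_cast hn
  have hx : ∀ x ∈ S, fdiff n R μ ((1 - χ) * u) x ^ 2
      ≤ 2 * Real.exp (-(2 * lo₂)) * ((Real.exp (ψ x) * fdiff n R μ u x) ^ 2 + (Real.exp (ψ x) * u x) ^ 2) := by
    intro x hxS
    by_cases hb : x.1 + uvec μ ∈ R
    · set x' : ↥R := ⟨x.1 + uvec μ, hb⟩ with hx'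
      have hnb : x'.1 ∈ nbrs x.1 := add_uvec_mem_nbrs x.1 μ
      have hdn : edistR n R x x' ≤ 1 / (n : ℝ) := edistR_le_of_mem_nbrs hn hnb
      have hd : edistR n R x x' ≤ 1 := hdn.trans (by rw [div_le_one hn0]; exact hn1)
      rw [fdiff_of_mem _ hb, fdiff_of_mem _ hb]
      simp only [Pi.mul_apply, Pi.sub_apply, Pi.one_apply]
      have hdec : (n : ℝ) * ((1 - χ x') * u x' - (1 - χ x) * u x)
          = (1 - χ x') * ((n : ℝ) * (u x' - u x)) - (n : ℝ) * (χ x' - χ x) * u x := by ring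
      -- bound `|…| ≤ e^{−lo₂}(e^{ψ x}|D u x| + e^{ψ x}|u x|)`
      have hT1 : |(1 - χ x') * ((n : ℝ) * (u x' - u x))| ≤ Real.exp (-lo₂) * (Real.exp (ψ x) * |(n : ℝ) * (u x' - u x)|) := by
        by_cases hc1 : χ x' = 1
        · rw [hc1, sub_self, zero_mul, abs_zero]; positivity
        have hψ := hlo₂ x hxS x' (hχC1 x' hc1) hd
        have h1c : |1 - χ x'| ≤ 1 := by rw [abs_le]; constructor <;> linarith [hχ0 x', hχ1 x']
        have hexp : 1 ≤ Real.exp (-lo₂) * Real.exp (ψ x) := by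
          rw [← Real.exp_add]; exact Real.one_le_exp (by linarith)
        rw [abs_mul]
        calc |1 - χ x'| * |(n : ℝ) * (u x' - u x)| ≤ 1 * |(n : ℝ) * (u x' - u x)| :=
              mul_le_mul_of_nonneg_right h1c (abs_nonneg _)
          _ ≤ (Real.exp (-lo₂) * Real.exp (ψ x)) * |(n : ℝ) * (u x' - u x)| :=
              mul_le_mul_of_nonneg_right hexp (abs_nonneg _)
          _ = _ := by ring
      have hT2 : |(n : ℝ) * (χ x' - χ x) * u x| ≤ Real.exp (-lo₂) * (Real.exp (ψ x) * |u x|) := by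
        by_cases hc2 : χ x = χ x'
        · rw [hc2, sub_self, mul_zero, zero_mul, abs_zero]; positivity
        have hψ := hlo₂ x hxS x (hχC x x' hd hc2) (by rw [edistR_self]; norm_num)
        have hnχ : |(n : ℝ) * (χ x' - χ x)| ≤ 1 := by
          rw [abs_mul, abs_of_nonneg hn0.le]
          calc (n : ℝ) * |χ x' - χ x| ≤ (n : ℝ) * (1 / (n : ℝ)) :=
                mul_le_mul_of_nonneg_left ((hχlip x' x).trans (by rw [edistR_comm]; exact hdn)) hn0.le
            _ = 1 := by field_simp
        have hexp : 1 ≤ Real.exp (-lo₂) * Real.exp (ψ x) := by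
          rw [← Real.exp_add]; exact Real.one_le_exp (by linarith)
        rw [abs_mul]
        calc |(n : ℝ) * (χ x' - χ x)| * |u x| ≤ 1 * |u x| := mul_le_mul_of_nonneg_right hnχ (abs_nonneg _)
          _ ≤ (Real.exp (-lo₂) * Real.exp (ψ x)) * |u x| := mul_le_mul_of_nonneg_right hexp (abs_nonneg _)
          _ = _ := by ring
      have hsum : |(n : ℝ) * ((1 - χ x') * u x' - (1 - χ x) * u x)|
          ≤ Real.exp (-lo₂) * (Real.exp (ψ x) * |(n : ℝ) * (u x' - u x)| + Real.exp (ψ x) * |u x|) := by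
        rw [hdec]
        refine (abs_sub _ _).trans ?_
        rw [mul_add]; exact add_le_add hT1 hT2
      have hexp2 : Real.exp (-lo₂) ^ 2 = Real.exp (-(2 * lo₂)) := by rw [sq, ← Real.exp_add]; congr 1; ring
      calc ((n : ℝ) * ((1 - χ x') * u x' - (1 - χ x) * u x)) ^ 2
          = |(n : ℝ) * ((1 - χ x') * u x' - (1 - χ x) * u x)| ^ 2 := (sq_abs _).symm
        _ ≤ (Real.exp (-lo₂) * (Real.exp (ψ x) * |(n : ℝ) * (u x' - u x)| + Real.exp (ψ x) * |u x|)) ^ 2 :=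
            pow_le_pow_left₀ (abs_nonneg _) hsum 2
        _ = Real.exp (-(2 * lo₂)) * (Real.exp (ψ x) * |(n : ℝ) * (u x' - u x)| + Real.exp (ψ x) * |u x|) ^ 2 := by
            rw [mul_pow, hexp2]
        _ ≤ Real.exp (-(2 * lo₂)) * (2 * ((Real.exp (ψ x) * |(n : ℝ) * (u x' - u x)|) ^ 2
            + (Real.exp (ψ x) * |u x|) ^ 2)) := mul_le_mul_of_nonneg_left (add_sq_le_two _ _) (Real.exp_pos _).le
        _ = _ := by rw [mul_pow, sq_abs, mul_pow (Real.exp (ψ x)) (|u x|), sq_abs]; ring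
    · rw [fdiff_of_not_mem _ hb]
      have : (0 : ℝ) ^ 2 = 0 := by norm_num
      rw [this]; positivity
  calc ∑ x ∈ S, fdiff n R μ ((1 - χ) * u) x ^ 2
      ≤ ∑ x ∈ S, 2 * Real.exp (-(2 * lo₂)) * ((Real.exp (ψ x) * fdiff n R μ u x) ^ 2 + (Real.exp (ψ x) * u x) ^ 2) :=
        Finset.sum_le_sum hx
    _ ≤ ∑ x, 2 * Real.exp (-(2 * lo₂)) * ((Real.exp (ψ x) * fdiff n R μ u x) ^ 2 + (Real.exp (ψ x) * u x) ^ 2) :=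
        Finset.sum_le_univ_sum_of_nonneg fun x => by positivity
    _ = _ := by rw [← Finset.mul_sum, Finset.sum_add_distrib]

end Extract

/-! ## §7  The master bound (abstract cutoff data) -/

section Master

variable {n : ℕ} {R R₀ : Finset (Fin (d + 1) → ℤ)} {a m2 : ℝ}

/-- `κ(a) = 4/min(2,a) + 8(1 + 4/min(2,a))`: bounds both source energies (cases A and B). [folklore] -/
def kapC (a : ℝ) : ℝ := 4 / min 2 a + 8 * (1 + 4 / min 2 a)

/-- `λ(a) = 1/min(2,a) + 2(1 + 4/min(2,a))`: extraction factor (values and gradients). [folklore] -/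
def lamC (a : ℝ) : ℝ := 1 / min 2 a + 2 * (1 + 4 / min 2 a)

/-- `β(d,a)`: the weighted norm `B(u)` of the Green's function is `≤ β‖f'‖²`. [folklore] -/
def betaC (d : ℕ) (a : ℝ) : ℝ :=
  2 * ((d : ℝ) + 1) * (((d : ℝ) + 1) * (2 * (1 + 4 / min 2 a) * kapC a)
    + (2 * ((d : ℝ) + 1) + 1) / 2 * (kapC a / min 2 a)) + 2 * a * (kapC a / min 2 a)

/-- `λ'(a)`: the cut-off part factor. [folklore] -/
def lampC (a : ℝ) : ℝ := kapC a / min 2 a + 2 * (2 * (1 + 4 / min 2 a) * kapC a + kapC a / min 2 a)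

/-- `K(d,a) = 2λ' + 16λ(αβ + γ)`: the master constant. [folklore] -/
def KC (d : ℕ) (a : ℝ) : ℝ := 2 * lampC a + 16 * lamC a * (alphaC d a * betaC d a + gammaC d a)

/-- `κ > 0`. [folklore] -/
theorem kapC_pos {a : ℝ} (ha : 0 < a) : 0 < kapC a := by
  have : 0 < min 2 a := lt_min (by norm_num) ha
  unfold kapC; positivity

/-- `λ > 0`. [folklore] -/
theorem lamC_pos {a : ℝ} (ha : 0 < a) : 0 < lamC a := by
  have : 0 < min 2 a := lt_min (by norm_num) ha
  unfold lamC; positivity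

/-- `β > 0`. [folklore] -/
theorem betaC_pos (d : ℕ) {a : ℝ} (ha : 0 < a) : 0 < betaC d a := by
  have : 0 < min 2 a := lt_min (by norm_num) ha
  have := kapC_pos ha
  unfold betaC; positivity

/-- `λ' > 0`. [folklore] -/
theorem lampC_pos {a : ℝ} (ha : 0 < a) : 0 < lampC a := by
  have : 0 < min 2 a := lt_min (by norm_num) ha
  have := kapC_pos ha
  unfold lampC; positivity

/-- `K > 0`. [folklore] -/
theorem KC_pos (d : ℕ) {a : ℝ} (ha : 0 < a) : 0 < KC d a := by
  have := lampC_pos ha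
  have := lamC_pos ha
  have := alphaC_pos d ha
  have := betaC_pos d ha
  have := gammaC_pos d ha
  unfold KC; positivity

/-- membership in the support. [folklore] -/
theorem mem_supp {f : ↥R → ℝ} {x : ↥R} : x ∈ supp f ↔ f x ≠ 0 := by
  simp [supp]

/-- **source energy**: for `u = G_R g'`, `g' ∈ {f', D_ν^⊤f'}`, `w' = e^{ψ}u` with `ψ` the Combes–Thomas weight of
`supp f'`: `⟨w', Hw'⟩ ≤ κ‖f'‖²` (cases A and B of Module 1). [cite: CombesThomas1973, §II] [folklore] -/
theorem srcEnergy_le (hn : 1 ≤ n) (hR : IsBlockUnion n R) (ha : 0 < a) (hm : 0 ≤ m2) {δ : ℝ} (hδ0 : 0 ≤ δ)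
    (hδ1 : δ ≤ 1) (hsmall : 2 * ((d : ℝ) + 1) * δ ^ 2 + a * (Real.exp δ - 1) ≤ min 2 a / 2) (f' : ↥R → ℝ)
    (hT : (supp f').Nonempty) (g' : ↥R → ℝ) (hg' : g' = f' ∨ ∃ ν, g' = fdiffT n R ν f') (w' : ↥R → ℝ)
    (hw' : ∀ j, w' j = Real.exp (ctw n R δ (supp f') hT j) * ((fineOpR n a m2 R)⁻¹.mulVec g') j) :
    w' ⬝ᵥ (fineOpR n a m2 R).mulVec w' ≤ kapC a * ∑ x, f' x ^ 2 := by
  have hσ : 0 < min 2 a := lt_min (by norm_num) ha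
  have hF0 : 0 ≤ ∑ x, f' x ^ 2 := Finset.sum_nonneg fun _ _ => sq_nonneg _
  have hsupp : ∀ j, j ∉ supp f' → f' j = 0 := fun j hj => eq_zero_of_not_mem_supp f' j hj
  have hk1 : 4 / min 2 a ≤ kapC a := by
    unfold kapC
    have : 0 ≤ 8 * (1 + 4 / min 2 a) := by positivity
    linarith
  have hk2 : 8 * (1 + 4 * δ ^ 2 / min 2 a) ≤ kapC a := by
    unfold kapC
    have hδ2 : 4 * δ ^ 2 ≤ 4 := by nlinarith
    have h1 : 4 * δ ^ 2 / min 2 a ≤ 4 / min 2 a := div_le_div_of_nonneg_right hδ2 hσ.le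
    have : 0 ≤ 4 / min 2 a := by positivity
    linarith
  rcases hg' with hg | ⟨ν, hg⟩
  · subst hg
    exact (energyA hn hR ha hm hδ0 hδ1 hsmall (supp g') hT g' hsupp w' hw').trans
      (mul_le_mul_of_nonneg_right hk1 hF0)
  · subst hg
    exact (energyB hn hR ha hm hδ0 hδ1 hsmall (supp f') hT ν f' hsupp w' hw').trans
      (mul_le_mul_of_nonneg_right hk2 hF0)

set_option maxHeartbeats 400000 in
/-- **THE MASTER BOUND.**  For abstract cutoff data `(χ, C', φ, lo, lo₂)` as in `energyW_le`, with `ψ` the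
Combes–Thomas weight of `supp f'`, `lo ≤ φ` on `Ŝ` and `lo₂ ≤ ψ` at the points of `S` within `dist_η ≤ 1` of the
collar: the restrictions to `S` of `δG g'` and of `D_μ δG g'` (`g' ∈ {f', D_ν^⊤f'}`) have
`Σ_{x∈S}(·)² ≤ (e^{−2lo₂} + e^{4δ−2δr}e^{−2lo})·K(d,a)·‖f'‖²`. [cite: CombesThomas1973, §II] [folklore] -/
theorem master_setSq_le (hn : 1 ≤ n) (hR : IsBlockUnion n R) (hR₀ : IsBlockUnion n R₀) (h : R ⊆ R₀)
    (ha : 0 < a) (hm : 0 ≤ m2) {δ r lo lo₂ : ℝ} (hδ0 : 0 ≤ δ) (hδ1 : δ ≤ 1)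
    (hsmall : 2 * ((d : ℝ) + 1) * δ ^ 2 + a * (Real.exp δ - 1) ≤ min 2 a / 2)
    (χ : ↥R → ℝ) (hχ0 : ∀ x, 0 ≤ χ x) (hχ1 : ∀ x, χ x ≤ 1) (hχlip : ∀ x y, |χ x - χ y| ≤ edistR n R x y)
    (hχbd : ∀ y ∈ bdR R R₀, χ y = 0) (C' : Finset ↥R)
    (hχC : ∀ x y, edistR n R x y ≤ 1 → χ x ≠ χ y → x ∈ C') (hχC1 : ∀ x, χ x ≠ 1 → x ∈ C')
    (f' : ↥R → ℝ) (hT : (supp f').Nonempty) (φ : ↥R₀ → ℝ)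
    (hφlip : ∀ j k, |φ j - φ k| ≤ δ * edistR n R₀ j k)
    (hφC : ∀ x ∈ C', φ (incl h x) ≤ ctw n R δ (supp f') hT x - δ * r) (S : Finset ↥R)
    (hlo : ∀ x ∈ S, lo ≤ φ (incl h x))
    (hlo₂ : ∀ x ∈ S, ∀ y ∈ C', edistR n R x y ≤ 1 → lo₂ ≤ ctw n R δ (supp f') hT x)
    (g' : ↥R → ℝ) (hg' : g' = f' ∨ ∃ ν, g' = fdiffT n R ν f') :
    (∑ x ∈ S, dG n a m2 h g' x ^ 2 ≤ (Real.exp (-(2 * lo₂)) + Real.exp (4 * δ - 2 * (δ * r)) * Real.exp (-(2 * lo))) * KC d a * ∑ x, f' x ^ 2)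
    ∧ ∀ μ, ∑ x ∈ S, fdiff n R μ (dG n a m2 h g') x ^ 2 ≤ (Real.exp (-(2 * lo₂)) + Real.exp (4 * δ - 2 * (δ * r)) * Real.exp (-(2 * lo))) * KC d a * ∑ x, f' x ^ 2 := by
  classical
  have hn0 : (0 : ℝ) < n := by exact_mod_cast hn
  have hσ : 0 < min 2 a := lt_min (by norm_num) ha
  have hF0 : 0 ≤ ∑ x, f' x ^ 2 := Finset.sum_nonneg fun _ _ => sq_nonneg _
  have hκ := kapC_pos ha
  have hα := alphaC_pos d ha
  have hβ := betaC_pos d ha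
  have hγ := gammaC_pos d ha
  -- the data
  have hu : (fineOpR n a m2 R).mulVec ((fineOpR n a m2 R)⁻¹.mulVec g') = g' := mulVec_inv_mulVec hn hR ha hm g'
  have hψ : ∀ x y, edistR n R x y ≤ 1 → |ctw n R δ (supp f') hT x - ctw n R δ (supp f') hT y| ≤ δ :=
    fun x y hxy => (abs_ctw_sub_le hδ0 _ hT x y).trans ((mul_le_mul_of_nonneg_left hxy hδ0).trans (by rw [mul_one]))
  have hψT : ∀ x, f' x ≠ 0 → ctw n R δ (supp f') hT x ≤ 0 :=
    fun x hx => ctw_le_zero_of_mem hδ0 _ hT (mem_supp.2 hx)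
  have hw : ∀ j : ↥R₀, (fun j => Real.exp (φ j) * corrW n a m2 R₀ χ ((fineOpR n a m2 R)⁻¹.mulVec g') g' j) j
      = Real.exp (φ j) * corrW n a m2 R₀ χ ((fineOpR n a m2 R)⁻¹.mulVec g') g' j := fun j => rfl
  have hw' : ∀ j : ↥R, (fun j => Real.exp (ctw n R δ (supp f') hT j) * ((fineOpR n a m2 R)⁻¹.mulVec g') j) j
      = Real.exp (ctw n R δ (supp f') hT j) * ((fineOpR n a m2 R)⁻¹.mulVec g') j := fun j => rfl
  -- source side
  have hE' := srcEnergy_le hn hR ha hm hδ0 hδ1 hsmall f' hT g' hg' _ hw'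
  have hY0 : ∑ x, (Real.exp (ctw n R δ (supp f') hT x) * ((fineOpR n a m2 R)⁻¹.mulVec g') x) ^ 2
      ≤ kapC a / min 2 a * ∑ x, f' x ^ 2 := by
    refine (weightedSq_le_energy hn hR ha hm _ _ _ hw').trans ?_
    rw [div_le_iff₀ hσ]
    calc _ ≤ kapC a * ∑ x, f' x ^ 2 := hE'
      _ = _ := by field_simp
  have h14 : 1 + 4 * δ ^ 2 / min 2 a ≤ 1 + 4 / min 2 a := by
    have hδ2 : 4 * δ ^ 2 ≤ 4 := by nlinarith
    have := div_le_div_of_nonneg_right hδ2 hσ.le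
    linarith
  have h14pos : 0 ≤ 1 + 4 * δ ^ 2 / min 2 a := by positivity
  have hY1 : ∀ μ, ∑ x, (Real.exp (ctw n R δ (supp f') hT x) * fdiff n R μ ((fineOpR n a m2 R)⁻¹.mulVec g') x) ^ 2
      ≤ 2 * (1 + 4 / min 2 a) * kapC a * ∑ x, f' x ^ 2 := by
    intro μ
    refine (weightedFdiffSq_le_energy hn hR ha hm hδ0 hδ1 (supp f') hT _ _ hw' μ).trans ?_
    have hE'0 : 0 ≤ (fun j => Real.exp (ctw n R δ (supp f') hT j) * ((fineOpR n a m2 R)⁻¹.mulVec g') j)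
        ⬝ᵥ (fineOpR n a m2 R).mulVec
          (fun j => Real.exp (ctw n R δ (supp f') hT j) * ((fineOpR n a m2 R)⁻¹.mulVec g') j) :=
      le_trans (mul_nonneg hσ.le (dotProduct_self_nonneg' _)) (hpos_region hn hR ha.le hm _)
    calc _ ≤ 2 * (1 + 4 / min 2 a) * (kapC a * ∑ x, f' x ^ 2) :=
          mul_le_mul (mul_le_mul_of_nonneg_left h14 (by norm_num)) hE' hE'0 (by positivity)
      _ = _ := by ring
  have hY1' : ∑ x, ∑ μ, (Real.exp (ctw n R δ (supp f') hT x)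
        * fdiff n R μ ((fineOpR n a m2 R)⁻¹.mulVec g') x) ^ 2
      ≤ ((d : ℝ) + 1) * (2 * (1 + 4 / min 2 a) * kapC a * ∑ x, f' x ^ 2) := by
    rw [Finset.sum_comm]
    calc _ ≤ ∑ μ : Fin (d + 1), 2 * (1 + 4 / min 2 a) * kapC a * ∑ x, f' x ^ 2 :=
          Finset.sum_le_sum fun μ _ => hY1 μ
      _ = _ := by simp
  have hB : 2 * ((d : ℝ) + 1) * (∑ x, ∑ μ, (Real.exp (ctw n R δ (supp f') hT x)
          * fdiff n R μ ((fineOpR n a m2 R)⁻¹.mulVec g') x) ^ 2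
        + (2 * ((d : ℝ) + 1) + 1) / 2 * ∑ x, (Real.exp (ctw n R δ (supp f') hT x)
          * ((fineOpR n a m2 R)⁻¹.mulVec g') x) ^ 2)
      + 2 * a * ∑ x, (Real.exp (ctw n R δ (supp f') hT x) * ((fineOpR n a m2 R)⁻¹.mulVec g') x) ^ 2
      ≤ betaC d a * ∑ x, f' x ^ 2 := by
    have e : betaC d a * ∑ x, f' x ^ 2
        = 2 * ((d : ℝ) + 1) * (((d : ℝ) + 1) * (2 * (1 + 4 / min 2 a) * kapC a * ∑ x, f' x ^ 2)
          + (2 * ((d : ℝ) + 1) + 1) / 2 * (kapC a / min 2 a * ∑ x, f' x ^ 2))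
          + 2 * a * (kapC a / min 2 a * ∑ x, f' x ^ 2) := by
      unfold betaC; ring
    rw [e]
    have t1 := mul_le_mul_of_nonneg_left hY0 (by positivity : 0 ≤ (2 * ((d : ℝ) + 1) + 1) / 2)
    have t2 := mul_le_mul_of_nonneg_left (add_le_add hY1' t1) (by positivity : 0 ≤ 2 * ((d : ℝ) + 1))
    have t3 := mul_le_mul_of_nonneg_left hY0 (by positivity : 0 ≤ 2 * a)
    linarith
  -- corrector energy
  have hE := energyW_le hn hR hR₀ h ha hm hδ0 hδ1 hsmall χ hχ0 hχ1 hχlip hχbd C' hχC hχC1 (ctw n R δ (supp f') hT)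
    hψ f' hψT φ hφlip hφC ((fineOpR n a m2 R)⁻¹.mulVec g') g' hu hg' _ hw
  have hΘ0 : 0 < Real.exp (4 * δ - 2 * (δ * r)) := Real.exp_pos _
  have hEF : (fun j => Real.exp (φ j) * corrW n a m2 R₀ χ ((fineOpR n a m2 R)⁻¹.mulVec g') g' j)
        ⬝ᵥ (fineOpR n a m2 R₀).mulVec
          (fun j => Real.exp (φ j) * corrW n a m2 R₀ χ ((fineOpR n a m2 R)⁻¹.mulVec g') g' j)
      ≤ 8 * Real.exp (4 * δ - 2 * (δ * r)) * (alphaC d a * betaC d a + gammaC d a) * ∑ x, f' x ^ 2 := by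
    refine hE.trans ?_
    have t1 := mul_le_mul_of_nonneg_left hB hα.le
    have t2 : alphaC d a * (2 * ((d : ℝ) + 1) * (∑ x, ∑ μ, (Real.exp (ctw n R δ (supp f') hT x)
          * fdiff n R μ ((fineOpR n a m2 R)⁻¹.mulVec g') x) ^ 2
        + (2 * ((d : ℝ) + 1) + 1) / 2 * ∑ x, (Real.exp (ctw n R δ (supp f') hT x)
          * ((fineOpR n a m2 R)⁻¹.mulVec g') x) ^ 2)
        + 2 * a * ∑ x, (Real.exp (ctw n R δ (supp f') hT x) * ((fineOpR n a m2 R)⁻¹.mulVec g') x) ^ 2)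
        + gammaC d a * ∑ x, f' x ^ 2
        ≤ (alphaC d a * betaC d a + gammaC d a) * ∑ x, f' x ^ 2 := by linarith
    calc _ ≤ 8 * Real.exp (4 * δ - 2 * (δ * r)) * ((alphaC d a * betaC d a + gammaC d a) * ∑ x, f' x ^ 2) :=
          mul_le_mul_of_nonneg_left t2 (by positivity)
      _ = _ := by ring
  -- the four pieces on `S`
  have hcut0 := sum_cutU_sq_le χ hχ0 hχ1 C' hχC1 (ctw n R δ (supp f') hT) ((fineOpR n a m2 R)⁻¹.mulVec g') S hlo₂
  have hcut1 := fun μ => sum_fdiff_cutU_sq_le hn χ hχ0 hχ1 hχlip C' hχC hχC1 (ctw n R δ (supp f') hT)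
    ((fineOpR n a m2 R)⁻¹.mulVec g') S hlo₂ μ
  have hres0 := sum_resW_sq_le hn hR₀ h ha hm φ (corrW n a m2 R₀ χ ((fineOpR n a m2 R)⁻¹.mulVec g') g') _
    hw S hlo
  have hres1 := fun μ => sum_fdiff_resW_sq_le hn hR₀ h ha hm hδ0 hδ1 φ
    (corrW n a m2 R₀ χ ((fineOpR n a m2 R)⁻¹.mulVec g') g') _ hφlip hw S hlo μ
  have hdec := dG_eq (n := n) (a := a) (m2 := m2) h χ g'
  -- constants
  have hP0 : 0 ≤ Real.exp (-(2 * lo₂)) := (Real.exp_pos _).le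
  have hQ0 : 0 ≤ Real.exp (4 * δ - 2 * (δ * r)) * Real.exp (-(2 * lo)) := by positivity
  have hK1 : 2 * (kapC a / min 2 a) ≤ KC d a := by
    unfold KC lampC
    have : 0 ≤ 16 * lamC a * (alphaC d a * betaC d a + gammaC d a) := by have := lamC_pos ha; positivity
    have : 0 ≤ 2 * (2 * (1 + 4 / min 2 a) * kapC a + kapC a / min 2 a) := by positivity
    linarith
  have hK3 : 4 * (2 * (1 + 4 / min 2 a) * kapC a + kapC a / min 2 a) ≤ KC d a := by
    unfold KC lampC
    have : 0 ≤ 16 * lamC a * (alphaC d a * betaC d a + gammaC d a) := by have := lamC_pos ha; positivity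
    have : 0 ≤ kapC a / min 2 a := by positivity
    linarith
  have hK2 : 16 * (1 / min 2 a) * (alphaC d a * betaC d a + gammaC d a) ≤ KC d a := by
    unfold KC lamC
    have : 0 ≤ 2 * lampC a := by have := lampC_pos ha; positivity
    have : 0 ≤ 2 * (1 + 4 / min 2 a) * (alphaC d a * betaC d a + gammaC d a) := by positivity
    nlinarith
  have hK4 : 32 * (1 + 4 / min 2 a) * (alphaC d a * betaC d a + gammaC d a) ≤ KC d a := by
    unfold KC lamC
    have : 0 ≤ 2 * lampC a := by have := lampC_pos ha; positivity
    have : 0 ≤ 1 / min 2 a * (alphaC d a * betaC d a + gammaC d a) := by positivity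
    nlinarith
  refine ⟨?_, fun μ => ?_⟩
  · -- values
    have hpt : ∀ x ∈ S, dG n a m2 h g' x ^ 2
        ≤ 2 * (((1 - χ) * (fineOpR n a m2 R)⁻¹.mulVec g') x ^ 2
          + resTo h (corrW n a m2 R₀ χ ((fineOpR n a m2 R)⁻¹.mulVec g') g') x ^ 2) := by
      intro x _
      rw [hdec, Pi.add_apply]; exact add_sq_le_two _ _
    have h1 : ∑ x ∈ S, dG n a m2 h g' x ^ 2
        ≤ 2 * (∑ x ∈ S, ((1 - χ) * (fineOpR n a m2 R)⁻¹.mulVec g') x ^ 2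
          + ∑ x ∈ S, resTo h (corrW n a m2 R₀ χ ((fineOpR n a m2 R)⁻¹.mulVec g') g') x ^ 2) := by
      refine (Finset.sum_le_sum hpt).trans (le_of_eq ?_)
      rw [← Finset.mul_sum, Finset.sum_add_distrib]
    have hc : ∑ x ∈ S, ((1 - χ) * (fineOpR n a m2 R)⁻¹.mulVec g') x ^ 2
        ≤ Real.exp (-(2 * lo₂)) * (kapC a / min 2 a * ∑ x, f' x ^ 2) :=
      hcut0.trans (mul_le_mul_of_nonneg_left hY0 hP0)
    have hr : ∑ x ∈ S, resTo h (corrW n a m2 R₀ χ ((fineOpR n a m2 R)⁻¹.mulVec g') g') x ^ 2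
        ≤ Real.exp (-(2 * lo)) / min 2 a
          * (8 * Real.exp (4 * δ - 2 * (δ * r)) * (alphaC d a * betaC d a + gammaC d a) * ∑ x, f' x ^ 2) :=
      hres0.trans (mul_le_mul_of_nonneg_left hEF (by positivity))
    have e1 : Real.exp (-(2 * lo₂)) * (kapC a / min 2 a * ∑ x, f' x ^ 2)
        = (Real.exp (-(2 * lo₂)) * ∑ x, f' x ^ 2) * (kapC a / min 2 a) := by ring
    have e2 : Real.exp (-(2 * lo)) / min 2 a
          * (8 * Real.exp (4 * δ - 2 * (δ * r)) * (alphaC d a * betaC d a + gammaC d a) * ∑ x, f' x ^ 2)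
        = (Real.exp (4 * δ - 2 * (δ * r)) * Real.exp (-(2 * lo)) * ∑ x, f' x ^ 2)
          * (8 * (1 / min 2 a) * (alphaC d a * betaC d a + gammaC d a)) := by ring
    rw [e1] at hc
    rw [e2] at hr
    have t1 := mul_le_mul_of_nonneg_left hK1 (mul_nonneg hP0 hF0)
    have t2 := mul_le_mul_of_nonneg_left hK2 (mul_nonneg hQ0 hF0)
    linarith
  · -- gradients
    have hpt : ∀ x ∈ S, fdiff n R μ (dG n a m2 h g') x ^ 2
        ≤ 2 * (fdiff n R μ ((1 - χ) * (fineOpR n a m2 R)⁻¹.mulVec g') x ^ 2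
          + fdiff n R μ (resTo h (corrW n a m2 R₀ χ ((fineOpR n a m2 R)⁻¹.mulVec g') g')) x ^ 2) := by
      intro x _
      rw [hdec, fdiff_add, Pi.add_apply]; exact add_sq_le_two _ _
    have h1 : ∑ x ∈ S, fdiff n R μ (dG n a m2 h g') x ^ 2
        ≤ 2 * (∑ x ∈ S, fdiff n R μ ((1 - χ) * (fineOpR n a m2 R)⁻¹.mulVec g') x ^ 2
          + ∑ x ∈ S, fdiff n R μ (resTo h (corrW n a m2 R₀ χ ((fineOpR n a m2 R)⁻¹.mulVec g') g')) x ^ 2) := by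
      refine (Finset.sum_le_sum hpt).trans (le_of_eq ?_)
      rw [← Finset.mul_sum, Finset.sum_add_distrib]
    have hc : ∑ x ∈ S, fdiff n R μ ((1 - χ) * (fineOpR n a m2 R)⁻¹.mulVec g') x ^ 2
        ≤ 2 * Real.exp (-(2 * lo₂))
          * (2 * (1 + 4 / min 2 a) * kapC a * ∑ x, f' x ^ 2 + kapC a / min 2 a * ∑ x, f' x ^ 2) :=
      (hcut1 μ).trans (mul_le_mul_of_nonneg_left (add_le_add (hY1 μ) hY0) (by positivity))
    have hr : ∑ x ∈ S, fdiff n R μ (resTo h (corrW n a m2 R₀ χ ((fineOpR n a m2 R)⁻¹.mulVec g') g')) x ^ 2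
        ≤ 2 * Real.exp (-(2 * lo)) * (1 + 4 * δ ^ 2 / min 2 a)
          * (8 * Real.exp (4 * δ - 2 * (δ * r)) * (alphaC d a * betaC d a + gammaC d a) * ∑ x, f' x ^ 2) :=
      (hres1 μ).trans (mul_le_mul_of_nonneg_left hEF (by positivity))
    have hr' : ∑ x ∈ S, fdiff n R μ (resTo h (corrW n a m2 R₀ χ ((fineOpR n a m2 R)⁻¹.mulVec g') g')) x ^ 2
        ≤ 2 * Real.exp (-(2 * lo)) * (1 + 4 / min 2 a)
          * (8 * Real.exp (4 * δ - 2 * (δ * r)) * (alphaC d a * betaC d a + gammaC d a) * ∑ x, f' x ^ 2) := by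
      refine hr.trans (mul_le_mul_of_nonneg_right ?_ (by positivity))
      exact mul_le_mul_of_nonneg_left h14 (by positivity)
    have e1 : 2 * Real.exp (-(2 * lo₂))
          * (2 * (1 + 4 / min 2 a) * kapC a * ∑ x, f' x ^ 2 + kapC a / min 2 a * ∑ x, f' x ^ 2)
        = (Real.exp (-(2 * lo₂)) * ∑ x, f' x ^ 2)
          * (2 * (2 * (1 + 4 / min 2 a) * kapC a + kapC a / min 2 a)) := by ring
    have e2 : 2 * Real.exp (-(2 * lo)) * (1 + 4 / min 2 a)
          * (8 * Real.exp (4 * δ - 2 * (δ * r)) * (alphaC d a * betaC d a + gammaC d a) * ∑ x, f' x ^ 2)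
        = (Real.exp (4 * δ - 2 * (δ * r)) * Real.exp (-(2 * lo)) * ∑ x, f' x ^ 2)
          * (16 * (1 + 4 / min 2 a) * (alphaC d a * betaC d a + gammaC d a)) := by ring
    rw [e1] at hc
    rw [e2] at hr'
    have t1 := mul_le_mul_of_nonneg_left hK3 (mul_nonneg hP0 hF0)
    have t2 := mul_le_mul_of_nonneg_left hK4 (mul_nonneg hQ0 hF0)
    linarith

end Master

/-! ## §8  Geometry: the boundary set, the cutoff, the collar and the inf-convolution weight -/

section Geometry

variable {n : ℕ} {R R₀ : Finset (Fin (d + 1) → ℤ)} {a m2 : ℝ}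

/-- the fine points of `Ω₀ ∖ Ω`: the points of `R₀` outside `R`. [folklore] -/
def outR (R R₀ : Finset (Fin (d + 1) → ℤ)) : Finset ↥R₀ := Finset.univ.filter fun z => z.1 ∉ R

/-- membership in `outR`. [folklore] -/
theorem mem_outR {z : ↥R₀} : z ∈ outR R R₀ ↔ z.1 ∉ R := by simp [outR]

/-- distance between two finite sets along `dR` (`0` if one of them is empty). [folklore] -/
def setDist {α : Type*} (dR : α → α → ℝ) (A B : Finset α) : ℝ :=
  if h : (A ×ˢ B).Nonempty then (A ×ˢ B).inf' h (fun p => dR p.1 p.2) else 0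

/-- the set distance is below every pointwise distance. [folklore] -/
theorem setDist_le {α : Type*} (dR : α → α → ℝ) {A B : Finset α} {x y : α} (hx : x ∈ A) (hy : y ∈ B) :
    setDist dR A B ≤ dR x y := by
  have hmem : (x, y) ∈ A ×ˢ B := Finset.mk_mem_product hx hy
  have hne : (A ×ˢ B).Nonempty := ⟨_, hmem⟩
  unfold setDist
  rw [dif_pos hne]
  exact Finset.inf'_le (fun p : α × α => dR p.1 p.2) hmem

/-- the inclusion `R ↪ R₀` as an embedding. [folklore] -/
def inclEmb (h : R ⊆ R₀) : ↥R ↪ ↥R₀ := ⟨incl h, incl_injective h⟩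

/-- **`dist_η(supp f, Ω₀∖Ω)`** inside `R₀` (`0` if `supp f` or `R₀∖R` is empty).  Since `Ω₀∖Ω ⊆ Ω^c`, this is
`≥ dist(supp f, Ω^c)` of the printed Corollary, so decay in `bdist` is at least as strong as the printed decay factor.
[cite: Balaban1983RegularityDecay, p. 581, Corollary 2.3, "e^{−δ₀ dist(supp f, Ω^c)}"] -/
def bdist (n : ℕ) (h : R ⊆ R₀) (f : ↥R → ℝ) : ℝ :=
  setDist (edistR n R₀) ((supp f).map (inclEmb h)) (outR R R₀)

/-- `bdist` is below every distance from the support to `Ω₀∖Ω`. [folklore] -/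
theorem bdist_le (h : R ⊆ R₀) (f : ↥R → ℝ) {x : ↥R} (hx : x ∈ supp f) {z : ↥R₀} (hz : z ∈ outR R R₀) :
    bdist n h f ≤ edistR n R₀ (incl h x) z :=
  setDist_le _ (Finset.mem_map_of_mem (inclEmb h) hx) hz

/-- distance to `Ω₀∖Ω`. [folklore] -/
def dout (n : ℕ) (hout : (outR R R₀).Nonempty) (j : ↥R₀) : ℝ := distTo (edistR n R₀) (outR R R₀) hout j

/-- the distance to `Ω₀∖Ω` is `1`-Lipschitz. [folklore] -/
theorem abs_dout_sub_le (hout : (outR R R₀).Nonempty) (j k : ↥R₀) :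
    |dout n hout j - dout n hout k| ≤ edistR n R₀ j k :=
  abs_distTo_sub_le (edistR n R₀) edistR_comm edistR_triangle _ hout j k

/-- the distance to `Ω₀∖Ω` is below every pointwise distance. [folklore] -/
theorem dout_le (hout : (outR R R₀).Nonempty) (j : ↥R₀) {z : ↥R₀} (hz : z ∈ outR R R₀) :
    dout n hout j ≤ edistR n R₀ j z :=
  distTo_le _ _ hout hz

/-- the distance to `Ω₀∖Ω` is attained. [folklore] -/
theorem exists_dout_eq (hout : (outR R R₀).Nonempty) (j : ↥R₀) :
    ∃ z ∈ outR R R₀, dout n hout j = edistR n R₀ j z := by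
  obtain ⟨z, hz, h⟩ := Finset.exists_mem_eq_inf' hout fun t => edistR n R₀ j t
  exact ⟨z, hz, h⟩

/-- **THE CUTOFF** `χ = min(1, max(dist_η(·, Ω₀∖Ω) − η, 0))`: values in `[0,1]`, `1`-Lipschitz for `dist_η`, zero on
the boundary layer, `≠ 1` only within `dist_η ≤ 2`. [folklore] -/
def cutF (n : ℕ) (h : R ⊆ R₀) (hout : (outR R R₀).Nonempty) (x : ↥R) : ℝ :=
  min 1 (max (dout n hout (incl h x) - 1 / (n : ℝ)) 0)

/-- **THE COLLAR** `C' = {dist_η(·, Ω₀∖Ω) ≤ 3}`. [folklore] -/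
def collar (n : ℕ) (h : R ⊆ R₀) (hout : (outR R R₀).Nonempty) : Finset ↥R :=
  Finset.univ.filter fun x => dout n hout (incl h x) ≤ 3

/-- membership in the collar. [folklore] -/
theorem mem_collar {h : R ⊆ R₀} {hout : (outR R R₀).Nonempty} {x : ↥R} :
    x ∈ collar n h hout ↔ dout n hout (incl h x) ≤ 3 := by simp [collar]

/-- `χ ≥ 0`. [folklore] -/
theorem cutF_nonneg (h : R ⊆ R₀) (hout : (outR R R₀).Nonempty) (x : ↥R) : 0 ≤ cutF n h hout x :=
  le_min zero_le_one (le_max_right _ _)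

/-- `χ ≤ 1`. [folklore] -/
theorem cutF_le_one (h : R ⊆ R₀) (hout : (outR R R₀).Nonempty) (x : ↥R) : cutF n h hout x ≤ 1 := min_le_left _ _

/-- `χ` is `1`-Lipschitz for `dist_η`. [folklore] -/
theorem abs_cutF_sub_le (h : R ⊆ R₀) (hout : (outR R R₀).Nonempty) (x y : ↥R) :
    |cutF n h hout x - cutF n h hout y| ≤ edistR n R x y := by
  unfold cutF
  calc _ ≤ max |(1 : ℝ) - 1| |max (dout n hout (incl h x) - 1 / (n : ℝ)) 0 - max (dout n hout (incl h y) - 1 / (n : ℝ)) 0| :=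
        abs_min_sub_min_le_max _ _ _ _
    _ = |max (dout n hout (incl h x) - 1 / (n : ℝ)) 0 - max (dout n hout (incl h y) - 1 / (n : ℝ)) 0| := by
        rw [sub_self, abs_zero, max_eq_right (abs_nonneg _)]
    _ ≤ |(dout n hout (incl h x) - 1 / (n : ℝ)) - (dout n hout (incl h y) - 1 / (n : ℝ))| :=
        abs_max_sub_max_le_abs _ _ _
    _ = |dout n hout (incl h x) - dout n hout (incl h y)| := by ring_nf
    _ ≤ edistR n R₀ (incl h x) (incl h y) := abs_dout_sub_le hout _ _
    _ = edistR n R x y := edistR_incl h x y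

/-- `χ = 0` on the boundary layer. [folklore] -/
theorem cutF_eq_zero_of_mem_bdR (hn : 1 ≤ n) (h : R ⊆ R₀) (hout : (outR R R₀).Nonempty) {y : ↥R}
    (hy : y ∈ bdR R R₀) : cutF n h hout y = 0 := by
  obtain ⟨z, hz, hz0, hzR⟩ := mem_bdR.1 hy
  have hzo : (⟨z, hz0⟩ : ↥R₀) ∈ outR R R₀ := mem_outR.2 hzR
  have h1 : dout n hout (incl h y) ≤ 1 / (n : ℝ) :=
    (dout_le hout _ hzo).trans (edistR_le_of_mem_nbrs (R := R₀) hn hz)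
  unfold cutF
  rw [max_eq_right (by linarith), min_eq_right zero_le_one]

/-- `χ = 1` beyond `dist_η > 2`. [folklore] -/
theorem cutF_eq_one_of_lt (hn : 1 ≤ n) (h : R ⊆ R₀) (hout : (outR R R₀).Nonempty) {x : ↥R}
    (hx : 2 < dout n hout (incl h x)) : cutF n h hout x = 1 := by
  have hn0 : (0 : ℝ) < n := by exact_mod_cast hn
  have hn1 : 1 / (n : ℝ) ≤ 1 := by rw [div_le_one hn0]; exact_mod_cast hn
  unfold cutF
  rw [min_eq_left]
  exact le_max_of_le_left (by linarith)

/-- `{χ ≠ 1}` lies in the collar. [folklore] -/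
theorem mem_collar_of_cutF_ne_one (hn : 1 ≤ n) (h : R ⊆ R₀) (hout : (outR R R₀).Nonempty) {x : ↥R}
    (hx : cutF n h hout x ≠ 1) : x ∈ collar n h hout := by
  rw [mem_collar]
  by_contra hc
  exact hx (cutF_eq_one_of_lt hn h hout (by linarith [not_le.1 hc]))

/-- the jump set of `χ` (at scale `dist_η ≤ 1`) lies in the collar. [folklore] -/
theorem mem_collar_of_jump (hn : 1 ≤ n) (h : R ⊆ R₀) (hout : (outR R R₀).Nonempty) {x y : ↥R}
    (hxy : edistR n R x y ≤ 1) (hj : cutF n h hout x ≠ cutF n h hout y) : x ∈ collar n h hout := by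
  rw [mem_collar]
  by_contra hc
  have hx : 3 < dout n hout (incl h x) := not_le.1 hc
  have hd := abs_dout_sub_le (n := n) hout (incl h x) (incl h y)
  rw [edistR_incl, abs_le] at hd
  have hy : 2 < dout n hout (incl h y) := by linarith [hd.2]
  exact hj (by rw [cutF_eq_one_of_lt hn h hout (by linarith), cutF_eq_one_of_lt hn h hout hy])

/-- **THE INF-CONVOLUTION** `j ↦ min_{c∈C} (g(c) + d(j,c))` (the largest `d`-`1`-Lipschitz function below `g` on `C`).
[folklore] -/
def infConv {α β : Type*} (dR : β → α → ℝ) (C : Finset α) (hC : C.Nonempty) (g : α → ℝ) (j : β) : ℝ :=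
  C.inf' hC fun c => g c + dR j c

/-- the inf-convolution is below each competitor. [folklore] -/
theorem infConv_le {α β : Type*} (dR : β → α → ℝ) {C : Finset α} (hC : C.Nonempty) (g : α → ℝ) (j : β) {c : α}
    (hc : c ∈ C) : infConv dR C hC g j ≤ g c + dR j c :=
  Finset.inf'_le (fun c => g c + dR j c) hc

/-- the inf-convolution is attained. [folklore] -/
theorem exists_infConv_eq {α β : Type*} (dR : β → α → ℝ) {C : Finset α} (hC : C.Nonempty) (g : α → ℝ) (j : β) :
    ∃ c ∈ C, infConv dR C hC g j = g c + dR j c := by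
  obtain ⟨c, hc, h⟩ := Finset.exists_mem_eq_inf' hC fun c => g c + dR j c
  exact ⟨c, hc, h⟩

/-- the inf-convolution is `1`-Lipschitz for any `dJ` dominating `dR` through the triangle inequality. [folklore] -/
theorem abs_infConv_sub_le {α β : Type*} (dR : β → α → ℝ) (dJ : β → β → ℝ) (hds : ∀ j k, dJ j k = dJ k j)
    (hdt : ∀ j k c, dR j c ≤ dJ j k + dR k c) {C : Finset α} (hC : C.Nonempty) (g : α → ℝ) (j k : β) :
    |infConv dR C hC g j - infConv dR C hC g k| ≤ dJ j k := by
  have one : ∀ j k, infConv dR C hC g j ≤ dJ j k + infConv dR C hC g k := by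
    intro j k
    obtain ⟨c, hc, hk⟩ := exists_infConv_eq dR hC g k
    calc infConv dR C hC g j ≤ g c + dR j c := infConv_le dR hC g j hc
      _ ≤ g c + (dJ j k + dR k c) := add_le_add le_rfl (hdt j k c)
      _ = dJ j k + infConv dR C hC g k := by rw [hk]; ring
  rw [abs_sub_le_iff]
  constructor
  · linarith [one j k]
  · linarith [one k j, hds j k]

/-- **THE EXTRACTION WEIGHT** on `R₀`: `φ = δ·min_{c∈C'}(dist_η(c, supp f') + dist_η(·, ĉ)) − δr` (and the constant
`lo` if the collar is empty). [folklore] -/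
def phiW (n : ℕ) (h : R ⊆ R₀) (δ r lo : ℝ) (C' : Finset ↥R) (T : Finset ↥R) (hT : T.Nonempty) (j : ↥R₀) : ℝ :=
  if hC : C'.Nonempty then
    δ * infConv (fun (j : ↥R₀) (c : ↥R) => edistR n R₀ j (incl h c)) C' hC (distTo (edistR n R) T hT) j - δ * r
  else lo

/-- the extraction weight is `δ`-Lipschitz for `dist_η`. [folklore] -/
theorem abs_phiW_sub_le (h : R ⊆ R₀) {δ : ℝ} (hδ0 : 0 ≤ δ) (r lo : ℝ) (C' T : Finset ↥R) (hT : T.Nonempty)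
    (j k : ↥R₀) : |phiW n h δ r lo C' T hT j - phiW n h δ r lo C' T hT k| ≤ δ * edistR n R₀ j k := by
  unfold phiW
  by_cases hC : C'.Nonempty
  · rw [dif_pos hC, dif_pos hC]
    have h1 := abs_infConv_sub_le (fun (j : ↥R₀) (c : ↥R) => edistR n R₀ j (incl h c)) (edistR n R₀)
      edistR_comm (fun j k c => edistR_triangle j k (incl h c)) hC (distTo (edistR n R) T hT) j k
    calc _ = |δ * (infConv (fun (j : ↥R₀) (c : ↥R) => edistR n R₀ j (incl h c)) C' hC (distTo (edistR n R) T hT) j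
          - infConv (fun (j : ↥R₀) (c : ↥R) => edistR n R₀ j (incl h c)) C' hC (distTo (edistR n R) T hT) k)| := by
          congr 1; ring
      _ ≤ δ * edistR n R₀ j k := by rw [abs_mul, abs_of_nonneg hδ0]; exact mul_le_mul_of_nonneg_left h1 hδ0
  · rw [dif_neg hC, dif_neg hC, sub_self, abs_zero]
    exact mul_nonneg hδ0 (edistR_nonneg _ _)

/-- on the collar the extraction weight is below `ψ − δr`. [folklore] -/
theorem phiW_le_on_collar (h : R ⊆ R₀) {δ : ℝ} (hδ0 : 0 ≤ δ) (r lo : ℝ) (C' T : Finset ↥R) (hT : T.Nonempty)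
    {x : ↥R} (hx : x ∈ C') : phiW n h δ r lo C' T hT (incl h x) ≤ ctw n R δ T hT x - δ * r := by
  have hC : C'.Nonempty := ⟨x, hx⟩
  unfold phiW
  rw [dif_pos hC]
  have h1 := infConv_le (fun (j : ↥R₀) (c : ↥R) => edistR n R₀ j (incl h c)) hC (distTo (edistR n R) T hT)
    (incl h x) hx
  rw [edistR_self, add_zero] at h1
  unfold ctw
  linarith [mul_le_mul_of_nonneg_left h1 hδ0]

/-- **LOWER BOUND OF THE EXTRACTION WEIGHT ON `supp f`**:
`φ(x̂) ≥ δ(D + ρ − r − 6)/2` for `x ∈ supp f`, where `D = dist_η(supp f, supp f')`, `ρ = bdist f`, `r = bdist f'`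
(triangle inequalities through the minimising collar point). [folklore] -/
theorem lo_le_phiW (h : R ⊆ R₀) (hout : (outR R R₀).Nonempty) {δ : ℝ} (hδ0 : 0 ≤ δ) (f f' : ↥R → ℝ)
    (hT : (supp f').Nonempty) {x : ↥R} (hx : x ∈ supp f) :
    δ * ((suppDist n R f f' + bdist n h f - bdist n h f' - 6) / 2)
      ≤ phiW n h δ (bdist n h f') (δ * ((suppDist n R f f' + bdist n h f - bdist n h f' - 6) / 2))
        (collar n h hout) (supp f') hT (incl h x) := by
  unfold phiW
  by_cases hC : (collar n h hout).Nonempty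
  · rw [dif_pos hC]
    obtain ⟨c, hc, hmin⟩ := exists_infConv_eq (fun (j : ↥R₀) (c : ↥R) => edistR n R₀ j (incl h c)) hC
      (distTo (edistR n R) (supp f') hT) (incl h x)
    rw [hmin]
    obtain ⟨t, ht, htmin⟩ := Finset.exists_mem_eq_inf' hT fun t => edistR n R c t
    have hct : distTo (edistR n R) (supp f') hT c = edistR n R c t := htmin
    rw [hct]
    obtain ⟨z, hz, hzmin⟩ := exists_dout_eq (n := n) hout (incl h c)
    have hc3 : dout n hout (incl h c) ≤ 3 := mem_collar.1 hc
    -- the three lower bounds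
    have hD : suppDist n R f f' ≤ edistR n R c t + edistR n R₀ (incl h x) (incl h c) := by
      calc suppDist n R f f' ≤ edistR n R x t := suppDist_le f f' hx ht
        _ ≤ edistR n R x c + edistR n R c t := edistR_triangle x c t
        _ = edistR n R c t + edistR n R₀ (incl h x) (incl h c) := by rw [edistR_incl]; ring
    have hr : bdist n h f' ≤ edistR n R c t + 3 := by
      calc bdist n h f' ≤ edistR n R₀ (incl h t) z := bdist_le h f' ht hz
        _ ≤ edistR n R₀ (incl h t) (incl h c) + edistR n R₀ (incl h c) z := edistR_triangle _ _ _
        _ ≤ edistR n R c t + 3 := by rw [edistR_incl, edistR_comm, ← hzmin]; linarith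
    have hρ : bdist n h f ≤ edistR n R₀ (incl h x) (incl h c) + 3 := by
      calc bdist n h f ≤ edistR n R₀ (incl h x) z := bdist_le h f hx hz
        _ ≤ edistR n R₀ (incl h x) (incl h c) + edistR n R₀ (incl h c) z := edistR_triangle _ _ _
        _ ≤ _ := by rw [← hzmin]; linarith
    have key : (suppDist n R f f' + bdist n h f - bdist n h f' - 6) / 2
        ≤ edistR n R c t + edistR n R₀ (incl h x) (incl h c) - bdist n h f' := by linarith
    have := mul_le_mul_of_nonneg_left key hδ0
    linarith
  · rw [dif_neg hC]

/-- **LOWER BOUND OF THE SOURCE WEIGHT NEAR THE COLLAR**: for `x ∈ supp f` within `dist_η ≤ 1` of the collar,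
`ψ(x) = δ·dist_η(x, supp f') ≥ δ(D + r + ρ − 8)/2`. [folklore] -/
theorem lo₂_le_ctw (h : R ⊆ R₀) (hout : (outR R R₀).Nonempty) {δ : ℝ} (hδ0 : 0 ≤ δ) (f f' : ↥R → ℝ)
    (hT : (supp f').Nonempty) {x y : ↥R} (hx : x ∈ supp f) (hy : y ∈ collar n h hout) (hxy : edistR n R x y ≤ 1) :
    δ * ((suppDist n R f f' + bdist n h f' + bdist n h f - 8) / 2) ≤ ctw n R δ (supp f') hT x := by
  obtain ⟨t, ht, htmin⟩ := Finset.exists_mem_eq_inf' hT fun t => edistR n R x t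
  have hxt : ctw n R δ (supp f') hT x = δ * edistR n R x t := by unfold ctw distTo; rw [htmin]
  rw [hxt]
  obtain ⟨z, hz, hzmin⟩ := exists_dout_eq (n := n) hout (incl h y)
  have hy3 : dout n hout (incl h y) ≤ 3 := mem_collar.1 hy
  have hD : suppDist n R f f' ≤ edistR n R x t := suppDist_le f f' hx ht
  have hxz : edistR n R₀ (incl h x) z ≤ 4 := by
    calc edistR n R₀ (incl h x) z ≤ edistR n R₀ (incl h x) (incl h y) + edistR n R₀ (incl h y) z := edistR_triangle _ _ _
      _ ≤ 1 + 3 := by rw [edistR_incl, ← hzmin]; exact add_le_add hxy hy3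
      _ = 4 := by norm_num
  have hr : bdist n h f' ≤ edistR n R x t + 4 := by
    calc bdist n h f' ≤ edistR n R₀ (incl h t) z := bdist_le h f' ht hz
      _ ≤ edistR n R₀ (incl h t) (incl h x) + edistR n R₀ (incl h x) z := edistR_triangle _ _ _
      _ ≤ edistR n R x t + 4 := by rw [edistR_incl, edistR_comm]; linarith
  have hρ : bdist n h f ≤ 4 := (bdist_le h f hx hz).trans hxz
  have key : (suppDist n R f f' + bdist n h f' + bdist n h f - 8) / 2 ≤ edistR n R x t := by linarith
  exact mul_le_mul_of_nonneg_left key hδ0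

end Geometry

/-! ## §9  B4 Corollary 2.3, the `δG_k(Ω,Ω₀,A)` clause, at `A = 0` -/

section Final

variable {n : ℕ} {R R₀ : Finset (Fin (d + 1) → ℤ)} {a m2 : ℝ}

/-- **THE CORE ESTIMATE** (non-degenerate case `R₀∖R ≠ ∅`, `f' ≠ 0`): with the cutoff of §8 and `δ` admissible,
`Σ_{x∈supp f} X(x)² ≤ 2e^{10δ}e^{−δ(D + ρ + r)}·K(d,a)·‖f'‖²` for `X ∈ {δG g', D_μ δG g'}`, `g' ∈ {f', D_ν^⊤f'}`,
`D = dist_η(supp f, supp f')`, `ρ = bdist f`, `r = bdist f'`. [cite: CombesThomas1973, §II] [folklore] -/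
theorem core_setSq (hn : 1 ≤ n) (hR : IsBlockUnion n R) (hR₀ : IsBlockUnion n R₀) (h : R ⊆ R₀) (ha : 0 < a)
    (hm : 0 ≤ m2) {δ : ℝ} (hδ0 : 0 ≤ δ) (hδ1 : δ ≤ 1)
    (hsmall : 2 * ((d : ℝ) + 1) * δ ^ 2 + a * (Real.exp δ - 1) ≤ min 2 a / 2)
    (hout : (outR R R₀).Nonempty) (f f' : ↥R → ℝ) (hT : (supp f').Nonempty) (g' : ↥R → ℝ)
    (hg' : g' = f' ∨ ∃ ν, g' = fdiffT n R ν f') :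
    (∑ x ∈ supp f, dG n a m2 h g' x ^ 2
        ≤ 2 * Real.exp (10 * δ) * Real.exp (-(δ * (suppDist n R f f' + bdist n h f + bdist n h f')))
          * KC d a * ∑ x, f' x ^ 2)
    ∧ ∀ μ, ∑ x ∈ supp f, fdiff n R μ (dG n a m2 h g') x ^ 2
        ≤ 2 * Real.exp (10 * δ) * Real.exp (-(δ * (suppDist n R f f' + bdist n h f + bdist n h f')))
          * KC d a * ∑ x, f' x ^ 2 := by
  have hK := (KC_pos d ha).le
  have hF0 : 0 ≤ ∑ x, f' x ^ 2 := Finset.sum_nonneg fun _ _ => sq_nonneg _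
  have hM := master_setSq_le hn hR hR₀ h ha hm (r := bdist n h f')
    (lo := δ * ((suppDist n R f f' + bdist n h f - bdist n h f' - 6) / 2))
    (lo₂ := δ * ((suppDist n R f f' + bdist n h f' + bdist n h f - 8) / 2)) hδ0 hδ1 hsmall
    (cutF n h hout) (cutF_nonneg h hout) (cutF_le_one h hout) (abs_cutF_sub_le h hout)
    (fun y hy => cutF_eq_zero_of_mem_bdR hn h hout hy) (collar n h hout)
    (fun x y hxy hj => mem_collar_of_jump hn h hout hxy hj) (fun x hx => mem_collar_of_cutF_ne_one hn h hout hx)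
    f' hT (phiW n h δ (bdist n h f') (δ * ((suppDist n R f f' + bdist n h f - bdist n h f' - 6) / 2))
      (collar n h hout) (supp f') hT)
    (abs_phiW_sub_le h hδ0 _ _ _ _ hT) (fun x hx => phiW_le_on_collar h hδ0 _ _ _ _ hT hx) (supp f)
    (fun x hx => lo_le_phiW h hout hδ0 f f' hT hx)
    (fun x hx y hy hxy => lo₂_le_ctw h hout hδ0 f f' hT hx hy hxy) g' hg'
  have hΦ : Real.exp (-(2 * (δ * ((suppDist n R f f' + bdist n h f' + bdist n h f - 8) / 2))))
      + Real.exp (4 * δ - 2 * (δ * bdist n h f'))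
        * Real.exp (-(2 * (δ * ((suppDist n R f f' + bdist n h f - bdist n h f' - 6) / 2))))
      ≤ 2 * Real.exp (10 * δ) * Real.exp (-(δ * (suppDist n R f f' + bdist n h f + bdist n h f'))) := by
    have eR : 2 * Real.exp (10 * δ) * Real.exp (-(δ * (suppDist n R f f' + bdist n h f + bdist n h f')))
        = 2 * Real.exp (10 * δ + -(δ * (suppDist n R f f' + bdist n h f + bdist n h f'))) := by
      rw [mul_assoc, ← Real.exp_add]
    rw [eR, ← Real.exp_add]
    have e2 : 4 * δ - 2 * (δ * bdist n h f')
          + -(2 * (δ * ((suppDist n R f f' + bdist n h f - bdist n h f' - 6) / 2)))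
        = 10 * δ + -(δ * (suppDist n R f f' + bdist n h f + bdist n h f')) := by ring
    have e1 : -(2 * (δ * ((suppDist n R f f' + bdist n h f' + bdist n h f - 8) / 2)))
        = 8 * δ + -(δ * (suppDist n R f f' + bdist n h f + bdist n h f')) := by ring
    rw [e1, e2]
    have : Real.exp (8 * δ + -(δ * (suppDist n R f f' + bdist n h f + bdist n h f')))
        ≤ Real.exp (10 * δ + -(δ * (suppDist n R f f' + bdist n h f + bdist n h f'))) :=
      Real.exp_le_exp.2 (by linarith)
    linarith
  have hΦK := mul_le_mul_of_nonneg_right (mul_le_mul_of_nonneg_right hΦ hK) hF0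
  exact ⟨hM.1.trans hΦK, fun μ => (hM.2 μ).trans hΦK⟩

/-- extension by zero to the same region is the identity. [folklore] -/
theorem extTo_self (g : ↥R → ℝ) : extTo R g = g := by
  funext y
  unfold extTo
  rw [extR_of_mem g y.2]

/-- restriction along `R ⊆ R` is the identity. [folklore] -/
theorem resTo_self (h : R ⊆ R) (U : ↥R → ℝ) : resTo h U = U := by
  funext x
  rfl

/-- **`δG_k(Ω,Ω,0) = 0`**. [cite: Balaban1983RegularityDecay, p. 573 (1.11)] -/
theorem dG_self (h : R ⊆ R) (g : ↥R → ℝ) : dG n a m2 h g = 0 := by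
  unfold dG
  rw [extTo_self, resTo_self, sub_self]

/-- extension of the zero function. [folklore] -/
theorem extTo_zero (R₀ : Finset (Fin (d + 1) → ℤ)) : extTo R₀ (0 : ↥R → ℝ) = 0 := by
  funext y
  unfold extTo extR
  split_ifs <;> rfl

/-- `δG 0 = 0`. [folklore] -/
theorem dG_zero (h : R ⊆ R₀) : dG n a m2 h (0 : ↥R → ℝ) = 0 := by
  unfold dG
  rw [extTo_zero, Matrix.mulVec_zero, Matrix.mulVec_zero]
  funext x
  simp [resTo]

/-- **THE CONSTANT `c₁` OF THE `δG` CLAUSE AT `A = 0`, EXPLICIT**: `c₁(d,a) = √(2e^{10}K(d,a))` with `K` the master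
constant of §7 (a rational function of `d`, `a`, `min(2,a)`) — depends on `d` and `a` only.
[cite: Balaban1983RegularityDecay, p. 581, Corollary 2.3, δG clause, case A = 0] -/
def c1 (d : ℕ) (a : ℝ) : ℝ := Real.sqrt (2 * Real.exp 10 * KC d a)

/-- `c₁ ≥ 0`. [folklore] -/
theorem c1_nonneg (d : ℕ) (a : ℝ) : 0 ≤ c1 d a := Real.sqrt_nonneg _

/-- `‖f‖₂ ≥ 0`. [folklore] -/
theorem l2n_nonneg' (f : ↥R → ℝ) : 0 ≤ l2n f := Real.sqrt_nonneg _

/-- **B4 COROLLARY 2.3, THE `δG_k(Ω,Ω₀,A)` CLAUSE, AT `A = 0`** — «The same inequalities hold for δG_k(Ω,Ω₀,A) with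
the additional factor e^{−δ₀(dist(supp f,Ω^c) + dist(supp f',Ω^c))}» (p. 581), with «δG_k(Ω,Ω₀,A) = G_k(Ω,A) −
G_k(Ω₀,A)» (p. 573 (1.11)), here for `Ω ⊆ Ω₀` finite unions of blocks at zero field: for EVERY mesh `η = 1/n`, EVERY
pair `R ⊆ R₀` of unions of `n`-blocks, EVERY mass `m² ≥ 0`, every `f, f'` on `R` and all directions `μ, ν`, the four
pairings of `δG = G_R − res∘G_{R₀}∘ext` obey
`|⟨f, X⟩| ≤ c₁(d,a)·exp(−(δ₀/2)(dist_η(supp f,supp f') + bdist f + bdist f'))·‖f‖₂‖f'‖₂`,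
`X ∈ {δG f', D_μ δG f', δG D_ν^⊤ f', D_μ δG D_ν^⊤ f'}` (the `D_μ = fdiff n R μ`, `D_ν^⊤ = fdiffT n R ν` here are the
difference operators on the bonds of `Ω` — both `f, f'` live on `Ω`), with the EXPLICIT `δ₀(d,a) = min(2,a)/(4(d+1+a))`
of Module 1 and `bdist = dist_η(supp ·, Ω₀∖Ω) ≥ dist(supp ·, Ω^c)`.  (Rate `δ₀/2`: the printed Corollary asserts SOME
positive `c₀, δ₀`; Module 1's main clause holds a fortiori with `δ₀/2`.)
[cite: Balaban1983RegularityDecay, p. 580–581 Corollary 2.3 (2.30) and the δG clause, case A = 0] -/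
theorem dcor23_zeroField (hn : 1 ≤ n) (hR : IsBlockUnion n R) (hR₀ : IsBlockUnion n R₀) (h : R ⊆ R₀)
    (ha : 0 < a) (hm : 0 ≤ m2) (f f' : ↥R → ℝ) (μ ν : Fin (d + 1)) :
    |f ⬝ᵥ dG n a m2 h f'|
        ≤ c1 d a * Real.exp (-(delta0 d a / 2 * (suppDist n R f f' + bdist n h f + bdist n h f')))
          * l2n f * l2n f'
    ∧ |f ⬝ᵥ fdiff n R μ (dG n a m2 h f')|
        ≤ c1 d a * Real.exp (-(delta0 d a / 2 * (suppDist n R f f' + bdist n h f + bdist n h f')))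
          * l2n f * l2n f'
    ∧ |f ⬝ᵥ dG n a m2 h (fdiffT n R ν f')|
        ≤ c1 d a * Real.exp (-(delta0 d a / 2 * (suppDist n R f f' + bdist n h f + bdist n h f')))
          * l2n f * l2n f'
    ∧ |f ⬝ᵥ fdiff n R μ (dG n a m2 h (fdiffT n R ν f'))|
        ≤ c1 d a * Real.exp (-(delta0 d a / 2 * (suppDist n R f f' + bdist n h f + bdist n h f')))
          * l2n f * l2n f' := by
  classical
  obtain ⟨h0, h1, hsmall⟩ := delta0_admissible d ha
  have hnn : 0 ≤ c1 d a * Real.exp (-(delta0 d a / 2 * (suppDist n R f f' + bdist n h f + bdist n h f')))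
          * l2n f * l2n f' := by
    have := c1_nonneg d a
    have := l2n_nonneg' f
    have := l2n_nonneg' f'
    positivity
  by_cases hout : (outR R R₀).Nonempty
  · by_cases hT : (supp f').Nonempty
    · have hC : 0 ≤ c1 d a * Real.exp (-(delta0 d a / 2 * (suppDist n R f f' + bdist n h f + bdist n h f'))) := by
        have := c1_nonneg d a
        positivity
      have key : ∀ X : ↥R → ℝ, ∑ x ∈ supp f, X x ^ 2
          ≤ (c1 d a * Real.exp (-(delta0 d a / 2 * (suppDist n R f f' + bdist n h f + bdist n h f')))) ^ 2
            * ∑ x, f' x ^ 2 →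
          |f ⬝ᵥ X| ≤ c1 d a * Real.exp (-(delta0 d a / 2 * (suppDist n R f f' + bdist n h f + bdist n h f')))
          * l2n f * l2n f' :=
        fun X hX => abs_dot_le_of_setSq f X (supp f) (eq_zero_of_not_mem_supp f) hC hX
      have hKpos := KC_pos d ha
      have hsq : (c1 d a * Real.exp (-(delta0 d a / 2 * (suppDist n R f f' + bdist n h f + bdist n h f')))) ^ 2
          = 2 * Real.exp 10 * KC d a * Real.exp (-(delta0 d a * (suppDist n R f f' + bdist n h f + bdist n h f'))) := by
        rw [mul_pow, c1, Real.sq_sqrt (by positivity), sq, ← Real.exp_add]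
        congr 1; ring
      have hup : 2 * Real.exp (10 * delta0 d a)
            * Real.exp (-(delta0 d a * (suppDist n R f f' + bdist n h f + bdist n h f'))) * KC d a * ∑ x, f' x ^ 2
          ≤ (c1 d a * Real.exp (-(delta0 d a / 2 * (suppDist n R f f' + bdist n h f + bdist n h f')))) ^ 2
            * ∑ x, f' x ^ 2 := by
        rw [hsq]
        have h10 : Real.exp (10 * delta0 d a) ≤ Real.exp 10 := Real.exp_le_exp.2 (by nlinarith)
        have hF0 : 0 ≤ ∑ x, f' x ^ 2 := Finset.sum_nonneg fun _ _ => sq_nonneg _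
        have he : 0 ≤ Real.exp (-(delta0 d a * (suppDist n R f f' + bdist n h f + bdist n h f'))) :=
          (Real.exp_pos _).le
        have t := mul_le_mul_of_nonneg_right (mul_le_mul_of_nonneg_right
          (mul_le_mul_of_nonneg_left h10 (by norm_num : (0 : ℝ) ≤ 2)) he) hKpos.le
        calc _ ≤ 2 * Real.exp 10
              * Real.exp (-(delta0 d a * (suppDist n R f f' + bdist n h f + bdist n h f'))) * KC d a
              * ∑ x, f' x ^ 2 := mul_le_mul_of_nonneg_right t hF0
          _ = _ := by ring
      have cA := core_setSq hn hR hR₀ h ha hm h0 h1 hsmall hout f f' hT f' (Or.inl rfl)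
      have cB := core_setSq hn hR hR₀ h ha hm h0 h1 hsmall hout f f' hT (fdiffT n R ν f') (Or.inr ⟨ν, rfl⟩)
      exact ⟨key _ (cA.1.trans hup), key _ ((cA.2 μ).trans hup), key _ (cB.1.trans hup),
        key _ ((cB.2 μ).trans hup)⟩
    · -- `f' = 0`: everything vanishes
      have hf' : f' = 0 := by
        funext x
        exact eq_zero_of_not_mem_supp f' x (fun hx => hT ⟨x, hx⟩)
      subst hf'
      simp only [dG_zero, fdiffT_zero, fdiff_zero, dotProduct_zero, abs_zero]
      exact ⟨hnn, hnn, hnn, hnn⟩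
  · -- `R₀ = R`: `δG = 0`
    have hsub : R₀ ⊆ R := by
      intro z hz
      by_contra hzR
      exact hout ⟨⟨z, hz⟩, mem_outR.2 hzR⟩
    have hEq : R₀ = R := Finset.Subset.antisymm hsub h
    subst hEq
    simp only [dG_self, fdiff_zero, dotProduct_zero, abs_zero]
    exact ⟨hnn, hnn, hnn, hnn⟩

/-- the fine region is monotone in the set of unit labels. [folklore] -/
theorem fineDom_mono (hn : 1 ≤ n) {Ω Ω₀ : Finset (Fin (d + 1) → ℤ)} (hΩ : Ω ⊆ Ω₀) : fineDom n Ω ⊆ fineDom n Ω₀ := by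
  intro x hx
  rw [mem_fineDom hn] at hx ⊢
  exact hΩ hx

/-- **ON THE FINE REGIONS OVER FINITE SETS OF UNIT LABELS `Ω ⊆ Ω₀`** (`R = fineDom n Ω ⊆ R₀ = fineDom n Ω₀`): the
same statement, hypothesis-free in `Ω ⊆ Ω₀`. [cite: Balaban1983RegularityDecay, p. 580–581 Corollary 2.3, δG
clause, case A = 0] -/
theorem dcor23_zeroField_fineDom (hn : 1 ≤ n) {Ω Ω₀ : Finset (Fin (d + 1) → ℤ)} (hΩ : Ω ⊆ Ω₀) (ha : 0 < a)
    (hm : 0 ≤ m2) (f f' : ↥(fineDom n Ω) → ℝ) (μ ν : Fin (d + 1)) :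
    |f ⬝ᵥ dG n a m2 (fineDom_mono hn hΩ) f'|
        ≤ c1 d a * Real.exp (-(delta0 d a / 2 * (suppDist n (fineDom n Ω) f f'
            + bdist n (fineDom_mono hn hΩ) f + bdist n (fineDom_mono hn hΩ) f'))) * l2n f * l2n f'
    ∧ |f ⬝ᵥ fdiff n (fineDom n Ω) μ (dG n a m2 (fineDom_mono hn hΩ) f')|
        ≤ c1 d a * Real.exp (-(delta0 d a / 2 * (suppDist n (fineDom n Ω) f f'
            + bdist n (fineDom_mono hn hΩ) f + bdist n (fineDom_mono hn hΩ) f'))) * l2n f * l2n f'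
    ∧ |f ⬝ᵥ dG n a m2 (fineDom_mono hn hΩ) (fdiffT n (fineDom n Ω) ν f')|
        ≤ c1 d a * Real.exp (-(delta0 d a / 2 * (suppDist n (fineDom n Ω) f f'
            + bdist n (fineDom_mono hn hΩ) f + bdist n (fineDom_mono hn hΩ) f'))) * l2n f * l2n f'
    ∧ |f ⬝ᵥ fdiff n (fineDom n Ω) μ (dG n a m2 (fineDom_mono hn hΩ) (fdiffT n (fineDom n Ω) ν f'))|
        ≤ c1 d a * Real.exp (-(delta0 d a / 2 * (suppDist n (fineDom n Ω) f f'
            + bdist n (fineDom_mono hn hΩ) f + bdist n (fineDom_mono hn hΩ) f'))) * l2n f * l2n f' :=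
  dcor23_zeroField hn (fineDom_isBlockUnion hn Ω) (fineDom_isBlockUnion hn Ω₀) (fineDom_mono hn hΩ) ha hm f f' μ ν

/-- Sanity instance (non-vacuity, explicit rate): in dimension `d + 1 = 4`, at `a = 1` (`δ₀ = 1/20`, rate
`δ₀/2 = 1/40`), mesh `η = 1/8`, mass `m² = 3`, for EVERY pair `Ω ⊆ Ω₀ ⊂ ℤ⁴` of finite sets of unit labels and every
`f, f'` on the fine region of `Ω`:
`|⟨f, D_0 δG D_1^⊤ f'⟩| ≤ c₁(3,1)·e^{−(dist_η(supp f,supp f') + bdist f + bdist f')/40}‖f‖₂‖f'‖₂`. -/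
example (Ω Ω₀ : Finset (Fin 4 → ℤ)) (hΩ : Ω ⊆ Ω₀) (f f' : ↥(fineDom 8 Ω) → ℝ) :
    |f ⬝ᵥ fdiff 8 (fineDom 8 Ω) 0
        (dG (d := 3) 8 1 3 (fineDom_mono (by norm_num) hΩ) (fdiffT 8 (fineDom 8 Ω) 1 f'))|
      ≤ c1 3 1 * Real.exp (-((1 / 40) * (suppDist 8 (fineDom 8 Ω) f f'
          + bdist 8 (fineDom_mono (by norm_num) hΩ) f + bdist 8 (fineDom_mono (by norm_num) hΩ) f')))
        * l2n f * l2n f' := by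
  have h := (dcor23_zeroField_fineDom (d := 3) (m2 := 3) (by norm_num) hΩ one_pos (by norm_num) f f' 0 1).2.2.2
  have hd : delta0 3 1 / 2 = 1 / 40 := by
    unfold delta0; rw [min_eq_right (by norm_num : (1 : ℝ) ≤ 2)]; norm_num
  rwa [hd] at h

end Final

end

end Literature.MathematicalPhysics.QuantumFieldTheory.Balaban1983to89.B4Cor23ZeroDelta
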